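import Summits.HodgeConjecture.HodgeConjecture.Cruxes.BlochSeedDiscOne.RingTwoMassLaw

/-!
# Shell-3 face of the dual certificate family, I: THE PAIR LAW, THE MIXED LAW, the SIGN TRICHOTOMY and the HH-CORNER LAW

`line stmt-HodgeConjecture-18881 Cruxes/BlochSeedDiscOne/Lines/birth.lean 814a6a70c14e831a stub_rung_pad4_seedAt`
(plan-lens-HodgeAV-dual g16, 2026-08-31).  KERNEL STATEMENTS ONLY — no `sorry`, no new axiom, no `instance`, no `notation`,
no `native_decide`.  **Nothing here is proved toward HC / HC_CM / HC_AV / №4 / 26512 / 18881 / H2**: these are identities and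
dichototmies satisfied by every (A1)-clean two-term design; they are the shell-3 (indeed every-shell) siblings of the ring-2
`six_E` ∕ `door_law` ∕ `lattice_law` of `RingTwoMassLaw.ClassLaw`, typed for the director's order (S3-1)(a) [bus R19.684].

## §1–§3 THE PAIR LAW (clause 2 of (A1) only; every height `h`, every ring, every room)

For a letter `ℓ = (a; x, y)` put `q_h(ℓ) := selfInt − 2h·a + h² = (h − a)² − |β|²`; on the height-`h` alphabet `q_h(ℓ) = 2|x||y|`
(`qv_eq`): it vanishes on axis letters and is `2, 4` on the ring-3 letters `B = (h−2; ±1, ±1)`, `D = (h−3; ±2, ±1), (h−3; ±1, ±2)`.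
For ANY two slots `g ≠ g'`:

  `E_h(D) := (Σ_N − Σ_P) m·∏_f (h − a_f)  =  (Σ_N − Σ_P) m · q_h(c_g)·q_h(c_{g'})`        (`pair_law`)

i.e. on the alphabet `E = 4·(k^N(g,g') − k^P(g,g'))` with the PAIR MASS `k^X(g,g') := Σ_X m·|x_g y_g|·|x_{g'} y_{g'}|`
(`pair_law_alphabet`; at ring 3: `k = m(BB@gg') + 2·m(BD@gg') + 4·m(DD@gg')`).  Reason: under clause 2 the class tensor of an
e-free word depends only on its degree, and both `∏_f (h·1 − h_f)` and `q_g ⊗ q_{g'} ⊗ 1 ⊗ 1` (`q = pt − 2h·h + h²·1`) collapse to the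
same binomial `t₄ − 4h t₃ + 6h² t₂ − 4h³ t₁ + h⁴ t₀`.  At ring 2 this is `6E = −4·m_P(HHDD)` = `six_E ∘ huuD_law`; at ring 3 it is
the law the director asked for: **the P-side pair mass at ONE slot pair is `k^P(g,g') = k^N(g,g') − E/4`, the same at all six pairs,
and `k^P ≡ k^N (mod 2)`** (`two_dvd_pairMass_sub`, from `8 ∣ E` = `lattice_digits`).

## §4 THE SIGNED-CLASS TRICHOTOMY (clause 1 of (A1) + alphabet parity; every height)

With `CS_k` the cube functional of `ClassLaw` (`cube_law`: `2·CS_k = 2E − Re(i^{Σk} μ)`), the four class values are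
`CS₀ = E − Re μ/2`, `CS₂ = E + Re μ/2`, `CS₁ = E + Im μ/2`, `CS₃ = E − Im μ/2` (`four_CS`), all in `16ℤ`, and `CS_k` depends only on
`Σk mod 4` (`CS_class`).  Hence for `μ ≠ 0`:
* `signed_class`: some class is `≥ 16` or some class is `≤ −16`;
* `posClass_or`: (some class `≥ 16`) ∨ `E ≤ −8` — and `E ≤ −8` reads `k^P(g,g') ≥ k^N(g,g') + 2` at EVERY slot pair (pair law);
* `negClass_or`: (some class `≤ −16`) ∨ `E ≥ 8` — and `E ≥ 8` reads `k^N(g,g') ≥ k^P(g,g') + 2` at every slot pair;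
* `posClass_meets` ∕ `negClass_meets`: a class `≥ 16` (`≤ −16`) forces an N-cell (a P-cell) of positive cube weight — hence hub-free
  (`colevel_pos_of_cubeZ_pos`) — in EVERY one of the 64 cubes of that class.
So every charged design either spreads hub-free N-cells over a whole class of 64 cubes, or carries `≥ 2` units of off-axis P pair
mass at each of the six slot pairs (and dually with N ∕ P exchanged).  The ring-2 door shut both options by `cover_le_six` +
`heavy_point` resp. `12 ∣ m_P(HHDD)`; what each option costs at ring 3 is priced in the companion memo `DUAL-CERT-FAMILY-g16.md`.

## §3b THE MIXED LAW.  Under clause 2 a per-slot e-free factor of degree `d ∈ {0,1,2}` stands for `(h − z)^d`, so the THREE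
degree-4 shapes `(1,1,1,1) = ∏ col`, `(2,2,0,0) = q_g q_{g'}`, `(2,1,1,0) = q_k col_f col_g` all have signed moment `E`
(`mid_law`; on the alphabet `E = 2·(τ^N − τ^P)(k;f,g)`, `τ^X := Σ_X m·|x_k y_k|·col_f·col_g`, `mid_law_alphabet`) — nineteen
termwise-nonnegative functionals (1 + 6 + 12) with ONE common signed value `E ∈ 8ℤ`.

## §5 SIGN TRICHOTOMY + Branch-B interface.  `E` is by definition negation's `BoxIdentity.Sigma` (`dep = rho = ∏ (h − a_f)`), so
`BoxIdentity.branchB_bound` feeds `pPairs_of_branchB` verbatim: Branch B ⇒ `k^P ≥ k^N + 2` at all six slot pairs (and a full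
class of cubes met by hub-free P-cells, `pCover_of_branchB`).  `sign_trichotomy`: `E > 0` ⇒ N-cover ∧ N-pairs; `E < 0` ⇒ P-cover ∧
P-pairs; `E = 0` ⇒ N-cover ∧ P-cover ∧ equal pair masses.  HEIGHT- AND SHELL-FREE throughout (R19.685 (1)): hypotheses of
§1–§6 are `OnAlphabet h`, (A1) (clause 1 via `A1e`, clause 2 via `Tz_eq_of_A1`) and `μ ≠ 0` only — no `Disj`, no Rule D, no ring,
no budget.  §6 CARRIERS turns the mass inequalities into supported cells (`pCarrier_of_E_le`, `pCarrier_of_branchB`, …).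

## §7 THE HH-CORNER LAW (v5; + coarse RULE D of the statement of record + `Disj`; still height- and shell-free).  On the
alphabet a letter equal to or a null step below an OFF-AXIS letter (`x ≠ 0 ∧ y ≠ 0`) is off-axis (`offAxis_of_le`), so RULE D's
two clauses chase each other inside the pair-carriers of a fixed slot pair and stop only at a P-carrier whose complementary
pair is the HUB pair (`hhCornerP`, `hhCorner_of_pCarrier` — the off-axis twin of `LeggedFloor.hubCornerP`).  **Branch B ⇒ for
EACH of the six slot pairs a supported P-cell off-axis on the pair and `(h;0,0)` on the complementary pair** (`hhCorner_of_branchB`)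
— six pairwise distinct P-cells (`ne_of_offAxis_of_hub`), at co-level `≤ 3` of types `BBHH ∕ BDHH ∕ DDHH` placed on the pair
(`two_le_colevel_of_offAxis`, `eq_hub_of_not_lt`) — **and each of them forces two supported N-cells differing from it by ONE strict
null step at one pair slot** (`edgeN_of_hub`, `hhCorner_edges_of_branchB`; the stepped letter stays charged, `nullStep_offAxis_lt`):
twelve pairwise distinct N-cells charged exactly on a slot pair.  This NAMES the surviving P-configuration of Branch B′ asked for
in R19.688 (D-B′): whatever else it contains, its P-support contains the six HH-CORNERS and its N-support their twelve EDGES.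

## §8 THE SHAPE LAWS (v6; clause 2 of (A1) only; every height, every ring, every placement).  A per-slot e-free factor `1`,
`h − a`, `q_h` stands for `(h − z)^0, (h − z)^1, (h − z)^2` under clause 2, so EVERY product shape of total shifted degree `D` has the
same signed moment `Φ_D = Σ_n (−1)^n C(D,n) h^{D−n} t_n` (`Phi1 … Phi7`; `Φ_4 = E` by `E_expand`), whatever the shape and the placement
`σ : Equiv.Perm (Fin 4)` (`shXXXX_moment`, ten shapes of degrees 1–3 and 5–7; the three degree-4 shapes are §1–§3b).  On the alphabet
(`qv = 2|x||y|`, `h − a = col`): `slot_law` (D=1), `degTwo_law` (`2·Σ±m|xy|_g = Σ±m col_f col_{g'}`), `degThree_law`, `degFive_law`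
(`4·Σ±m|xy|_g|xy|_j col_k = 2·Σ±m|xy|_g col_j col_k col_l`), **`degSix_law`** (`8·Σ±m|xy|_g|xy|_j|xy|_k = 4·Σ±m|xy|_g|xy|_j col_k col_l`
— the kernel form of anomaly g16's «b-law»: at shell 3 it reads `m_P(BBuu@pair) = 2·m_P(BBBH@triple)` uniformly), `degSeven_law`.

## §9 THE DECORATED e-ROW LAW (v7; clause 1 of (A1) only; every height, every ring, every placement).  Clause 1 kills every
e-mixed word except `eeee ∕ ēēēē`, so for every decoration pattern `p : Fin 4 → DS` (`E ↦ β̄`, `Eb ↦ β`, `Q ↦ q_h`, `C ↦ h − a`,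
`I ↦ 1`) with an `e/ē` slot, not constantly `e` nor constantly `ē`, the N- and P-moments of `∏_f dval (p f)` are EQUAL
(`decorated_row_law`, `decorated_row_law_perm`, instances `phase_rows`; built on `CI.expand ∕ CI.collapse` of `RingTwoMassLaw`).
These PHASE ROWS are invisible to every type-level LP and not implied by the cube laws.  Shell-3 reading on the fine room (memo):
`(e,ē,Q,Q) ∕ (e,e,Q,Q) ∕ (e,C,Q,Q)` have N-side ZERO and P-side the `BBuu` cells of the pair only ⇒ the `BBuu` masses at each pair are
phase-balanced in each complementary slot and in both products ⇒ `4 ∣ m_P(BBuu@pair)`, i.e. the b-law's `b` is EVEN, and `b ≥ 2`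
costs ≥ 4 distinct `BBuu` P-cells at every pair (24 in all).

## §10 THE PHASE-LATTICE LAW (v8; pure integer lemma, `omega`): an integer mass table on `μ₄ × μ₄` whose character sums at
`(1,0), (0,1), (1,1), (−1,1)` vanish has total mass `≡ 0 (mod 4)` (`phase_lattice_four`) — the abstract form of `4 ∣ m_P(BBuu@pair)`.

## §11 CONSUMER FORMS UNDER SUPPORT HYPOTHESES (v9): the shape laws as EXCLUSIONS / INEQUALITIES once a support-level fact is
known — `offaxis_triple_free` (no N off-axis triple + no «off-axis pair & charged co-pair» cell on either side ⇒ NO P off-axis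
triple: at shell 3, gs-eng-2 (B) «no P BBuu» ⇒ **no P BBBH**), `hook_slot_law` / `offaxis_pair_col_le` / `hook_equidistributed` /
`offaxis_pair_col_eq` (no N off-axis hook, gs-eng-2 (A) ⇒ P hooks slot-equidistributed and `Σ_N m a2210∘σ ≤ Σ_P m a2210∘σ` at
every placement, with equality iff P has no off-axis hook); §11b BRANCH RIDERS `pHookedHub_of_E_le` / `nHookedHub_of_le_E` (Branch β +
«every off-axis-bearing P cell has a hub» ⇒ at every (k; f,g) a P cell off-axis at k, hub-free at f,g, HUB at the fourth slot —
twelve support-level clauses; mirror for Branch α on N); §11c BRANCH-β DICHOTOMY `E_dichotomy` / `hubfreeN_of_E_eq` /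
`branchB_dichotomy` / `excess_of_E_le_sixteen` (8 ∣ E ⇒ in Branch β either E ≤ −16 — pair excess ≥ 4, mixed excess ≥ 8 everywhere —
or E = −8 and a P hub-free cover of dep-weight ≥ 9 forces a HUB-FREE N cell).  Height/shell-free; support hypotheses are binders.
-/

set_option linter.dupNamespace false
set_option autoImplicit false

namespace Summit.HodgeConjecture.HodgeConjecture.Cruxes.BlochSeedDiscOne.ShellThreePairLaw

open Summit.HodgeConjecture.HodgeConjecture.Cruxes.BlochSeedDiscOne.DepthBoundA4
open Summit.HodgeConjecture.HodgeConjecture.Cruxes.BlochSeedDiscOne.RingFourEmpty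
open Summit.HodgeConjecture.HodgeConjecture.Cruxes.BlochSeedDiscOne.RingTwoMassLaw
open Summit.HodgeConjecture.HodgeConjecture.Cruxes.BlochSeedDiscOne.RingTwoMassLaw.CI (A1e a1e_of_a1)
open Summit.HodgeConjecture.HodgeConjecture.Cruxes.BlochSeedDiscOne.RingTwoMassLaw.ClassLaw

/-! ## §1 The off-axis weight `q_h` -/

/-- `q_h(ℓ) = selfInt − 2h·a + h²` — the e-free per-slot functional `pt − 2h·h + h²·1`. -/
def qv (h : ℤ) (ℓ : Letter) : ℤ := ℓ.selfInt - 2 * h * ℓ.a + h ^ 2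

/-- on the height-`h` alphabet `q_h(ℓ) = 2|x||y|`. -/
theorem qv_eq {h : ℤ} {ℓ : Letter} (hℓ : ℓ.OnAlphabet h) : qv h ℓ = 2 * |ℓ.x| * |ℓ.y| := by
  obtain ⟨hh, _⟩ := hℓ
  unfold Letter.height at hh
  have hx : |ℓ.x| ^ 2 = ℓ.x ^ 2 := sq_abs _
  have hy : |ℓ.y| ^ 2 = ℓ.y ^ 2 := sq_abs _
  unfold qv Letter.selfInt Letter.bnorm
  have e : h = ℓ.a + |ℓ.x| + |ℓ.y| := hh.symm
  subst e
  linear_combination hx + hy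

theorem qv_nonneg {h : ℤ} {ℓ : Letter} (hℓ : ℓ.OnAlphabet h) : 0 ≤ qv h ℓ := by
  rw [qv_eq hℓ]; positivity

/-- the pair functional `σ_{g,g'} = q_h(c_g)·q_h(c_{g'})`. -/
def sig (h : ℤ) (g g' : Fin 4) (c : Cell) : ℤ := qv h (c g) * qv h (c g')

/-- the PAIR WEIGHT `|x_g y_g|·|x_{g'} y_{g'}|` (ring 3: `BB ↦ 1`, `BD ↦ 2`, `DD ↦ 4`; ring 2: `DD ↦ 1`; axis letters `↦ 0`). -/
def pw (g g' : Fin 4) (c : Cell) : ℤ := (|(c g).x| * |(c g).y|) * (|(c g').x| * |(c g').y|)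

theorem sig_eq_four_pw {h : ℤ} {c : Cell} (hc : ∀ f : Fin 4, (c f).OnAlphabet h) (g g' : Fin 4) :
    sig h g g' c = 4 * pw g g' c := by
  unfold sig pw
  rw [qv_eq (hc g), qv_eq (hc g')]
  ring

/-! ## §2 Word bookkeeping -/

/-- the word with `s` at slot `g`, `t` at slot `g'`, `1` elsewhere. -/
def wq (g g' : Fin 4) (s t : Sym) : Word := fun f => if f = g then s else if f = g' then t else Sym.one

theorem efree_wq (g g' : Fin 4) {s t : Sym} (hs : s.efree = true) (ht : t.efree = true) : (wq g g' s t).efree := by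
  intro f
  unfold wq
  split_ifs
  · exact hs
  · exact ht
  · rfl

theorem deg_wq {g g' : Fin 4} (hne : g ≠ g') (s t : Sym) : (wq g g' s t).deg = s.deg + t.deg := by
  fin_cases g <;> fin_cases g' <;> first
    | exact absurd rfl hne
    | (simp +decide [Word.deg, wq, Fin.sum_univ_four, Sym.deg]; try omega)

theorem icellCoef_wq {g g' : Fin 4} (hne : g ≠ g') (s t : Sym) (c : Cell) :
    icellCoef c (wq g g' s t) = s.icoef (c g) * t.icoef (c g') := by
  fin_cases g <;> fin_cases g' <;> first
    | exact absurd rfl hne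
    | (simp +decide [icellCoef, wq, Fin.prod_univ_four, Sym.icoef]; try ring)

/-- the four e-free words with one `h` (degree 1) and their reference word. -/
def wordsH1 : List Word :=
  [![Sym.h, Sym.one, Sym.one, Sym.one], ![Sym.one, Sym.h, Sym.one, Sym.one],
   ![Sym.one, Sym.one, Sym.h, Sym.one], ![Sym.one, Sym.one, Sym.one, Sym.h]]
/-- degree-1 reference word -/
def ref1 : Word := ![Sym.h, Sym.one, Sym.one, Sym.one]

set_option maxRecDepth 20000 in
theorem wordsH1_ok : ∀ w ∈ wordsH1, efreeB w = true ∧ Word.deg w = 1 := by decide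
theorem wordsH1_length : wordsH1.length = 4 := rfl

theorem SO_H1 (c : Cell) : SO wordsH1 c = (c 0).a + (c 1).a + (c 2).a + (c 3).a := by
  simp [SO, wordsH1, icellCoef, Fin.prod_univ_four, Sym.icoef]
  ring

theorem icellCoef_unit (c : Cell) : icellCoef c Word.unit = 1 := by
  simp [icellCoef, Word.unit, Sym.icoef]

theorem unit_efree : Word.unit.efree := fun _ => rfl

/-! ## §3 THE PAIR LAW -/

/-- binomial expansion of the depth functional into orbit sums. -/
theorem dep_expand (h : ℤ) (c : Cell) : dep h c =
    h ^ 4 * icellCoef c Word.unit - h ^ 3 * SO wordsH1 c + h ^ 2 * SO wordsHH c - h * SO wordsHHH c + SO wordsHHHH c := by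
  rw [SO_H1, SO_HH, SO_HHH, SO_HHHH, icellCoef_unit]
  simp only [dep, Fin.prod_univ_four, oHH, oHHH, oHHHH]
  ring

theorem linZ_dep (h : ℤ) (L : List (Cell × ℕ)) : linZ L (dep h) =
    h ^ 4 * linZ L (fun c => icellCoef c Word.unit) - h ^ 3 * linZ L (SO wordsH1) + h ^ 2 * linZ L (SO wordsHH)
      - h * linZ L (SO wordsHHH) + linZ L (SO wordsHHHH) := by
  induction L with
  | nil => simp [linZ]
  | cons a t ih => simp only [linZ_cons]; rw [ih, dep_expand]; ring

/-- `E = h⁴ t₀ − 4h³ t₁ + 6h² t₂ − 4h t₃ + t₄`. -/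
theorem E_expand (h : ℤ) (D : Design) (h1 : D.A1) : E h D =
    h ^ 4 * D.Tz Word.unit - 4 * h ^ 3 * D.Tz ref1 + 6 * h ^ 2 * D.Tz ref2 - 4 * h * D.Tz ref3 + D.Tz ref4 := by
  have r1 := orbit_row D h1 ref1 (by decide) 1 (by decide) wordsH1 wordsH1_ok
  have r2 := orbit_row D h1 ref2 (by decide) 2 (by decide) wordsHH wordsHH_ok
  have r3 := orbit_row D h1 ref3 (by decide) 3 (by decide) wordsHHH wordsHHH_ok
  have r4 := orbit_row D h1 ref4 (by decide) 4 (by decide) wordsHHHH wordsHHHH_ok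
  rw [wordsH1_length] at r1; rw [wordsHH_length] at r2; rw [wordsHHH_length] at r3; rw [wordsHHHH_length] at r4
  unfold E
  rw [linZ_dep, linZ_dep]
  unfold Design.Tz at *
  push_cast at *
  linear_combination (-h ^ 3) * r1 + h ^ 2 * r2 - h * r3 + r4

/-- expansion of the pair functional into nine two-slot words. -/
theorem sig_expand (h : ℤ) {g g' : Fin 4} (hne : g ≠ g') (c : Cell) : sig h g g' c =
    icellCoef c (wq g g' Sym.pt Sym.pt)
      - 2 * h * (icellCoef c (wq g g' Sym.pt Sym.h) + icellCoef c (wq g g' Sym.h Sym.pt))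
      + h ^ 2 * (icellCoef c (wq g g' Sym.pt Sym.one) + icellCoef c (wq g g' Sym.one Sym.pt))
      + 4 * h ^ 2 * icellCoef c (wq g g' Sym.h Sym.h)
      - 2 * h ^ 3 * (icellCoef c (wq g g' Sym.h Sym.one) + icellCoef c (wq g g' Sym.one Sym.h))
      + h ^ 4 * icellCoef c (wq g g' Sym.one Sym.one) := by
  simp only [icellCoef_wq hne, Sym.icoef, sig, qv]
  ring

theorem linZ_sig (h : ℤ) {g g' : Fin 4} (hne : g ≠ g') (L : List (Cell × ℕ)) : linZ L (sig h g g') =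
    linZ L (fun c => icellCoef c (wq g g' Sym.pt Sym.pt))
      - 2 * h * (linZ L (fun c => icellCoef c (wq g g' Sym.pt Sym.h)) + linZ L (fun c => icellCoef c (wq g g' Sym.h Sym.pt)))
      + h ^ 2 * (linZ L (fun c => icellCoef c (wq g g' Sym.pt Sym.one)) + linZ L (fun c => icellCoef c (wq g g' Sym.one Sym.pt)))
      + 4 * h ^ 2 * linZ L (fun c => icellCoef c (wq g g' Sym.h Sym.h))
      - 2 * h ^ 3 * (linZ L (fun c => icellCoef c (wq g g' Sym.h Sym.one)) + linZ L (fun c => icellCoef c (wq g g' Sym.one Sym.h)))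
      + h ^ 4 * linZ L (fun c => icellCoef c (wq g g' Sym.one Sym.one)) := by
  induction L with
  | nil => simp [linZ]
  | cons a t ih => simp only [linZ_cons]; rw [ih, sig_expand h hne]; ring

/-- **THE PAIR LAW** (every height, every ring; clause 2 of (A1) only): `E_h(D) = (Σ_N − Σ_P) m·q_h(c_g)·q_h(c_{g'})` for any two
slots `g ≠ g'`. -/
theorem pair_law (h : ℤ) (D : Design) (h1 : D.A1) {g g' : Fin 4} (hne : g ≠ g') :
    E h D = linZ D.N (sig h g g') - linZ D.P (sig h g g') := by
  have dq : ∀ s t : Sym, s.efree = true → t.efree = true → ∀ r : Word, r.efree → r.deg = s.deg + t.deg →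
      D.Tz (wq g g' s t) = D.Tz r := fun s t hs ht r hr hd =>
    Tz_eq_of_A1 D h1 _ _ (efree_wq g g' hs ht) hr (by rw [deg_wq hne, hd])
  have q1 := dq Sym.pt Sym.pt rfl rfl ref4 (efree_of_efreeB _ (by decide)) (by decide)
  have q2 := dq Sym.pt Sym.h rfl rfl ref3 (efree_of_efreeB _ (by decide)) (by decide)
  have q3 := dq Sym.h Sym.pt rfl rfl ref3 (efree_of_efreeB _ (by decide)) (by decide)
  have q4 := dq Sym.pt Sym.one rfl rfl ref2 (efree_of_efreeB _ (by decide)) (by decide)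
  have q5 := dq Sym.one Sym.pt rfl rfl ref2 (efree_of_efreeB _ (by decide)) (by decide)
  have q6 := dq Sym.h Sym.h rfl rfl ref2 (efree_of_efreeB _ (by decide)) (by decide)
  have q7 := dq Sym.h Sym.one rfl rfl ref1 (efree_of_efreeB _ (by decide)) (by decide)
  have q8 := dq Sym.one Sym.h rfl rfl ref1 (efree_of_efreeB _ (by decide)) (by decide)
  have q9 := dq Sym.one Sym.one rfl rfl Word.unit unit_efree (by decide)
  rw [E_expand h D h1, linZ_sig h hne, linZ_sig h hne]
  unfold Design.Tz at *
  linear_combination (-1 : ℤ) * q1 + 2 * h * (q2 + q3) - h ^ 2 * (q4 + q5) - 4 * h ^ 2 * q6 + 2 * h ^ 3 * (q7 + q8) - h ^ 4 * q9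

/-! ## §3b THE MIXED LAW — the third (and last) degree-4 shape `(2,1,1,0)`

Under clause 2 a per-slot e-free factor of degree `d ∈ {0,1,2}` (`1`, `h − a`, `q_h`) stands for `(h − z)^d`; the degree-4
products are exactly the three shapes `(1,1,1,1)` = `dep`, `(2,2,0,0)` = `sig` and `(2,1,1,0)` = `mid` below, and all three have
the same signed moment `E`.  On the alphabet `mid = 2·|x_k y_k|·col_f·col_g ≥ 0` termwise. -/

theorem icoef_one (ℓ : Letter) : Sym.one.icoef ℓ = 1 := rfl

/-- the word with `s` at slot `k`, `t` at slot `f`, `r` at slot `g`, `1` elsewhere. -/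
def wt (k f g : Fin 4) (s t r : Sym) : Word :=
  fun i => if i = k then s else if i = f then t else if i = g then r else Sym.one

theorem efree_wt (k f g : Fin 4) {s t r : Sym} (hs : s.efree = true) (ht : t.efree = true) (hr : r.efree = true) :
    (wt k f g s t r).efree := by
  intro i
  unfold wt
  split_ifs
  · exact hs
  · exact ht
  · exact hr
  · rfl

theorem deg_wt {k f g : Fin 4} (hkf : k ≠ f) (hkg : k ≠ g) (hfg : f ≠ g) (s t r : Sym) :
    (wt k f g s t r).deg = s.deg + t.deg + r.deg := by
  fin_cases k <;> fin_cases f <;> fin_cases g <;> first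
    | exact absurd rfl hkf
    | exact absurd rfl hkg
    | exact absurd rfl hfg
    | (simp +decide [Word.deg, wt, Fin.sum_univ_four, Sym.deg]; try omega)

theorem icellCoef_wt {k f g : Fin 4} (hkf : k ≠ f) (hkg : k ≠ g) (hfg : f ≠ g) (s t r : Sym) (c : Cell) :
    icellCoef c (wt k f g s t r) = s.icoef (c k) * t.icoef (c f) * r.icoef (c g) := by
  fin_cases k <;> fin_cases f <;> fin_cases g <;> first
    | exact absurd rfl hkf
    | exact absurd rfl hkg
    | exact absurd rfl hfg
    | (simp +decide [icellCoef, wt, Fin.prod_univ_four, icoef_one, -mul_eq_mul_left_iff, -mul_eq_mul_right_iff]; try ring)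

/-- the mixed functional `q_h(c_k)·(h − a_f)·(h − a_g)`. -/
def mid (h : ℤ) (k f g : Fin 4) (c : Cell) : ℤ := qv h (c k) * ((h - (c f).a) * (h - (c g).a))

/-- the MIXED WEIGHT `|x_k y_k|·col_f·col_g`. -/
def pm (k f g : Fin 4) (c : Cell) : ℤ := (|(c k).x| * |(c k).y|) * ((c f).colevel * (c g).colevel)

theorem col_eq {h : ℤ} {ℓ : Letter} (hℓ : ℓ.OnAlphabet h) : h - ℓ.a = ℓ.colevel := by
  obtain ⟨hh, _⟩ := hℓ
  unfold Letter.height at hh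
  unfold Letter.colevel
  omega

theorem mid_eq_two_pm {h : ℤ} {c : Cell} (hc : ∀ f : Fin 4, (c f).OnAlphabet h) (k f g : Fin 4) :
    mid h k f g c = 2 * pm k f g c := by
  unfold mid pm
  rw [qv_eq (hc k), col_eq (hc f), col_eq (hc g)]
  ring

theorem pm_nonneg (k f g : Fin 4) (c : Cell) : 0 ≤ pm k f g c := by
  unfold pm Letter.colevel; positivity

theorem mid_expand (h : ℤ) {k f g : Fin 4} (hkf : k ≠ f) (hkg : k ≠ g) (hfg : f ≠ g) (c : Cell) : mid h k f g c =
    icellCoef c (wt k f g Sym.pt Sym.h Sym.h)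
      - h * (icellCoef c (wt k f g Sym.pt Sym.h Sym.one) + icellCoef c (wt k f g Sym.pt Sym.one Sym.h))
      + h ^ 2 * icellCoef c (wt k f g Sym.pt Sym.one Sym.one)
      - 2 * h * icellCoef c (wt k f g Sym.h Sym.h Sym.h)
      + 2 * h ^ 2 * (icellCoef c (wt k f g Sym.h Sym.h Sym.one) + icellCoef c (wt k f g Sym.h Sym.one Sym.h))
      - 2 * h ^ 3 * icellCoef c (wt k f g Sym.h Sym.one Sym.one)
      + h ^ 2 * icellCoef c (wt k f g Sym.one Sym.h Sym.h)
      - h ^ 3 * (icellCoef c (wt k f g Sym.one Sym.h Sym.one) + icellCoef c (wt k f g Sym.one Sym.one Sym.h))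
      + h ^ 4 * icellCoef c (wt k f g Sym.one Sym.one Sym.one) := by
  simp only [icellCoef_wt hkf hkg hfg, Sym.icoef, mid, qv]
  ring

theorem linZ_mid (h : ℤ) {k f g : Fin 4} (hkf : k ≠ f) (hkg : k ≠ g) (hfg : f ≠ g) (L : List (Cell × ℕ)) :
    linZ L (mid h k f g) =
    linZ L (fun c => icellCoef c (wt k f g Sym.pt Sym.h Sym.h))
      - h * (linZ L (fun c => icellCoef c (wt k f g Sym.pt Sym.h Sym.one))
              + linZ L (fun c => icellCoef c (wt k f g Sym.pt Sym.one Sym.h)))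
      + h ^ 2 * linZ L (fun c => icellCoef c (wt k f g Sym.pt Sym.one Sym.one))
      - 2 * h * linZ L (fun c => icellCoef c (wt k f g Sym.h Sym.h Sym.h))
      + 2 * h ^ 2 * (linZ L (fun c => icellCoef c (wt k f g Sym.h Sym.h Sym.one))
              + linZ L (fun c => icellCoef c (wt k f g Sym.h Sym.one Sym.h)))
      - 2 * h ^ 3 * linZ L (fun c => icellCoef c (wt k f g Sym.h Sym.one Sym.one))
      + h ^ 2 * linZ L (fun c => icellCoef c (wt k f g Sym.one Sym.h Sym.h))
      - h ^ 3 * (linZ L (fun c => icellCoef c (wt k f g Sym.one Sym.h Sym.one))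
              + linZ L (fun c => icellCoef c (wt k f g Sym.one Sym.one Sym.h)))
      + h ^ 4 * linZ L (fun c => icellCoef c (wt k f g Sym.one Sym.one Sym.one)) := by
  induction L with
  | nil => simp [linZ]
  | cons a t ih => simp only [linZ_cons]; rw [ih, mid_expand h hkf hkg hfg]; ring

/-- **THE MIXED LAW** (every height, every ring; clause 2 only): `E_h(D) = (Σ_N − Σ_P) m·q_h(c_k)·(h − a_f)(h − a_g)` for any
three distinct slots. -/
theorem mid_law (h : ℤ) (D : Design) (h1 : D.A1) {k f g : Fin 4} (hkf : k ≠ f) (hkg : k ≠ g) (hfg : f ≠ g) :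
    E h D = linZ D.N (mid h k f g) - linZ D.P (mid h k f g) := by
  have dq : ∀ s t r : Sym, s.efree = true → t.efree = true → r.efree = true → ∀ w : Word, w.efree →
      w.deg = s.deg + t.deg + r.deg → D.Tz (wt k f g s t r) = D.Tz w := fun s t r hs ht hr w hw hd =>
    Tz_eq_of_A1 D h1 _ _ (efree_wt k f g hs ht hr) hw (by rw [deg_wt hkf hkg hfg, hd])
  have q1 := dq Sym.pt Sym.h Sym.h rfl rfl rfl ref4 (efree_of_efreeB _ (by decide)) (by decide)
  have q2 := dq Sym.pt Sym.h Sym.one rfl rfl rfl ref3 (efree_of_efreeB _ (by decide)) (by decide)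
  have q3 := dq Sym.pt Sym.one Sym.h rfl rfl rfl ref3 (efree_of_efreeB _ (by decide)) (by decide)
  have q4 := dq Sym.pt Sym.one Sym.one rfl rfl rfl ref2 (efree_of_efreeB _ (by decide)) (by decide)
  have q5 := dq Sym.h Sym.h Sym.h rfl rfl rfl ref3 (efree_of_efreeB _ (by decide)) (by decide)
  have q6 := dq Sym.h Sym.h Sym.one rfl rfl rfl ref2 (efree_of_efreeB _ (by decide)) (by decide)
  have q7 := dq Sym.h Sym.one Sym.h rfl rfl rfl ref2 (efree_of_efreeB _ (by decide)) (by decide)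
  have q8 := dq Sym.h Sym.one Sym.one rfl rfl rfl ref1 (efree_of_efreeB _ (by decide)) (by decide)
  have q9 := dq Sym.one Sym.h Sym.h rfl rfl rfl ref2 (efree_of_efreeB _ (by decide)) (by decide)
  have q10 := dq Sym.one Sym.h Sym.one rfl rfl rfl ref1 (efree_of_efreeB _ (by decide)) (by decide)
  have q11 := dq Sym.one Sym.one Sym.h rfl rfl rfl ref1 (efree_of_efreeB _ (by decide)) (by decide)
  have q12 := dq Sym.one Sym.one Sym.one rfl rfl rfl Word.unit unit_efree (by decide)
  rw [E_expand h D h1, linZ_mid h hkf hkg hfg, linZ_mid h hkf hkg hfg]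
  unfold Design.Tz at *
  linear_combination (-1 : ℤ) * q1 + h * (q2 + q3) - h ^ 2 * q4 + 2 * h * q5 - 2 * h ^ 2 * (q6 + q7)
    + 2 * h ^ 3 * q8 - h ^ 2 * q9 + h ^ 3 * (q10 + q11) - h ^ 4 * q12

theorem onAlphabet_of_N {h : ℤ} {D : Design} (hD : D.OnAlphabet h) {cm : Cell × ℕ} (hcm : cm ∈ D.N) (hpos : 0 < cm.2)
    (f : Fin 4) : (cm.1 f).OnAlphabet h :=
  hD cm.1 (List.mem_append.mpr (Or.inl ((mem_suppN_iff D cm.1).mpr ⟨cm.2, by simpa using hcm, hpos⟩))) f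

theorem onAlphabet_of_P {h : ℤ} {D : Design} (hD : D.OnAlphabet h) {cm : Cell × ℕ} (hcm : cm ∈ D.P) (hpos : 0 < cm.2)
    (f : Fin 4) : (cm.1 f).OnAlphabet h :=
  hD cm.1 (List.mem_append.mpr (Or.inr ((mem_suppP_iff D cm.1).mpr ⟨cm.2, by simpa using hcm, hpos⟩))) f

/-- **THE PAIR LAW on the alphabet**: `E = 4·(k^N(g,g') − k^P(g,g'))`, `k^X(g,g') = Σ_X m·|x_g y_g|·|x_{g'} y_{g'}|`. -/
theorem pair_law_alphabet {h : ℤ} {D : Design} (hD : D.OnAlphabet h) (h1 : D.A1) {g g' : Fin 4} (hne : g ≠ g') :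
    E h D = 4 * (linZ D.N (pw g g') - linZ D.P (pw g g')) := by
  rw [pair_law h D h1 hne]
  rw [linZ_congr' D.N (sig h g g') (fun c => 4 * pw g g' c) fun cm hm hp => sig_eq_four_pw (onAlphabet_of_N hD hm hp) g g',
    linZ_congr' D.P (sig h g g') (fun c => 4 * pw g g' c) fun cm hm hp => sig_eq_four_pw (onAlphabet_of_P hD hm hp) g g',
    linZ_smul, linZ_smul]
  ring

/-- the MIXED LAW on the alphabet: `E = 2·(τ^N − τ^P)(k;f,g)` with `τ^X = Σ_X m·|x_k y_k|·col_f·col_g`. -/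
theorem mid_law_alphabet {h : ℤ} {D : Design} (hD : D.OnAlphabet h) (h1 : D.A1) {k f g : Fin 4} (hkf : k ≠ f)
    (hkg : k ≠ g) (hfg : f ≠ g) : E h D = 2 * (linZ D.N (pm k f g) - linZ D.P (pm k f g)) := by
  rw [mid_law h D h1 hkf hkg hfg]
  rw [linZ_congr' D.N (mid h k f g) (fun c => 2 * pm k f g c) fun cm hm hp => mid_eq_two_pm (onAlphabet_of_N hD hm hp) k f g,
    linZ_congr' D.P (mid h k f g) (fun c => 2 * pm k f g c) fun cm hm hp => mid_eq_two_pm (onAlphabet_of_P hD hm hp) k f g,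
    linZ_smul, linZ_smul]
  ring

/-- in particular `E ≤ −8` forces `τ^P(k;f,g) ≥ τ^N(k;f,g) + 4` for every slot `k` and every pair `{f,g}` of other slots:
the P side carries an off-axis letter at EVERY slot `k` inside cells that are hub-free at `f` and `g`. -/
theorem mixedMassP_ge_of_E_le {h : ℤ} {D : Design} (hD : D.OnAlphabet h) (h1 : D.A1) (hE : E h D ≤ -8) {k f g : Fin 4}
    (hkf : k ≠ f) (hkg : k ≠ g) (hfg : f ≠ g) : linZ D.N (pm k f g) + 4 ≤ linZ D.P (pm k f g) := by
  have := mid_law_alphabet hD h1 hkf hkg hfg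
  omega

theorem mixedMassN_ge_of_le_E {h : ℤ} {D : Design} (hD : D.OnAlphabet h) (h1 : D.A1) (hE : 8 ≤ E h D) {k f g : Fin 4}
    (hkf : k ≠ f) (hkg : k ≠ g) (hfg : f ≠ g) : linZ D.P (pm k f g) + 4 ≤ linZ D.N (pm k f g) := by
  have := mid_law_alphabet hD h1 hkf hkg hfg
  omega

/-- parity of the pair masses: `k^N(g,g') ≡ k^P(g,g') (mod 2)` (from `8 ∣ E`). -/
theorem two_dvd_pairMass_sub {h : ℤ} {D : Design} (hD : D.OnAlphabet h) (h1 : D.A1) {g g' : Fin 4} (hne : g ≠ g') :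
    (2 : ℤ) ∣ linZ D.N (pw g g') - linZ D.P (pw g g') := by
  have h8 := (lattice_digits hD (a1e_of_a1 D h1)).1
  rw [pair_law_alphabet hD h1 hne] at h8
  omega

/-- the pair masses are the SAME at all six slot pairs. -/
theorem pairMass_sub_indep {h : ℤ} {D : Design} (hD : D.OnAlphabet h) (h1 : D.A1) {g g' k k' : Fin 4} (hne : g ≠ g')
    (hne' : k ≠ k') : linZ D.N (pw g g') - linZ D.P (pw g g') = linZ D.N (pw k k') - linZ D.P (pw k k') := by
  have a := pair_law_alphabet hD h1 hne
  have b := pair_law_alphabet hD h1 hne'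
  omega

theorem pw_nonneg (g g' : Fin 4) (c : Cell) : 0 ≤ pw g g' c := by unfold pw; positivity

/-- `E ≤ −8` ⟹ `k^P(g,g') ≥ k^N(g,g') + 2 ≥ 2` at every slot pair: the P side carries off-axis pairs everywhere. -/
theorem pairMassP_ge_of_E_le {h : ℤ} {D : Design} (hD : D.OnAlphabet h) (h1 : D.A1) (hE : E h D ≤ -8) {g g' : Fin 4}
    (hne : g ≠ g') : linZ D.N (pw g g') + 2 ≤ linZ D.P (pw g g') := by
  have a := pair_law_alphabet hD h1 hne
  omega

/-- `8 ≤ E` ⟹ `k^N(g,g') ≥ k^P(g,g') + 2 ≥ 2` at every slot pair. -/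
theorem pairMassN_ge_of_le_E {h : ℤ} {D : Design} (hD : D.OnAlphabet h) (h1 : D.A1) (hE : 8 ≤ E h D) {g g' : Fin 4}
    (hne : g ≠ g') : linZ D.P (pw g g') + 2 ≤ linZ D.N (pw g g') := by
  have a := pair_law_alphabet hD h1 hne
  omega

/-! ## §4 THE SIGNED-CLASS TRICHOTOMY -/

theorem sk_kc3 : sk (kc 3) = 3 := by
  simp [sk, kc, Fin.sum_univ_four]

theorem zI_pow_mod (n : ℕ) : zI ^ n = zI ^ (n % 4) := by
  conv_lhs => rw [← Nat.div_add_mod n 4]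
  rw [pow_add, pow_mul, zI_pow_four, one_pow, one_mul]

/-- the four class values: `2CS₀ = 2E − Re μ`, `2CS₂ = 2E + Re μ`, `2CS₁ = 2E + Im μ`, `2CS₃ = 2E − Im μ`. -/
theorem four_CS (h : ℤ) (D : Design) (hA : A1e D) :
    2 * CS h (kc 0) D = 2 * E h D - D.mu.re ∧ 2 * CS h (kc 2) D = 2 * E h D + D.mu.re ∧
      2 * CS h (kc 1) D = 2 * E h D + D.mu.im ∧ 2 * CS h (kc 3) D = 2 * E h D - D.mu.im := by
  have c0 := cube_law h D hA (kc 0)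
  have c1 := cube_law h D hA (kc 1)
  have c2 := cube_law h D hA (kc 2)
  have c3 := cube_law h D hA (kc 3)
  rw [sk_kc.1, pow_zero, one_mul] at c0
  rw [sk_kc.2.1, pow_one, zI_mul_re] at c1
  rw [sk_kc.2.2, zI_sq, neg_one_mul, Zsqrtd.re_neg] at c2
  rw [sk_kc3, show (3 : ℕ) = 2 + 1 from rfl, pow_succ, zI_sq, neg_one_mul, neg_zI_mul_re] at c3
  refine ⟨?_, ?_, ?_, ?_⟩ <;> linarith

/-- `CS_k` depends only on the class `Σk mod 4`. -/
theorem CS_class (h : ℤ) (D : Design) (hA : A1e D) (k k' : Fin 4 → Fin 4) (hkk : sk k % 4 = sk k' % 4) :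
    CS h k D = CS h k' D := by
  have a := cube_law h D hA k
  have b := cube_law h D hA k'
  rw [zI_pow_mod (sk k), hkk, ← zI_pow_mod (sk k')] at a
  linarith

/-- every residue is the class of one of `kc 0, kc 1, kc 2, kc 3`. -/
theorem CS_eq_kc (h : ℤ) (D : Design) (hA : A1e D) (k : Fin 4 → Fin 4) :
    CS h k D = CS h (kc (sk k % 4)) D := by
  apply CS_class h D hA
  have h4 : sk k % 4 < 4 := Nat.mod_lt _ (by norm_num)
  interval_cases hm : sk k % 4
  · rw [sk_kc.1]
  · rw [sk_kc.2.1]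
  · rw [sk_kc.2.2]
  · rw [sk_kc3]

/-- **SIGNED CLASS**: for `μ ≠ 0` some class value is `≥ 16` or some class value is `≤ −16`. -/
theorem signed_class {h : ℤ} {D : Design} (hD : D.OnAlphabet h) (hA : A1e D) (hμ : D.mu ≠ 0) :
    (∃ k, 16 ≤ CS h k D) ∨ (∃ k, CS h k D ≤ -16) := by
  obtain ⟨c0, c2, c1, c3⟩ := four_CS h D hA
  have d0 := sixteen_dvd_CS hD (kc 0)
  have d1 := sixteen_dvd_CS hD (kc 1)
  have d2 := sixteen_dvd_CS hD (kc 2)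
  have d3 := sixteen_dvd_CS hD (kc 3)
  by_contra hcon
  push Not at hcon
  obtain ⟨hlt, hgt⟩ := hcon
  have a0 := hlt (kc 0); have a1 := hlt (kc 1); have a2 := hlt (kc 2); have a3 := hlt (kc 3)
  have b0 := hgt (kc 0); have b1 := hgt (kc 1); have b2 := hgt (kc 2); have b3 := hgt (kc 3)
  have hre : D.mu.re = 0 := by omega
  have him : D.mu.im = 0 := by omega
  exact hμ (Zsqrtd.ext (by simpa using hre) (by simpa using him))

/-- **(N-cover) or (P-pairs)**: some class value is `≥ 16`, or else `E ≤ −8` (then `k^P ≥ k^N + 2` at every slot pair,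
`pairMassP_ge_of_E_le`). -/
theorem posClass_or {h : ℤ} {D : Design} (hD : D.OnAlphabet h) (hA : A1e D) (hμ : D.mu ≠ 0) :
    (∃ k, 16 ≤ CS h k D) ∨ E h D ≤ -8 := by
  obtain ⟨c0, c2, c1, c3⟩ := four_CS h D hA
  have h8 := (lattice_digits hD hA).1
  have d0 := sixteen_dvd_CS hD (kc 0)
  have d1 := sixteen_dvd_CS hD (kc 1)
  have d2 := sixteen_dvd_CS hD (kc 2)
  have d3 := sixteen_dvd_CS hD (kc 3)
  by_contra hcon
  push Not at hcon
  obtain ⟨hlt, hE⟩ := hcon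
  have a0 := hlt (kc 0); have a1 := hlt (kc 1); have a2 := hlt (kc 2); have a3 := hlt (kc 3)
  have hre : D.mu.re = 0 := by omega
  have him : D.mu.im = 0 := by omega
  exact hμ (Zsqrtd.ext (by simpa using hre) (by simpa using him))

/-- **(P-cover) or (N-pairs)**: some class value is `≤ −16`, or else `8 ≤ E` (then `k^N ≥ k^P + 2` at every slot pair). -/
theorem negClass_or {h : ℤ} {D : Design} (hD : D.OnAlphabet h) (hA : A1e D) (hμ : D.mu ≠ 0) :
    (∃ k, CS h k D ≤ -16) ∨ 8 ≤ E h D := by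
  obtain ⟨c0, c2, c1, c3⟩ := four_CS h D hA
  have h8 := (lattice_digits hD hA).1
  have d0 := sixteen_dvd_CS hD (kc 0)
  have d1 := sixteen_dvd_CS hD (kc 1)
  have d2 := sixteen_dvd_CS hD (kc 2)
  have d3 := sixteen_dvd_CS hD (kc 3)
  by_contra hcon
  push Not at hcon
  obtain ⟨hgt, hE⟩ := hcon
  have a0 := hgt (kc 0); have a1 := hgt (kc 1); have a2 := hgt (kc 2); have a3 := hgt (kc 3)
  have hre : D.mu.re = 0 := by omega
  have him : D.mu.im = 0 := by omega
  exact hμ (Zsqrtd.ext (by simpa using hre) (by simpa using him))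

/-- `‖μ‖_∞ ≤ −2E` (Regime II of the memo) ⟺ no class value is positive; in particular it forces `E ≤ −8`. -/
theorem no_posClass_iff {h : ℤ} {D : Design} (hA : A1e D) :
    (∀ k, CS h k D ≤ 0) ↔ (|D.mu.re| ≤ -2 * E h D ∧ |D.mu.im| ≤ -2 * E h D) := by
  obtain ⟨c0, c2, c1, c3⟩ := four_CS h D hA
  constructor
  · intro hk
    have a0 := hk (kc 0); have a1 := hk (kc 1); have a2 := hk (kc 2); have a3 := hk (kc 3)
    constructor <;> rw [abs_le] <;> constructor <;> linarith
  · rintro ⟨hre, him⟩ k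
    rw [abs_le] at hre him
    rw [CS_eq_kc h D hA k]
    have h4 : sk k % 4 < 4 := Nat.mod_lt _ (by norm_num)
    interval_cases hm : sk k % 4 <;> linarith [hre.1, hre.2, him.1, him.2]

/-! ### cube weights are non-negative on the alphabet; a signed class is met by hub-free cells in every cube -/

theorem gq_nonneg {h : ℤ} {ℓ : Letter} (hℓ : ℓ.OnAlphabet h) (r : Fin 4) : 0 ≤ gq h r ℓ := by
  obtain ⟨hh, _⟩ := hℓ
  unfold Letter.height at hh
  unfold gq cubeCrd
  rcases abs_cases ℓ.x with ⟨hx, _⟩ | ⟨hx, _⟩ <;> rcases abs_cases ℓ.y with ⟨hy, _⟩ | ⟨hy, _⟩ <;> split_ifs <;> omega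

theorem gq_le {h : ℤ} {ℓ : Letter} (hℓ : ℓ.OnAlphabet h) (r : Fin 4) : gq h r ℓ ≤ 2 * ℓ.colevel := by
  obtain ⟨hh, _⟩ := hℓ
  unfold Letter.height at hh
  unfold gq cubeCrd Letter.colevel
  rcases abs_cases ℓ.x with ⟨hx, _⟩ | ⟨hx, _⟩ <;> rcases abs_cases ℓ.y with ⟨hy, _⟩ | ⟨hy, _⟩ <;> split_ifs <;> omega

/-- the four corner weights of a letter sum to `4·colevel` (so a letter lies in exactly "half" of the corners, with weights). -/
theorem gq_sum {h : ℤ} {ℓ : Letter} (hℓ : ℓ.OnAlphabet h) : gq h 0 ℓ + gq h 1 ℓ + gq h 2 ℓ + gq h 3 ℓ = 4 * ℓ.colevel := by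
  obtain ⟨hh, _⟩ := hℓ
  unfold Letter.height at hh
  simp only [gq, cubeCrd, Letter.colevel]
  simp
  omega

theorem cubeZ_nonneg {h : ℤ} {c : Cell} (hc : ∀ f : Fin 4, (c f).OnAlphabet h) (k : Fin 4 → Fin 4) : 0 ≤ cubeZ h k c :=
  Finset.prod_nonneg fun f _ => gq_nonneg (hc f) (k f)

/-- a cell of positive cube weight is hub-free (every letter has positive co-level). -/
theorem colevel_pos_of_cubeZ_pos {h : ℤ} {c : Cell} (hc : ∀ f : Fin 4, (c f).OnAlphabet h) {k : Fin 4 → Fin 4}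
    (hpos : 0 < cubeZ h k c) (f : Fin 4) : 0 < (c f).colevel := by
  by_contra hle
  push Not at hle
  obtain ⟨hh, _⟩ := hc f
  unfold Letter.height at hh
  have hx0 : (c f).x = 0 := by
    have := abs_nonneg (c f).x; have := abs_nonneg (c f).y; unfold Letter.colevel at hle
    have : |(c f).x| = 0 := by omega
    exact abs_eq_zero.mp this
  have hy0 : (c f).y = 0 := by
    have := abs_nonneg (c f).x; have := abs_nonneg (c f).y; unfold Letter.colevel at hle
    have : |(c f).y| = 0 := by omega
    exact abs_eq_zero.mp this
  have hz : gq h (k f) (c f) = 0 := by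
    unfold gq cubeCrd
    rw [hx0, hy0] at hh ⊢
    simp at hh
    split_ifs <;> simp <;> omega
  have : cubeZ h k c = 0 := Finset.prod_eq_zero (Finset.mem_univ f) hz
  omega

theorem linZ_zero (L : List (Cell × ℕ)) : linZ L (fun _ => (0 : ℤ)) = 0 := by
  simp [linZ]

theorem exists_pos_of_linZ_pos (L : List (Cell × ℕ)) (φ : Cell → ℤ) (hL : 0 < linZ L φ) :
    ∃ cm ∈ L, 0 < cm.2 ∧ 0 < φ cm.1 := by
  by_contra hcon
  push Not at hcon
  have hle := linZ_mono L φ (fun _ => 0) fun cm hm hp => hcon cm hm hp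
  rw [linZ_zero] at hle
  omega

/-- **a class value `≥ 16` at `k` puts a hub-free N-cell of positive weight in the cube `k`** (and, by `CS_class`, in every cube of
that class). -/
theorem posClass_meets {h : ℤ} {D : Design} (hD : D.OnAlphabet h) {k : Fin 4 → Fin 4} (hk : 16 ≤ CS h k D) :
    ∃ cm ∈ D.N, 0 < cm.2 ∧ 0 < cubeZ h k cm.1 ∧ ∀ f : Fin 4, 0 < (cm.1 f).colevel := by
  have hP : 0 ≤ linZ D.P (cubeZ h k) := linZ_nonneg _ _ fun cm hm hp => cubeZ_nonneg (onAlphabet_of_P hD hm hp) k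
  have hN : 0 < linZ D.N (cubeZ h k) := by unfold CS at hk; omega
  obtain ⟨cm, hm, hp, hpos⟩ := exists_pos_of_linZ_pos _ _ hN
  exact ⟨cm, hm, hp, hpos, colevel_pos_of_cubeZ_pos (onAlphabet_of_N hD hm hp) hpos⟩

/-- dually, a class value `≤ −16` at `k` puts a hub-free P-cell of positive weight in the cube `k`. -/
theorem negClass_meets {h : ℤ} {D : Design} (hD : D.OnAlphabet h) {k : Fin 4 → Fin 4} (hk : CS h k D ≤ -16) :
    ∃ cm ∈ D.P, 0 < cm.2 ∧ 0 < cubeZ h k cm.1 ∧ ∀ f : Fin 4, 0 < (cm.1 f).colevel := by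
  have hN : 0 ≤ linZ D.N (cubeZ h k) := linZ_nonneg _ _ fun cm hm hp => cubeZ_nonneg (onAlphabet_of_N hD hm hp) k
  have hP : 0 < linZ D.P (cubeZ h k) := by unfold CS at hk; omega
  obtain ⟨cm, hm, hp, hpos⟩ := exists_pos_of_linZ_pos _ _ hP
  exact ⟨cm, hm, hp, hpos, colevel_pos_of_cubeZ_pos (onAlphabet_of_P hD hm hp) hpos⟩

/-- **THE TRICHOTOMY, assembled** (every height; `(A1)`, alphabet, `μ ≠ 0`): EITHER hub-free N-cells meet all 64 cubes of some
class, OR (`E ≤ −8` and) the P side carries `≥ k^N + 2` units of off-axis pair mass at every one of the six slot pairs. -/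
theorem nCover_or_pPairs {h : ℤ} {D : Design} (hD : D.OnAlphabet h) (h1 : D.A1) (hμ : D.mu ≠ 0) :
    (∃ s : ℕ, ∀ k : Fin 4 → Fin 4, sk k % 4 = s →
        ∃ cm ∈ D.N, 0 < cm.2 ∧ 0 < cubeZ h k cm.1 ∧ ∀ f : Fin 4, 0 < (cm.1 f).colevel) ∨
    (E h D ≤ -8 ∧ ∀ g g' : Fin 4, g ≠ g' → linZ D.N (pw g g') + 2 ≤ linZ D.P (pw g g')) := by
  rcases posClass_or hD (a1e_of_a1 D h1) hμ with ⟨k0, hk0⟩ | hE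
  · left
    refine ⟨sk k0 % 4, fun k hk => posClass_meets hD ?_⟩
    rw [CS_class h D (a1e_of_a1 D h1) k k0 hk]
    exact hk0
  · right
    exact ⟨hE, fun g g' hne => pairMassP_ge_of_E_le hD h1 hE hne⟩

/-- the dual trichotomy: EITHER hub-free P-cells meet all 64 cubes of some class, OR `8 ≤ E` and the N side carries
`≥ k^P + 2` units of off-axis pair mass at every slot pair. -/
theorem pCover_or_nPairs {h : ℤ} {D : Design} (hD : D.OnAlphabet h) (h1 : D.A1) (hμ : D.mu ≠ 0) :
    (∃ s : ℕ, ∀ k : Fin 4 → Fin 4, sk k % 4 = s →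
        ∃ cm ∈ D.P, 0 < cm.2 ∧ 0 < cubeZ h k cm.1 ∧ ∀ f : Fin 4, 0 < (cm.1 f).colevel) ∨
    (8 ≤ E h D ∧ ∀ g g' : Fin 4, g ≠ g' → linZ D.P (pw g g') + 2 ≤ linZ D.N (pw g g')) := by
  rcases negClass_or hD (a1e_of_a1 D h1) hμ with ⟨k0, hk0⟩ | hE
  · left
    refine ⟨sk k0 % 4, fun k hk => negClass_meets hD ?_⟩
    rw [CS_class h D (a1e_of_a1 D h1) k k0 hk]
    exact hk0
  · right
    exact ⟨hE, fun g g' hne => pairMassN_ge_of_le_E hD h1 hE hne⟩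


/-! ## §5 Sign trichotomy of `E` and the Branch-B consumer interface

`E h D` is `ClassLaw.E h D = linZ D.N (dep h) − linZ D.P (dep h)` with `dep h c = ∏ f, (h − (c f).a)` (the signed
colevel-product moment).  This is *by definition the same functional* as negation's `BoxIdentity.Sigma h D`
(`rho h c = ∏ f, (h − (c f).a)`), so the conclusion of `BoxIdentity.branchB_bound`
(`2·Σ + |Re μ| ≤ 0 ∧ 2·Σ + |Im μ| ≤ 0`) is literally hypothesis `hB` of `pPairs_of_branchB` below, and the composition
«Branch B (N killed by a three-box) ⇒ k^P(g,g′) ≥ k^N(g,g′) + 2 at all six slot pairs» is one `exact` in any file that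
imports both modules.  Everything in this section is height-free and shell-free (clause 1 + clause 2 + alphabet only). -/

theorem dep_eq_prod (h : ℤ) (c : Cell) : dep h c = ∏ f : Fin 4, (h - (c f).a) := rfl

theorem E_eq (h : ℤ) (D : Design) :
    E h D = linZ D.N (fun c => ∏ f : Fin 4, (h - (c f).a)) - linZ D.P (fun c => ∏ f : Fin 4, (h - (c f).a)) := rfl

/-- `E < 0` ⇒ P-pairs (uses `8 ∣ E`). -/
theorem pPairs_of_E_neg {h : ℤ} {D : Design} (hD : D.OnAlphabet h) (h1 : D.A1) (hE : E h D < 0) {g g' : Fin 4}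
    (hne : g ≠ g') : linZ D.N (pw g g') + 2 ≤ linZ D.P (pw g g') := by
  obtain ⟨q, hq⟩ := (lattice_digits hD (a1e_of_a1 D h1)).1
  exact pairMassP_ge_of_E_le hD h1 (by omega) hne

/-- `0 < E` ⇒ N-pairs. -/
theorem nPairs_of_E_pos {h : ℤ} {D : Design} (hD : D.OnAlphabet h) (h1 : D.A1) (hE : 0 < E h D) {g g' : Fin 4}
    (hne : g ≠ g') : linZ D.P (pw g g') + 2 ≤ linZ D.N (pw g g') := by
  obtain ⟨q, hq⟩ := (lattice_digits hD (a1e_of_a1 D h1)).1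
  exact pairMassN_ge_of_le_E hD h1 (by omega) hne

/-- `E = 0` ⇒ equal pair masses at every slot pair. -/
theorem pairs_eq_of_E_zero {h : ℤ} {D : Design} (hD : D.OnAlphabet h) (h1 : D.A1) (hE : E h D = 0) {g g' : Fin 4}
    (hne : g ≠ g') : linZ D.N (pw g g') = linZ D.P (pw g g') := by
  have := pair_law_alphabet hD h1 hne
  omega

/-- **Branch-B composition interface.**  The hypothesis is the conclusion of `BoxIdentity.branchB_bound` read through
`E = Sigma`; the conclusion is the P-side pair law (S3-1)(a): `k^P(g,g′) ≥ k^N(g,g′) + 2` at every slot pair. -/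
theorem pPairs_of_branchB {h : ℤ} {D : Design} (hD : D.OnAlphabet h) (h1 : D.A1) (hμ : D.mu ≠ 0)
    (hB : 2 * E h D + |D.mu.re| ≤ 0 ∧ 2 * E h D + |D.mu.im| ≤ 0) {g g' : Fin 4} (hne : g ≠ g') :
    linZ D.N (pw g g') + 2 ≤ linZ D.P (pw g g') := by
  have hE : E h D < 0 := by
    obtain ⟨hre, him⟩ := hB
    by_contra hc
    push Not at hc
    have h0re : |D.mu.re| = 0 := le_antisymm (by linarith) (abs_nonneg _)
    have h0im : |D.mu.im| = 0 := le_antisymm (by linarith) (abs_nonneg _)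
    rw [abs_eq_zero] at h0re h0im
    exact hμ (Zsqrtd.ext (by simpa using h0re) (by simpa using h0im))
  exact pPairs_of_E_neg hD h1 hE hne

/-- in Branch B there is moreover a class of 64 cubes each met by a hub-free P-cell (`E < 0 < 8`). -/
theorem pCover_of_branchB {h : ℤ} {D : Design} (hD : D.OnAlphabet h) (h1 : D.A1) (hμ : D.mu ≠ 0)
    (hB : 2 * E h D + |D.mu.re| ≤ 0 ∧ 2 * E h D + |D.mu.im| ≤ 0) :
    ∃ s : ℕ, ∀ k : Fin 4 → Fin 4, sk k % 4 = s →
        ∃ cm ∈ D.P, 0 < cm.2 ∧ 0 < cubeZ h k cm.1 ∧ ∀ f : Fin 4, 0 < (cm.1 f).colevel := by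
  rcases pCover_or_nPairs hD h1 hμ with hc | ⟨hE, -⟩
  · exact hc
  · exfalso
    obtain ⟨hre, him⟩ := hB
    have := abs_nonneg D.mu.re
    linarith

/-- **SIGN TRICHOTOMY** (every height, every ring; clause 1 + clause 2 + alphabet + `μ ≠ 0`):
* `E > 0`: the N side meets all 64 cubes of some class with hub-free cells AND out-carries P by `≥ 2` at every slot pair;
* `E < 0`: the same two statements with N and P exchanged;
* `E = 0`: BOTH sides meet a full class of cubes with hub-free cells, and the pair masses agree at every slot pair. -/
theorem sign_trichotomy {h : ℤ} {D : Design} (hD : D.OnAlphabet h) (h1 : D.A1) (hμ : D.mu ≠ 0) :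
    (0 < E h D ∧
      (∃ s : ℕ, ∀ k : Fin 4 → Fin 4, sk k % 4 = s →
        ∃ cm ∈ D.N, 0 < cm.2 ∧ 0 < cubeZ h k cm.1 ∧ ∀ f : Fin 4, 0 < (cm.1 f).colevel) ∧
      ∀ g g' : Fin 4, g ≠ g' → linZ D.P (pw g g') + 2 ≤ linZ D.N (pw g g')) ∨
    (E h D < 0 ∧
      (∃ s : ℕ, ∀ k : Fin 4 → Fin 4, sk k % 4 = s →
        ∃ cm ∈ D.P, 0 < cm.2 ∧ 0 < cubeZ h k cm.1 ∧ ∀ f : Fin 4, 0 < (cm.1 f).colevel) ∧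
      ∀ g g' : Fin 4, g ≠ g' → linZ D.N (pw g g') + 2 ≤ linZ D.P (pw g g')) ∨
    (E h D = 0 ∧
      (∃ s : ℕ, ∀ k : Fin 4 → Fin 4, sk k % 4 = s →
        ∃ cm ∈ D.N, 0 < cm.2 ∧ 0 < cubeZ h k cm.1 ∧ ∀ f : Fin 4, 0 < (cm.1 f).colevel) ∧
      (∃ s : ℕ, ∀ k : Fin 4 → Fin 4, sk k % 4 = s →
        ∃ cm ∈ D.P, 0 < cm.2 ∧ 0 < cubeZ h k cm.1 ∧ ∀ f : Fin 4, 0 < (cm.1 f).colevel) ∧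
      ∀ g g' : Fin 4, g ≠ g' → linZ D.N (pw g g') = linZ D.P (pw g g')) := by
  rcases lt_trichotomy 0 (E h D) with hpos | hzero | hneg
  · left
    refine ⟨hpos, ?_, fun g g' hne => nPairs_of_E_pos hD h1 hpos hne⟩
    rcases nCover_or_pPairs hD h1 hμ with hc | ⟨hE, -⟩
    · exact hc
    · exfalso; omega
  · right; right
    refine ⟨hzero.symm, ?_, ?_, fun g g' hne => pairs_eq_of_E_zero hD h1 hzero.symm hne⟩
    · rcases nCover_or_pPairs hD h1 hμ with hc | ⟨hE, -⟩
      · exact hc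
      · exfalso; omega
    · rcases pCover_or_nPairs hD h1 hμ with hc | ⟨hE, -⟩
      · exact hc
      · exfalso; omega
  · right; left
    refine ⟨hneg, ?_, fun g g' hne => pPairs_of_E_neg hD h1 hneg hne⟩
    rcases pCover_or_nPairs hD h1 hμ with hc | ⟨hE, -⟩
    · exact hc
    · exfalso; omega

/-! ## §6 CARRIERS: the support signature of the two charged branches (every height, every shell)

A cell CARRIES pair weight at `(g, g')` iff both letters are off-axis (`pw_pos_iff`), and mixed weight at `(k; f, g)` iff the
letter at `k` is off-axis and the letters at `f, g` are not hubs (`pm_pos_iff`).  Hence (`pCarrier_of_E_le`, `pMixedCarrier_of_E_le`,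
mirrors `nCarrier_of_le_E`, `nMixedCarrier_of_le_E`): **Branch β (`E ≤ −8`) puts into `P`, for EVERY slot pair, a cell off-axis at both
slots, and for EVERY slot triple a cell off-axis at the first and hub-free at the other two; Branch α (`E ≥ 8`) does the same in `N`.**
At ring 3 (gs-eng-2 fine room `8940f2df8ed13676`) the N-cells with two off-axis letters are exactly the types `BBHH, BBHu, BDHH` — each
carries ONE pair — so Branch α needs six distinct such N-cells, one per pair; the P-carriers are `ABBH, BBBH, BBHH, BBHu, BBuu, BDHH, BDHu,
DDHH` (`BBBH` carries three pairs, the rest one), so Branch β needs at least three of them (memo `DUAL-CERT-FAMILY-g16.md` §4). -/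

theorem absmul_pos_iff (a b : ℤ) : 0 < |a| * |b| ↔ a ≠ 0 ∧ b ≠ 0 := by
  constructor
  · intro hp
    refine ⟨?_, ?_⟩ <;> rintro rfl <;> simp at hp
  · rintro ⟨ha, hb⟩
    exact mul_pos (abs_pos.mpr ha) (abs_pos.mpr hb)

/-- a cell carries pair weight at `(g, g')` iff both letters are off-axis. -/
theorem pw_pos_iff (g g' : Fin 4) (c : Cell) :
    0 < pw g g' c ↔ ((c g).x ≠ 0 ∧ (c g).y ≠ 0) ∧ ((c g').x ≠ 0 ∧ (c g').y ≠ 0) := by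
  have h1 := absmul_pos_iff (c g).x (c g).y
  have h2 := absmul_pos_iff (c g').x (c g').y
  have n1 : 0 ≤ |(c g).x| * |(c g).y| := by positivity
  have n2 : 0 ≤ |(c g').x| * |(c g').y| := by positivity
  unfold pw
  constructor
  · intro hp
    have q1 : 0 < |(c g).x| * |(c g).y| := by
      rcases n1.lt_or_eq with h | h
      · exact h
      · rw [← h, zero_mul] at hp; exact absurd hp (lt_irrefl 0)
    have q2 : 0 < |(c g').x| * |(c g').y| := by
      rcases n2.lt_or_eq with h | h
      · exact h
      · rw [← h, mul_zero] at hp; exact absurd hp (lt_irrefl 0)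
    exact ⟨h1.mp q1, h2.mp q2⟩
  · rintro ⟨hg, hg'⟩
    exact mul_pos (h1.mpr hg) (h2.mpr hg')

/-- on the alphabet, a cell carries mixed weight at `(k; f, g)` iff the letter at `k` is off-axis and those at `f, g` are not hubs. -/
theorem pm_pos_iff {h : ℤ} {c : Cell} (hc : ∀ f : Fin 4, (c f).OnAlphabet h) (k f g : Fin 4) :
    0 < pm k f g c ↔ ((c k).x ≠ 0 ∧ (c k).y ≠ 0) ∧ (0 < (c f).colevel ∧ 0 < (c g).colevel) := by
  have h1 := absmul_pos_iff (c k).x (c k).y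
  have n1 : 0 ≤ |(c k).x| * |(c k).y| := by positivity
  have nf : 0 ≤ (c f).colevel := by unfold Letter.colevel; positivity
  have ng : 0 ≤ (c g).colevel := by unfold Letter.colevel; positivity
  have _u := hc k
  unfold pm
  constructor
  · intro hp
    have q1 : 0 < |(c k).x| * |(c k).y| := by
      rcases n1.lt_or_eq with h | h
      · exact h
      · rw [← h, zero_mul] at hp; exact absurd hp (lt_irrefl 0)
    have q2 : 0 < (c f).colevel * (c g).colevel := by
      rcases (mul_nonneg nf ng).lt_or_eq with h | h
      · exact h
      · rw [← h, mul_zero] at hp; exact absurd hp (lt_irrefl 0)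
    have qf : 0 < (c f).colevel := by
      rcases nf.lt_or_eq with h | h
      · exact h
      · rw [← h, zero_mul] at q2; exact absurd q2 (lt_irrefl 0)
    have qg : 0 < (c g).colevel := by
      rcases ng.lt_or_eq with h | h
      · exact h
      · rw [← h, mul_zero] at q2; exact absurd q2 (lt_irrefl 0)
    exact ⟨h1.mp q1, qf, qg⟩
  · rintro ⟨hk, hf, hg⟩
    exact mul_pos (h1.mpr hk) (mul_pos hf hg)

/-- **Branch β ⇒ a P pair-carrier at every slot pair.** -/
theorem pCarrier_of_E_le {h : ℤ} {D : Design} (hD : D.OnAlphabet h) (h1 : D.A1) (hE : E h D ≤ -8) {g g' : Fin 4}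
    (hne : g ≠ g') : ∃ cm ∈ D.P, 0 < cm.2 ∧ ((cm.1 g).x ≠ 0 ∧ (cm.1 g).y ≠ 0) ∧ ((cm.1 g').x ≠ 0 ∧ (cm.1 g').y ≠ 0) := by
  have hN : 0 ≤ linZ D.N (pw g g') := linZ_nonneg _ _ fun cm _ _ => pw_nonneg g g' cm.1
  have hP : 0 < linZ D.P (pw g g') := by
    have := pairMassP_ge_of_E_le hD h1 hE hne
    omega
  obtain ⟨cm, hm, hp, hpos⟩ := exists_pos_of_linZ_pos _ _ hP
  exact ⟨cm, hm, hp, (pw_pos_iff g g' cm.1).mp hpos⟩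

/-- **Branch α ⇒ an N pair-carrier at every slot pair.** -/
theorem nCarrier_of_le_E {h : ℤ} {D : Design} (hD : D.OnAlphabet h) (h1 : D.A1) (hE : 8 ≤ E h D) {g g' : Fin 4}
    (hne : g ≠ g') : ∃ cm ∈ D.N, 0 < cm.2 ∧ ((cm.1 g).x ≠ 0 ∧ (cm.1 g).y ≠ 0) ∧ ((cm.1 g').x ≠ 0 ∧ (cm.1 g').y ≠ 0) := by
  have hP : 0 ≤ linZ D.P (pw g g') := linZ_nonneg _ _ fun cm _ _ => pw_nonneg g g' cm.1
  have hN : 0 < linZ D.N (pw g g') := by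
    have := pairMassN_ge_of_le_E hD h1 hE hne
    omega
  obtain ⟨cm, hm, hp, hpos⟩ := exists_pos_of_linZ_pos _ _ hN
  exact ⟨cm, hm, hp, (pw_pos_iff g g' cm.1).mp hpos⟩

/-- **Branch β ⇒ a P mixed-carrier at every slot triple**: off-axis at `k`, hub-free at `f` and `g`. -/
theorem pMixedCarrier_of_E_le {h : ℤ} {D : Design} (hD : D.OnAlphabet h) (h1 : D.A1) (hE : E h D ≤ -8) {k f g : Fin 4}
    (hkf : k ≠ f) (hkg : k ≠ g) (hfg : f ≠ g) :
    ∃ cm ∈ D.P, 0 < cm.2 ∧ ((cm.1 k).x ≠ 0 ∧ (cm.1 k).y ≠ 0) ∧ (0 < (cm.1 f).colevel ∧ 0 < (cm.1 g).colevel) := by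
  have hN : 0 ≤ linZ D.N (pm k f g) := linZ_nonneg _ _ fun cm _ _ => pm_nonneg k f g cm.1
  have hP : 0 < linZ D.P (pm k f g) := by
    have := mixedMassP_ge_of_E_le hD h1 hE hkf hkg hfg
    omega
  obtain ⟨cm, hm, hp, hpos⟩ := exists_pos_of_linZ_pos _ _ hP
  exact ⟨cm, hm, hp, (pm_pos_iff (onAlphabet_of_P hD hm hp) k f g).mp hpos⟩

/-- **Branch α ⇒ an N mixed-carrier at every slot triple.** -/
theorem nMixedCarrier_of_le_E {h : ℤ} {D : Design} (hD : D.OnAlphabet h) (h1 : D.A1) (hE : 8 ≤ E h D) {k f g : Fin 4}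
    (hkf : k ≠ f) (hkg : k ≠ g) (hfg : f ≠ g) :
    ∃ cm ∈ D.N, 0 < cm.2 ∧ ((cm.1 k).x ≠ 0 ∧ (cm.1 k).y ≠ 0) ∧ (0 < (cm.1 f).colevel ∧ 0 < (cm.1 g).colevel) := by
  have hP : 0 ≤ linZ D.P (pm k f g) := linZ_nonneg _ _ fun cm _ _ => pm_nonneg k f g cm.1
  have hN : 0 < linZ D.N (pm k f g) := by
    have := mixedMassN_ge_of_le_E hD h1 hE hkf hkg hfg
    omega
  obtain ⟨cm, hm, hp, hpos⟩ := exists_pos_of_linZ_pos _ _ hN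
  exact ⟨cm, hm, hp, (pm_pos_iff (onAlphabet_of_N hD hm hp) k f g).mp hpos⟩

/-- **Branch B of `BoxIdentity` ⇒ P pair-carriers at all six slot pairs** (the qualitative `k^P` door law the director asked for). -/
theorem pCarrier_of_branchB {h : ℤ} {D : Design} (hD : D.OnAlphabet h) (h1 : D.A1) (hμ : D.mu ≠ 0)
    (hB : 2 * E h D + |D.mu.re| ≤ 0 ∧ 2 * E h D + |D.mu.im| ≤ 0) {g g' : Fin 4} (hne : g ≠ g') :
    ∃ cm ∈ D.P, 0 < cm.2 ∧ ((cm.1 g).x ≠ 0 ∧ (cm.1 g).y ≠ 0) ∧ ((cm.1 g').x ≠ 0 ∧ (cm.1 g').y ≠ 0) := by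
  have hN : 0 ≤ linZ D.N (pw g g') := linZ_nonneg _ _ fun cm _ _ => pw_nonneg g g' cm.1
  have hP : 0 < linZ D.P (pw g g') := by
    have := pPairs_of_branchB hD h1 hμ hB hne
    omega
  obtain ⟨cm, hm, hp, hpos⟩ := exists_pos_of_linZ_pos _ _ hP
  exact ⟨cm, hm, hp, (pw_pos_iff g g' cm.1).mp hpos⟩

section HHCorner
open Summit.HodgeConjecture.HodgeConjecture.Cruxes.BlochSeedDiscOne.LeggedFloor

/-! ## §7 THE HH-CORNER LAW (coarse RULE D + `Disj` + alphabet only; height-free and shell-free)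

A letter is OFF-AXIS when `x ≠ 0 ∧ y ≠ 0` (it carries pair weight `|x·y| > 0`).  On the height-`h` alphabet a letter that is
equal to or a NULL step below an off-axis letter is again off-axis (`offAxis_of_eq_or_null`).  Hence RULE D's two clauses chase
each other INSIDE the set of pair-carriers of a fixed slot pair `(g, j)`: an N-carrier's `(g,j)`-supplier is a P-carrier with the
same complement; a P-carrier whose complement `(g′,j′)` detects has a `(g′,j′)`-supplier above it, an N-carrier with the SAME
`(g,j)` letters and a complement of strictly smaller co-level sum.  The chase ends at a P-carrier whose complement does NOT
detect, i.e. is the HUB PAIR (`hhCornerP`, `hhCorner_of_pCarrier`).  With `pCarrier_of_branchB`: **Branch B ⇒ for each of the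
six slot pairs a supported P-cell off-axis on the pair and hub `(h;0,0)` on the complementary pair** (`hhCorner_of_branchB`);
each such cell forces two supported N-cells obtained from it by ONE strict null step at one pair slot (`edgeN_of_hub`). -/

/-- off-axis letter: `x ≠ 0 ∧ y ≠ 0`. -/
def OffAxis (ℓ : Letter) : Prop := ℓ.x ≠ 0 ∧ ℓ.y ≠ 0

/-- on the alphabet, a letter weakly-causally below an off-axis letter (`a < a′`, `|β′ − β|² ≤ (a′ − a)²`) is off-axis. -/
theorem offAxis_of_le {h : ℤ} {ℓ ℓ' : Letter} (hℓ : ℓ.OnAlphabet h) (hℓ' : ℓ'.OnAlphabet h) (hlt : ℓ.a < ℓ'.a)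
    (hcone : (ℓ'.x - ℓ.x) ^ 2 + (ℓ'.y - ℓ.y) ^ 2 ≤ (ℓ'.a - ℓ.a) ^ 2) (hoff : OffAxis ℓ') : OffAxis ℓ := by
  have e1 := hℓ.1
  have e2 := hℓ'.1
  unfold Letter.height at e1 e2
  have hP : 0 < |ℓ'.x| := abs_pos.mpr hoff.1
  have hQ : 0 < |ℓ'.y| := abs_pos.mpr hoff.2
  have sx : (|ℓ'.x| - |ℓ.x|) ^ 2 ≤ (ℓ'.x - ℓ.x) ^ 2 := by
    have h0 := abs_abs_sub_abs_le_abs_sub ℓ'.x ℓ.x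
    have h3 := sq_le_sq' (abs_le.mp h0).1 (abs_le.mp h0).2
    simpa only [sq_abs] using h3
  have sy : (|ℓ'.y| - |ℓ.y|) ^ 2 ≤ (ℓ'.y - ℓ.y) ^ 2 := by
    have h0 := abs_abs_sub_abs_le_abs_sub ℓ'.y ℓ.y
    have h3 := sq_le_sq' (abs_le.mp h0).1 (abs_le.mp h0).2
    simpa only [sq_abs] using h3
  by_contra hcon
  unfold OffAxis at hcon
  rcases not_and_or.mp hcon with hx | hy
  · have hx0 : ℓ.x = 0 := not_not.mp hx
    have ax : |ℓ.x| = 0 := by rw [hx0]; simp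
    have px : (ℓ'.x - ℓ.x) ^ 2 = |ℓ'.x| ^ 2 := by rw [hx0, sub_zero, sq_abs]
    rw [px] at hcone
    rw [ax] at e1
    nlinarith [mul_pos hP hQ, mul_pos hP hP]
  · have hy0 : ℓ.y = 0 := not_not.mp hy
    have ay : |ℓ.y| = 0 := by rw [hy0]; simp
    have py : (ℓ'.y - ℓ.y) ^ 2 = |ℓ'.y| ^ 2 := by rw [hy0, sub_zero, sq_abs]
    rw [py] at hcone
    rw [ay] at e1
    nlinarith [mul_pos hP hQ, mul_pos hQ hQ]

/-- in particular along `ℓ = ℓ′ ∨ NullStep ℓ ℓ′` (a supplier's block letters). -/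
theorem offAxis_of_eq_or_null {h : ℤ} {ℓ ℓ' : Letter} (hℓ : ℓ.OnAlphabet h) (hℓ' : ℓ'.OnAlphabet h)
    (hs : ℓ = ℓ' ∨ NullStep ℓ ℓ') (hoff : OffAxis ℓ') : OffAxis ℓ := by
  rcases hs with hs | hs
  · rw [hs]; exact hoff
  · exact offAxis_of_le hℓ hℓ' hs.1 (le_of_eq hs.2) hoff

/-- an off-axis letter makes every block through its slot detect. -/
theorem detects_of_offAxis_left (c : Cell) (g j : Fin 4) (hg : OffAxis (c g)) : Detects c g j := by
  intro hd; exact hg.1 hd.1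

theorem detects_of_offAxis_right (c : Cell) (g j : Fin 4) (hj : OffAxis (c j)) : Detects c g j := by
  intro hd; exact hj.1 hd.2.2.1

/-- a hub letter and an off-axis letter at the same slot separate two cells. -/
theorem ne_of_offAxis_of_hub {h : ℤ} {c c' : Cell} {f : Fin 4} (hc' : (c' f).OnAlphabet h)
    (hoff : OffAxis (c f)) (hhub : ¬ (c' f).a < h) : c ≠ c' := by
  intro heq
  have := (xy_eq_zero_of_not_lt hc' hhub).1
  rw [← heq] at this
  exact hoff.1 this


/-- shell reading: an off-axis letter of the alphabet has co-level `|x| + |y| ≥ 2` (co-level `≤ 3`: the classes `B` (2) and `D` (3)),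
and a hub-pair letter is the hub `(h; 0, 0)` itself. -/
theorem two_le_colevel_of_offAxis (ℓ : Letter) (hoff : OffAxis ℓ) : 2 ≤ ℓ.colevel := by
  have hP : 0 < |ℓ.x| := abs_pos.mpr hoff.1
  have hQ : 0 < |ℓ.y| := abs_pos.mpr hoff.2
  unfold Letter.colevel
  omega

theorem eq_hub_of_not_lt {h : ℤ} {ℓ : Letter} (hℓ : ℓ.OnAlphabet h) (hn : ¬ ℓ.a < h) : ℓ = ⟨h, 0, 0⟩ := by
  have hxy := xy_eq_zero_of_not_lt hℓ hn
  have e1 := hℓ.1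
  unfold Letter.height at e1
  rw [hxy.1, hxy.2] at e1
  simp at e1
  cases ℓ with
  | mk a x y =>
    simp only at hxy e1
    simp [hxy.1, hxy.2, e1]

/-- **CHASE UP inside the carriers of `(g,j)`**: an N-cell off-axis on `(g,j)` forces a supported P-cell off-axis on `(g,j)` and HUB on
the complement `(g′,j′)`. -/
theorem hhCornerP (h : ℤ) (D : Design) (hD : D.OnAlphabet h) (hr : RuleD D) (hdis : Disj D)
    (g j g' j' : Fin 4) (hgj : g < j) (hg'j' : g' < j')
    (h1 : g ≠ g') (h2 : g ≠ j') (h3 : j ≠ g') (h4 : j ≠ j') :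
    ∀ y ∈ D.suppN, OffAxis (y g) → OffAxis (y j) →
      ∃ x ∈ D.suppP, HubPair h x g' j' ∧ OffAxis (x g) ∧ OffAxis (x j) := by
  suffices key : ∀ n : ℕ, ∀ y ∈ D.suppN, OffAxis (y g) → OffAxis (y j) →
      (h - (y g').a) + (h - (y j').a) < (n : ℤ) → ∃ x ∈ D.suppP, HubPair h x g' j' ∧ OffAxis (x g) ∧ OffAxis (x j) by
    intro y hy hg hj
    refine key (((h - (y g').a) + (h - (y j').a)).toNat + 1) y hy hg hj ?_
    have := Int.self_le_toNat ((h - (y g').a) + (h - (y j').a))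
    push_cast
    linarith
  intro n
  induction n with
  | zero =>
    intro y hy _ _ hlt
    have a1 := level_le_of_onAlphabet (hD y (LeggedFloor.mem_supp_of_memN D hy) g')
    have a2 := level_le_of_onAlphabet (hD y (LeggedFloor.mem_supp_of_memN D hy) j')
    push_cast at hlt
    linarith
  | succ n ih =>
    intro y hy hg hj hlt
    have hyA : ∀ f : Fin 4, (y f).OnAlphabet h := hD y (LeggedFloor.mem_supp_of_memN D hy)
    obtain ⟨x, hx, hs⟩ := hr.1 y hy g j hgj (detects_of_offAxis_left y g j hg)
    have hxA : ∀ f : Fin 4, (x f).OnAlphabet h := hD x (LeggedFloor.mem_supp_of_memP D hx)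
    have hxg : OffAxis (x g) := offAxis_of_eq_or_null (hxA g) (hyA g) hs.2.1 hg
    have hxj : OffAxis (x j) := offAxis_of_eq_or_null (hxA j) (hyA j) hs.2.2 hj
    by_cases hhub : HubPair h x g' j'
    · exact ⟨x, hx, hhub, hxg, hxj⟩
    have hlx : LowPair h x g' j' := lowPair_of_not_hubPair hhub
    obtain ⟨y', hy', hs'⟩ := hr.2 x hx g' j' hg'j' (detects_of_lowPair hxA hlx)
    have hne : x ≠ y' := fun heq => hdis x (heq ▸ hy') hx
    have hstrict := levelSum_lt_of_supplies_ne hs' hne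
    have hxg' : x g' = y g' := hs.1 g' h1.symm h3.symm
    have hxj' : x j' = y j' := hs.1 j' h2.symm h4.symm
    have hy'g : y' g = x g := (hs'.1 g h1 h2).symm
    have hy'j : y' j = x j := (hs'.1 j h3 h4).symm
    refine ih y' hy' (by rw [hy'g]; exact hxg) (by rw [hy'j]; exact hxj) ?_
    rw [hxg', hxj'] at hstrict
    push_cast at hlt
    linarith

/-- **THE HH-CORNER LAW**: a supported P-cell off-axis on `(g,j)` forces a supported P-cell off-axis on `(g,j)` and HUB on the
complementary pair. -/
theorem hhCorner_of_pCarrier (h : ℤ) (D : Design) (hD : D.OnAlphabet h) (hr : RuleD D) (hdis : Disj D)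
    (g j g' j' : Fin 4) (hgj : g < j) (hg'j' : g' < j')
    (h1 : g ≠ g') (h2 : g ≠ j') (h3 : j ≠ g') (h4 : j ≠ j')
    {x : Cell} (hx : x ∈ D.suppP) (hg : OffAxis (x g)) (hj : OffAxis (x j)) :
    ∃ x' ∈ D.suppP, HubPair h x' g' j' ∧ OffAxis (x' g) ∧ OffAxis (x' j) := by
  by_cases hhub : HubPair h x g' j'
  · exact ⟨x, hx, hhub, hg, hj⟩
  have hxA : ∀ f : Fin 4, (x f).OnAlphabet h := hD x (LeggedFloor.mem_supp_of_memP D hx)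
  obtain ⟨y, hy, hs⟩ := hr.2 x hx g' j' hg'j' (detects_of_lowPair hxA (lowPair_of_not_hubPair hhub))
  have hyg : y g = x g := (hs.1 g h1 h2).symm
  have hyj : y j = x j := (hs.1 j h3 h4).symm
  exact hhCornerP h D hD hr hdis g j g' j' hgj hg'j' h1 h2 h3 h4 y hy (by rw [hyg]; exact hg) (by rw [hyj]; exact hj)

/-- **Branch B ⇒ an HH-cornered P pair-carrier at every slot pair** (composition with `pCarrier_of_branchB`; uses (A1), `μ ≠ 0`,
coarse RULE D, `Disj`, the alphabet — and nothing about heights, rings, Hall or budgets). -/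
theorem hhCorner_of_branchB {h : ℤ} {D : Design} (hD : D.OnAlphabet h) (hA : D.A1) (hμ : D.mu ≠ 0)
    (hB : 2 * RingTwoMassLaw.ClassLaw.E h D + |D.mu.re| ≤ 0 ∧ 2 * RingTwoMassLaw.ClassLaw.E h D + |D.mu.im| ≤ 0)
    (hr : RuleD D) (hdis : Disj D)
    (g j g' j' : Fin 4) (hgj : g < j) (hg'j' : g' < j')
    (h1 : g ≠ g') (h2 : g ≠ j') (h3 : j ≠ g') (h4 : j ≠ j') :
    ∃ x ∈ D.suppP, HubPair h x g' j' ∧ OffAxis (x g) ∧ OffAxis (x j) := by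
  obtain ⟨cm, hm, hp, hoffg, hoffj⟩ := pCarrier_of_branchB hD hA hμ hB (ne_of_lt hgj)
  have hx : cm.1 ∈ D.suppP := (mem_suppP_iff D cm.1).mpr ⟨cm.2, hm, hp⟩
  exact hhCorner_of_pCarrier h D hD hr hdis g j g' j' hgj hg'j' h1 h2 h3 h4 hx hoffg hoffj

/-- **EDGE CELLS**: a supported P-cell off-axis at slot `s` and hub at slot `t ≠ s` forces a supported N-cell that differs from it
EXACTLY at `s`, by one strict null step up (RULE D at the block `{s,t}`: nothing lies above the hub, `Disj` forbids equality). -/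
theorem edgeN_of_hub {h : ℤ} {D : Design} (hD : D.OnAlphabet h) (hr : RuleD D) (hdis : Disj D)
    {x : Cell} (hx : x ∈ D.suppP) {s t : Fin 4} (hst : s ≠ t) (hs : OffAxis (x s)) (ht : ¬ (x t).a < h) :
    ∃ y ∈ D.suppN, NullStep (x s) (y s) ∧ ∀ f : Fin 4, f ≠ s → y f = x f := by
  have hxA : ∀ f : Fin 4, (x f).OnAlphabet h := hD x (LeggedFloor.mem_supp_of_memP D hx)
  -- no strict null step starts at a hub letter
  have nohub : ∀ y ∈ D.suppN, ¬ NullStep (x t) (y t) := by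
    intro y hy hn
    have := level_le_of_onAlphabet (hD y (LeggedFloor.mem_supp_of_memN D hy) t)
    have := hn.1
    omega
  rcases lt_or_gt_of_ne hst with hlt | hlt
  · obtain ⟨y, hy, hsup⟩ := hr.2 x hx s t hlt (detects_of_offAxis_left x s t hs)
    have hyt : y t = x t := by
      rcases hsup.2.2 with he | hn
      · exact he.symm
      · exact absurd hn (nohub y hy)
    have hne : x ≠ y := fun heq => hdis x (heq ▸ hy) hx
    have hys : NullStep (x s) (y s) := by
      rcases hsup.2.1 with he | hn
      · exfalso; apply hne; funext f
        by_cases hfs : f = s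
        · rw [hfs]; exact he
        by_cases hft : f = t
        · rw [hft]; exact hyt.symm
        exact hsup.1 f hfs hft
      · exact hn
    refine ⟨y, hy, hys, fun f hfs => ?_⟩
    by_cases hft : f = t
    · rw [hft]; exact hyt
    exact (hsup.1 f hfs hft).symm
  · obtain ⟨y, hy, hsup⟩ := hr.2 x hx t s hlt (detects_of_offAxis_right x t s hs)
    have hyt : y t = x t := by
      rcases hsup.2.1 with he | hn
      · exact he.symm
      · exact absurd hn (nohub y hy)
    have hne : x ≠ y := fun heq => hdis x (heq ▸ hy) hx
    have hys : NullStep (x s) (y s) := by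
      rcases hsup.2.2 with he | hn
      · exfalso; apply hne; funext f
        by_cases hft : f = t
        · rw [hft]; exact hyt.symm
        by_cases hfs : f = s
        · rw [hfs]; exact he
        exact hsup.1 f hft hfs
      · exact hn
    refine ⟨y, hy, hys, fun f hfs => ?_⟩
    by_cases hft : f = t
    · rw [hft]; exact hyt
    exact (hsup.1 f hft hfs).symm

/-- a strict null step up from an off-axis letter never reaches the hub: the edge cell is still charged at `s`. -/
theorem nullStep_offAxis_lt {h : ℤ} {ℓ ℓ' : Letter} (hℓ : ℓ.OnAlphabet h) (hℓ' : ℓ'.OnAlphabet h)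
    (hn : NullStep ℓ ℓ') (hoff : OffAxis ℓ) : ℓ'.a < h := by
  by_contra hge
  have hxy := xy_eq_zero_of_not_lt hℓ' hge
  have e1 := hℓ.1
  have e2 := hℓ'.1
  unfold Letter.height at e1 e2
  have ha' : ℓ'.a = h := by
    have := level_le_of_onAlphabet hℓ'
    omega
  obtain ⟨hlt, hsq⟩ := hn
  rw [hxy.1, hxy.2] at hsq
  have hP : 0 < |ℓ.x| := abs_pos.mpr hoff.1
  have hQ : 0 < |ℓ.y| := abs_pos.mpr hoff.2
  have hx2 : (0 - ℓ.x) ^ 2 = |ℓ.x| ^ 2 := by rw [zero_sub, neg_sq, sq_abs]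
  have hy2 : (0 - ℓ.y) ^ 2 = |ℓ.y| ^ 2 := by rw [zero_sub, neg_sq, sq_abs]
  rw [hx2, hy2] at hsq
  nlinarith [mul_pos hP hQ]

/-- **Branch B ⇒ at every slot pair `(g,j)` (complement `(g′,j′)`): an HH-cornered P-carrier `x` AND two supported N-cells, `x` with
ONE strict null step at `g`, resp. at `j`** — six P-cells and twelve N-cells, pairwise distinct across pairs by their charged slots
(`ne_of_offAxis_of_hub`, `nullStep_offAxis_lt`). -/
theorem hhCorner_edges_of_branchB {h : ℤ} {D : Design} (hD : D.OnAlphabet h) (hA : D.A1) (hμ : D.mu ≠ 0)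
    (hB : 2 * RingTwoMassLaw.ClassLaw.E h D + |D.mu.re| ≤ 0 ∧ 2 * RingTwoMassLaw.ClassLaw.E h D + |D.mu.im| ≤ 0)
    (hr : RuleD D) (hdis : Disj D)
    (g j g' j' : Fin 4) (hgj : g < j) (hg'j' : g' < j')
    (h1 : g ≠ g') (h2 : g ≠ j') (h3 : j ≠ g') (h4 : j ≠ j') :
    ∃ x ∈ D.suppP, HubPair h x g' j' ∧ OffAxis (x g) ∧ OffAxis (x j) ∧
      (∃ y ∈ D.suppN, NullStep (x g) (y g) ∧ ∀ f : Fin 4, f ≠ g → y f = x f) ∧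
      (∃ y ∈ D.suppN, NullStep (x j) (y j) ∧ ∀ f : Fin 4, f ≠ j → y f = x f) := by
  obtain ⟨x, hx, hhub, hg, hj⟩ := hhCorner_of_branchB hD hA hμ hB hr hdis g j g' j' hgj hg'j' h1 h2 h3 h4
  exact ⟨x, hx, hhub, hg, hj, edgeN_of_hub hD hr hdis hx h1 hg hhub.1, edgeN_of_hub hD hr hdis hx h3 hj hhub.1⟩

end HHCorner

/-! ## §8 THE SHAPE LAWS — every e-free product shape, every placement, every degree (clause 2 of (A1) only)

Under clause 2 a per-slot factor `1`, `h − a`, `q_h` stands for `(h − z)^0, (h − z)^1, (h − z)^2`; a product shape of total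
shifted degree `D` therefore has signed moment `Φ_D = Σ_n (−1)^n C(D,n) h^{D−n} t_n` (`t_n = Tz` of any e-free word of degree `n`),
INDEPENDENT of the shape and of the placement `σ`.  `Φ_4 = E` (`E_expand`); the degree-4 instances are the pair and mixed laws above.
The degree-6 instance `(2,2,2,0) ~ (2,2,1,1)` is the kernel form of anomaly g16's «b-law»; degree 5 gives its companion rows.
All statements here are height-free and shell-free. -/

section ShapeLaws

/-- a pattern word read through a slot permutation `σ` (slot `σ i` carries the `i`-th pattern symbol). -/
def wperm (v : Word) (σ : Equiv.Perm (Fin 4)) : Word := fun f => v (σ.symm f)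

theorem efree_wperm {v : Word} (hv : v.efree) (σ : Equiv.Perm (Fin 4)) : (wperm v σ).efree := fun f => hv (σ.symm f)

theorem deg_wperm (v : Word) (σ : Equiv.Perm (Fin 4)) : (wperm v σ).deg = v.deg := by
  unfold Word.deg wperm
  exact Equiv.sum_comp σ.symm (fun i => (v i).deg)

/-- explicit four-symbol pattern word. -/
def mk4 (s t r u : Sym) : Word := ![s, t, r, u]
theorem mk4_0 (s t r u : Sym) : mk4 s t r u 0 = s := rfl
theorem mk4_1 (s t r u : Sym) : mk4 s t r u 1 = t := rfl
theorem mk4_2 (s t r u : Sym) : mk4 s t r u 2 = r := rfl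
theorem mk4_3 (s t r u : Sym) : mk4 s t r u 3 = u := rfl

theorem icellCoef_wperm (c : Cell) (s t r u : Sym) (σ : Equiv.Perm (Fin 4)) :
    icellCoef c (wperm (mk4 s t r u) σ) = s.icoef (c (σ 0)) * t.icoef (c (σ 1)) * r.icoef (c (σ 2)) * u.icoef (c (σ 3)) := by
  unfold icellCoef
  rw [← Equiv.prod_comp σ (fun f => ((wperm (mk4 s t r u) σ) f).icoef (c f))]
  simp only [wperm, Equiv.symm_apply_apply, Fin.prod_univ_four, mk4_0, mk4_1, mk4_2, mk4_3]

/-- reference e-free words of degrees 5, 6, 7 (degrees 0–4: `Word.unit, ref1, ref2, ref3, ref4`). -/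
def ref5 : Word := ![Sym.pt, Sym.pt, Sym.h, Sym.one]
def ref6 : Word := ![Sym.pt, Sym.pt, Sym.pt, Sym.one]
def ref7 : Word := ![Sym.pt, Sym.pt, Sym.pt, Sym.h]

/-- `Φ_1 = Σ_n (−1)^n C(1,n) h^(1−n) t_n`. -/
def Phi1 (h : ℤ) (D : Design) : ℤ := 1 * h * D.Tz Word.unit + (-1 : ℤ) * D.Tz ref1

/-- `Φ_2 = Σ_n (−1)^n C(2,n) h^(2−n) t_n`. -/
def Phi2 (h : ℤ) (D : Design) : ℤ := 1 * h ^ 2 * D.Tz Word.unit + (-2 : ℤ) * h * D.Tz ref1 + 1 * D.Tz ref2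

/-- `Φ_3 = Σ_n (−1)^n C(3,n) h^(3−n) t_n`. -/
def Phi3 (h : ℤ) (D : Design) : ℤ := 1 * h ^ 3 * D.Tz Word.unit + (-3 : ℤ) * h ^ 2 * D.Tz ref1 + 3 * h * D.Tz ref2 + (-1 : ℤ) * D.Tz ref3

/-- `Φ_5 = Σ_n (−1)^n C(5,n) h^(5−n) t_n`. -/
def Phi5 (h : ℤ) (D : Design) : ℤ := 1 * h ^ 5 * D.Tz Word.unit + (-5 : ℤ) * h ^ 4 * D.Tz ref1 + 10 * h ^ 3 * D.Tz ref2 + (-10 : ℤ) * h ^ 2 * D.Tz ref3 + 5 * h * D.Tz ref4 + (-1 : ℤ) * D.Tz ref5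

/-- `Φ_6 = Σ_n (−1)^n C(6,n) h^(6−n) t_n`. -/
def Phi6 (h : ℤ) (D : Design) : ℤ := 1 * h ^ 6 * D.Tz Word.unit + (-6 : ℤ) * h ^ 5 * D.Tz ref1 + 15 * h ^ 4 * D.Tz ref2 + (-20 : ℤ) * h ^ 3 * D.Tz ref3 + 15 * h ^ 2 * D.Tz ref4 + (-6 : ℤ) * h * D.Tz ref5 + 1 * D.Tz ref6

/-- `Φ_7 = Σ_n (−1)^n C(7,n) h^(7−n) t_n`. -/
def Phi7 (h : ℤ) (D : Design) : ℤ := 1 * h ^ 7 * D.Tz Word.unit + (-7 : ℤ) * h ^ 6 * D.Tz ref1 + 21 * h ^ 5 * D.Tz ref2 + (-35 : ℤ) * h ^ 4 * D.Tz ref3 + 35 * h ^ 3 * D.Tz ref4 + (-21 : ℤ) * h ^ 2 * D.Tz ref5 + 7 * h * D.Tz ref6 + (-1 : ℤ) * D.Tz ref7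

/-- clause 2 makes every permuted pattern word's `Tz` equal to the reference value of its degree. -/
theorem Tz_wperm (D : Design) (h1 : D.A1) {s t r u : Sym} (hs : s.efree = true) (ht : t.efree = true)
    (hr : r.efree = true) (hu : u.efree = true) (σ : Equiv.Perm (Fin 4)) (w : Word) (hw : w.efree)
    (hd : (mk4 s t r u).deg = w.deg) : D.Tz (wperm (mk4 s t r u) σ) = D.Tz w := by
  refine Tz_eq_of_A1 D h1 _ _ (efree_wperm ?_ σ) hw (by rw [deg_wperm, hd])
  intro f; fin_cases f
  · exact hs
  · exact ht
  · exact hr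
  · exact hu

theorem ref5_ok : efreeB ref5 = true ∧ ref5.deg = 5 := by decide
theorem ref6_ok : efreeB ref6 = true ∧ ref6.deg = 6 := by decide
theorem ref7_ok : efreeB ref7 = true ∧ ref7.deg = 7 := by decide

/-- the shape `(1,0,0,0)` placed by `σ`: col · 1 · 1 · 1 at slots `σ 0..3`. -/
def sh1000 (h : ℤ) (σ : Equiv.Perm (Fin 4)) (c : Cell) : ℤ := (h - (c (σ 0)).a)

theorem sh1000_expand (h : ℤ) (σ : Equiv.Perm (Fin 4)) (c : Cell) : sh1000 h σ c =
    1 * h * icellCoef c (wperm (mk4 Sym.one Sym.one Sym.one Sym.one) σ)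
      + (-1 : ℤ) * icellCoef c (wperm (mk4 Sym.h Sym.one Sym.one Sym.one) σ) := by
  simp only [sh1000, icellCoef_wperm, Sym.icoef]
  ring

theorem linZ_sh1000 (h : ℤ) (σ : Equiv.Perm (Fin 4)) (L : List (Cell × ℕ)) : linZ L (sh1000 h σ) =
    1 * h * linZ L (fun c => icellCoef c (wperm (mk4 Sym.one Sym.one Sym.one Sym.one) σ))
      + (-1 : ℤ) * linZ L (fun c => icellCoef c (wperm (mk4 Sym.h Sym.one Sym.one Sym.one) σ)) := by
  induction L with
  | nil => simp [linZ]
  | cons a t ih => simp only [linZ_cons]; rw [ih, sh1000_expand h σ]; ring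

/-- moment law for the shape `(1,0,0,0)`: its signed moment is `Φ_1`, whatever the placement. -/
theorem sh1000_moment (h : ℤ) (D : Design) (h1 : D.A1) (σ : Equiv.Perm (Fin 4)) :
    linZ D.N (sh1000 h σ) - linZ D.P (sh1000 h σ) = Phi1 h D := by
  have q1 := Tz_wperm D h1 (s := Sym.one) (t := Sym.one) (r := Sym.one) (u := Sym.one) rfl rfl rfl rfl σ Word.unit unit_efree (by decide)
  have q2 := Tz_wperm D h1 (s := Sym.h) (t := Sym.one) (r := Sym.one) (u := Sym.one) rfl rfl rfl rfl σ ref1 (efree_of_efreeB _ (by decide)) (by decide)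
  rw [linZ_sh1000 h σ, linZ_sh1000 h σ]
  unfold Phi1 Design.Tz at *
  linear_combination 1 * h * q1 + (-1 : ℤ) * q2

/-- alphabet form of the shape `(1,0,0,0)`: `|xy|` for each `q`, `col` for each `h − a`. -/
def a1000 (σ : Equiv.Perm (Fin 4)) (c : Cell) : ℤ := (c (σ 0)).colevel

theorem sh1000_alpha {h : ℤ} {c : Cell} (hc : ∀ f : Fin 4, (c f).OnAlphabet h) (σ : Equiv.Perm (Fin 4)) :
    sh1000 h σ c = 1 * a1000 σ c := by
  unfold sh1000 a1000
  rw [col_eq (hc (σ 0))]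
  ring

theorem sh1000_moment_alpha {h : ℤ} {D : Design} (hD : D.OnAlphabet h) (h1 : D.A1) (σ : Equiv.Perm (Fin 4)) :
    1 * (linZ D.N (a1000 σ) - linZ D.P (a1000 σ)) = Phi1 h D := by
  rw [← sh1000_moment h D h1 σ,
    linZ_congr' D.N (sh1000 h σ) (fun c => 1 * a1000 σ c) fun cm hm hp => sh1000_alpha (onAlphabet_of_N hD hm hp) σ,
    linZ_congr' D.P (sh1000 h σ) (fun c => 1 * a1000 σ c) fun cm hm hp => sh1000_alpha (onAlphabet_of_P hD hm hp) σ,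
    linZ_smul, linZ_smul]
  ring

/-- the shape `(2,0,0,0)` placed by `σ`: q · 1 · 1 · 1 at slots `σ 0..3`. -/
def sh2000 (h : ℤ) (σ : Equiv.Perm (Fin 4)) (c : Cell) : ℤ := qv h (c (σ 0))

theorem sh2000_expand (h : ℤ) (σ : Equiv.Perm (Fin 4)) (c : Cell) : sh2000 h σ c =
    1 * icellCoef c (wperm (mk4 Sym.pt Sym.one Sym.one Sym.one) σ)
      + (-2 : ℤ) * h * icellCoef c (wperm (mk4 Sym.h Sym.one Sym.one Sym.one) σ)
      + 1 * h ^ 2 * icellCoef c (wperm (mk4 Sym.one Sym.one Sym.one Sym.one) σ) := by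
  simp only [sh2000, icellCoef_wperm, Sym.icoef, qv]
  ring

theorem linZ_sh2000 (h : ℤ) (σ : Equiv.Perm (Fin 4)) (L : List (Cell × ℕ)) : linZ L (sh2000 h σ) =
    1 * linZ L (fun c => icellCoef c (wperm (mk4 Sym.pt Sym.one Sym.one Sym.one) σ))
      + (-2 : ℤ) * h * linZ L (fun c => icellCoef c (wperm (mk4 Sym.h Sym.one Sym.one Sym.one) σ))
      + 1 * h ^ 2 * linZ L (fun c => icellCoef c (wperm (mk4 Sym.one Sym.one Sym.one Sym.one) σ)) := by
  induction L with
  | nil => simp [linZ]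
  | cons a t ih => simp only [linZ_cons]; rw [ih, sh2000_expand h σ]; ring

/-- moment law for the shape `(2,0,0,0)`: its signed moment is `Φ_2`, whatever the placement. -/
theorem sh2000_moment (h : ℤ) (D : Design) (h1 : D.A1) (σ : Equiv.Perm (Fin 4)) :
    linZ D.N (sh2000 h σ) - linZ D.P (sh2000 h σ) = Phi2 h D := by
  have q1 := Tz_wperm D h1 (s := Sym.pt) (t := Sym.one) (r := Sym.one) (u := Sym.one) rfl rfl rfl rfl σ ref2 (efree_of_efreeB _ (by decide)) (by decide)
  have q2 := Tz_wperm D h1 (s := Sym.h) (t := Sym.one) (r := Sym.one) (u := Sym.one) rfl rfl rfl rfl σ ref1 (efree_of_efreeB _ (by decide)) (by decide)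
  have q3 := Tz_wperm D h1 (s := Sym.one) (t := Sym.one) (r := Sym.one) (u := Sym.one) rfl rfl rfl rfl σ Word.unit unit_efree (by decide)
  rw [linZ_sh2000 h σ, linZ_sh2000 h σ]
  unfold Phi2 Design.Tz at *
  linear_combination 1 * q1 + (-2 : ℤ) * h * q2 + 1 * h ^ 2 * q3

/-- alphabet form of the shape `(2,0,0,0)`: `|xy|` for each `q`, `col` for each `h − a`. -/
def a2000 (σ : Equiv.Perm (Fin 4)) (c : Cell) : ℤ := (|(c (σ 0)).x| * |(c (σ 0)).y|)

theorem sh2000_alpha {h : ℤ} {c : Cell} (hc : ∀ f : Fin 4, (c f).OnAlphabet h) (σ : Equiv.Perm (Fin 4)) :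
    sh2000 h σ c = 2 * a2000 σ c := by
  unfold sh2000 a2000
  rw [qv_eq (hc (σ 0))]
  ring

theorem sh2000_moment_alpha {h : ℤ} {D : Design} (hD : D.OnAlphabet h) (h1 : D.A1) (σ : Equiv.Perm (Fin 4)) :
    2 * (linZ D.N (a2000 σ) - linZ D.P (a2000 σ)) = Phi2 h D := by
  rw [← sh2000_moment h D h1 σ,
    linZ_congr' D.N (sh2000 h σ) (fun c => 2 * a2000 σ c) fun cm hm hp => sh2000_alpha (onAlphabet_of_N hD hm hp) σ,
    linZ_congr' D.P (sh2000 h σ) (fun c => 2 * a2000 σ c) fun cm hm hp => sh2000_alpha (onAlphabet_of_P hD hm hp) σ,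
    linZ_smul, linZ_smul]
  ring

/-- the shape `(1,1,0,0)` placed by `σ`: col · col · 1 · 1 at slots `σ 0..3`. -/
def sh1100 (h : ℤ) (σ : Equiv.Perm (Fin 4)) (c : Cell) : ℤ := (h - (c (σ 0)).a) * (h - (c (σ 1)).a)

theorem sh1100_expand (h : ℤ) (σ : Equiv.Perm (Fin 4)) (c : Cell) : sh1100 h σ c =
    1 * h ^ 2 * icellCoef c (wperm (mk4 Sym.one Sym.one Sym.one Sym.one) σ)
      + (-1 : ℤ) * h * icellCoef c (wperm (mk4 Sym.one Sym.h Sym.one Sym.one) σ)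
      + (-1 : ℤ) * h * icellCoef c (wperm (mk4 Sym.h Sym.one Sym.one Sym.one) σ)
      + 1 * icellCoef c (wperm (mk4 Sym.h Sym.h Sym.one Sym.one) σ) := by
  simp only [sh1100, icellCoef_wperm, Sym.icoef]
  ring

theorem linZ_sh1100 (h : ℤ) (σ : Equiv.Perm (Fin 4)) (L : List (Cell × ℕ)) : linZ L (sh1100 h σ) =
    1 * h ^ 2 * linZ L (fun c => icellCoef c (wperm (mk4 Sym.one Sym.one Sym.one Sym.one) σ))
      + (-1 : ℤ) * h * linZ L (fun c => icellCoef c (wperm (mk4 Sym.one Sym.h Sym.one Sym.one) σ))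
      + (-1 : ℤ) * h * linZ L (fun c => icellCoef c (wperm (mk4 Sym.h Sym.one Sym.one Sym.one) σ))
      + 1 * linZ L (fun c => icellCoef c (wperm (mk4 Sym.h Sym.h Sym.one Sym.one) σ)) := by
  induction L with
  | nil => simp [linZ]
  | cons a t ih => simp only [linZ_cons]; rw [ih, sh1100_expand h σ]; ring

/-- moment law for the shape `(1,1,0,0)`: its signed moment is `Φ_2`, whatever the placement. -/
theorem sh1100_moment (h : ℤ) (D : Design) (h1 : D.A1) (σ : Equiv.Perm (Fin 4)) :
    linZ D.N (sh1100 h σ) - linZ D.P (sh1100 h σ) = Phi2 h D := by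
  have q1 := Tz_wperm D h1 (s := Sym.one) (t := Sym.one) (r := Sym.one) (u := Sym.one) rfl rfl rfl rfl σ Word.unit unit_efree (by decide)
  have q2 := Tz_wperm D h1 (s := Sym.one) (t := Sym.h) (r := Sym.one) (u := Sym.one) rfl rfl rfl rfl σ ref1 (efree_of_efreeB _ (by decide)) (by decide)
  have q3 := Tz_wperm D h1 (s := Sym.h) (t := Sym.one) (r := Sym.one) (u := Sym.one) rfl rfl rfl rfl σ ref1 (efree_of_efreeB _ (by decide)) (by decide)
  have q4 := Tz_wperm D h1 (s := Sym.h) (t := Sym.h) (r := Sym.one) (u := Sym.one) rfl rfl rfl rfl σ ref2 (efree_of_efreeB _ (by decide)) (by decide)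
  rw [linZ_sh1100 h σ, linZ_sh1100 h σ]
  unfold Phi2 Design.Tz at *
  linear_combination 1 * h ^ 2 * q1 + (-1 : ℤ) * h * q2 + (-1 : ℤ) * h * q3 + 1 * q4

/-- alphabet form of the shape `(1,1,0,0)`: `|xy|` for each `q`, `col` for each `h − a`. -/
def a1100 (σ : Equiv.Perm (Fin 4)) (c : Cell) : ℤ := (c (σ 0)).colevel * (c (σ 1)).colevel

theorem sh1100_alpha {h : ℤ} {c : Cell} (hc : ∀ f : Fin 4, (c f).OnAlphabet h) (σ : Equiv.Perm (Fin 4)) :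
    sh1100 h σ c = 1 * a1100 σ c := by
  unfold sh1100 a1100
  rw [col_eq (hc (σ 0)), col_eq (hc (σ 1))]
  ring

theorem sh1100_moment_alpha {h : ℤ} {D : Design} (hD : D.OnAlphabet h) (h1 : D.A1) (σ : Equiv.Perm (Fin 4)) :
    1 * (linZ D.N (a1100 σ) - linZ D.P (a1100 σ)) = Phi2 h D := by
  rw [← sh1100_moment h D h1 σ,
    linZ_congr' D.N (sh1100 h σ) (fun c => 1 * a1100 σ c) fun cm hm hp => sh1100_alpha (onAlphabet_of_N hD hm hp) σ,
    linZ_congr' D.P (sh1100 h σ) (fun c => 1 * a1100 σ c) fun cm hm hp => sh1100_alpha (onAlphabet_of_P hD hm hp) σ,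
    linZ_smul, linZ_smul]
  ring

/-- the shape `(2,1,0,0)` placed by `σ`: q · col · 1 · 1 at slots `σ 0..3`. -/
def sh2100 (h : ℤ) (σ : Equiv.Perm (Fin 4)) (c : Cell) : ℤ := qv h (c (σ 0)) * (h - (c (σ 1)).a)

theorem sh2100_expand (h : ℤ) (σ : Equiv.Perm (Fin 4)) (c : Cell) : sh2100 h σ c =
    1 * h * icellCoef c (wperm (mk4 Sym.pt Sym.one Sym.one Sym.one) σ)
      + (-1 : ℤ) * icellCoef c (wperm (mk4 Sym.pt Sym.h Sym.one Sym.one) σ)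
      + (-2 : ℤ) * h ^ 2 * icellCoef c (wperm (mk4 Sym.h Sym.one Sym.one Sym.one) σ)
      + 2 * h * icellCoef c (wperm (mk4 Sym.h Sym.h Sym.one Sym.one) σ)
      + 1 * h ^ 3 * icellCoef c (wperm (mk4 Sym.one Sym.one Sym.one Sym.one) σ)
      + (-1 : ℤ) * h ^ 2 * icellCoef c (wperm (mk4 Sym.one Sym.h Sym.one Sym.one) σ) := by
  simp only [sh2100, icellCoef_wperm, Sym.icoef, qv]
  ring

theorem linZ_sh2100 (h : ℤ) (σ : Equiv.Perm (Fin 4)) (L : List (Cell × ℕ)) : linZ L (sh2100 h σ) =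
    1 * h * linZ L (fun c => icellCoef c (wperm (mk4 Sym.pt Sym.one Sym.one Sym.one) σ))
      + (-1 : ℤ) * linZ L (fun c => icellCoef c (wperm (mk4 Sym.pt Sym.h Sym.one Sym.one) σ))
      + (-2 : ℤ) * h ^ 2 * linZ L (fun c => icellCoef c (wperm (mk4 Sym.h Sym.one Sym.one Sym.one) σ))
      + 2 * h * linZ L (fun c => icellCoef c (wperm (mk4 Sym.h Sym.h Sym.one Sym.one) σ))
      + 1 * h ^ 3 * linZ L (fun c => icellCoef c (wperm (mk4 Sym.one Sym.one Sym.one Sym.one) σ))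
      + (-1 : ℤ) * h ^ 2 * linZ L (fun c => icellCoef c (wperm (mk4 Sym.one Sym.h Sym.one Sym.one) σ)) := by
  induction L with
  | nil => simp [linZ]
  | cons a t ih => simp only [linZ_cons]; rw [ih, sh2100_expand h σ]; ring

/-- moment law for the shape `(2,1,0,0)`: its signed moment is `Φ_3`, whatever the placement. -/
theorem sh2100_moment (h : ℤ) (D : Design) (h1 : D.A1) (σ : Equiv.Perm (Fin 4)) :
    linZ D.N (sh2100 h σ) - linZ D.P (sh2100 h σ) = Phi3 h D := by
  have q1 := Tz_wperm D h1 (s := Sym.pt) (t := Sym.one) (r := Sym.one) (u := Sym.one) rfl rfl rfl rfl σ ref2 (efree_of_efreeB _ (by decide)) (by decide)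
  have q2 := Tz_wperm D h1 (s := Sym.pt) (t := Sym.h) (r := Sym.one) (u := Sym.one) rfl rfl rfl rfl σ ref3 (efree_of_efreeB _ (by decide)) (by decide)
  have q3 := Tz_wperm D h1 (s := Sym.h) (t := Sym.one) (r := Sym.one) (u := Sym.one) rfl rfl rfl rfl σ ref1 (efree_of_efreeB _ (by decide)) (by decide)
  have q4 := Tz_wperm D h1 (s := Sym.h) (t := Sym.h) (r := Sym.one) (u := Sym.one) rfl rfl rfl rfl σ ref2 (efree_of_efreeB _ (by decide)) (by decide)
  have q5 := Tz_wperm D h1 (s := Sym.one) (t := Sym.one) (r := Sym.one) (u := Sym.one) rfl rfl rfl rfl σ Word.unit unit_efree (by decide)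
  have q6 := Tz_wperm D h1 (s := Sym.one) (t := Sym.h) (r := Sym.one) (u := Sym.one) rfl rfl rfl rfl σ ref1 (efree_of_efreeB _ (by decide)) (by decide)
  rw [linZ_sh2100 h σ, linZ_sh2100 h σ]
  unfold Phi3 Design.Tz at *
  linear_combination 1 * h * q1 + (-1 : ℤ) * q2 + (-2 : ℤ) * h ^ 2 * q3 + 2 * h * q4 + 1 * h ^ 3 * q5 + (-1 : ℤ) * h ^ 2 * q6

/-- alphabet form of the shape `(2,1,0,0)`: `|xy|` for each `q`, `col` for each `h − a`. -/
def a2100 (σ : Equiv.Perm (Fin 4)) (c : Cell) : ℤ := (|(c (σ 0)).x| * |(c (σ 0)).y|) * (c (σ 1)).colevel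

theorem sh2100_alpha {h : ℤ} {c : Cell} (hc : ∀ f : Fin 4, (c f).OnAlphabet h) (σ : Equiv.Perm (Fin 4)) :
    sh2100 h σ c = 2 * a2100 σ c := by
  unfold sh2100 a2100
  rw [qv_eq (hc (σ 0)), col_eq (hc (σ 1))]
  ring

theorem sh2100_moment_alpha {h : ℤ} {D : Design} (hD : D.OnAlphabet h) (h1 : D.A1) (σ : Equiv.Perm (Fin 4)) :
    2 * (linZ D.N (a2100 σ) - linZ D.P (a2100 σ)) = Phi3 h D := by
  rw [← sh2100_moment h D h1 σ,
    linZ_congr' D.N (sh2100 h σ) (fun c => 2 * a2100 σ c) fun cm hm hp => sh2100_alpha (onAlphabet_of_N hD hm hp) σ,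
    linZ_congr' D.P (sh2100 h σ) (fun c => 2 * a2100 σ c) fun cm hm hp => sh2100_alpha (onAlphabet_of_P hD hm hp) σ,
    linZ_smul, linZ_smul]
  ring

/-- the shape `(1,1,1,0)` placed by `σ`: col · col · col · 1 at slots `σ 0..3`. -/
def sh1110 (h : ℤ) (σ : Equiv.Perm (Fin 4)) (c : Cell) : ℤ := (h - (c (σ 0)).a) * (h - (c (σ 1)).a) * (h - (c (σ 2)).a)

theorem sh1110_expand (h : ℤ) (σ : Equiv.Perm (Fin 4)) (c : Cell) : sh1110 h σ c =
    1 * h ^ 3 * icellCoef c (wperm (mk4 Sym.one Sym.one Sym.one Sym.one) σ)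
      + (-1 : ℤ) * h ^ 2 * icellCoef c (wperm (mk4 Sym.one Sym.one Sym.h Sym.one) σ)
      + (-1 : ℤ) * h ^ 2 * icellCoef c (wperm (mk4 Sym.one Sym.h Sym.one Sym.one) σ)
      + 1 * h * icellCoef c (wperm (mk4 Sym.one Sym.h Sym.h Sym.one) σ)
      + (-1 : ℤ) * h ^ 2 * icellCoef c (wperm (mk4 Sym.h Sym.one Sym.one Sym.one) σ)
      + 1 * h * icellCoef c (wperm (mk4 Sym.h Sym.one Sym.h Sym.one) σ)
      + 1 * h * icellCoef c (wperm (mk4 Sym.h Sym.h Sym.one Sym.one) σ)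
      + (-1 : ℤ) * icellCoef c (wperm (mk4 Sym.h Sym.h Sym.h Sym.one) σ) := by
  simp only [sh1110, icellCoef_wperm, Sym.icoef]
  ring

theorem linZ_sh1110 (h : ℤ) (σ : Equiv.Perm (Fin 4)) (L : List (Cell × ℕ)) : linZ L (sh1110 h σ) =
    1 * h ^ 3 * linZ L (fun c => icellCoef c (wperm (mk4 Sym.one Sym.one Sym.one Sym.one) σ))
      + (-1 : ℤ) * h ^ 2 * linZ L (fun c => icellCoef c (wperm (mk4 Sym.one Sym.one Sym.h Sym.one) σ))
      + (-1 : ℤ) * h ^ 2 * linZ L (fun c => icellCoef c (wperm (mk4 Sym.one Sym.h Sym.one Sym.one) σ))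
      + 1 * h * linZ L (fun c => icellCoef c (wperm (mk4 Sym.one Sym.h Sym.h Sym.one) σ))
      + (-1 : ℤ) * h ^ 2 * linZ L (fun c => icellCoef c (wperm (mk4 Sym.h Sym.one Sym.one Sym.one) σ))
      + 1 * h * linZ L (fun c => icellCoef c (wperm (mk4 Sym.h Sym.one Sym.h Sym.one) σ))
      + 1 * h * linZ L (fun c => icellCoef c (wperm (mk4 Sym.h Sym.h Sym.one Sym.one) σ))
      + (-1 : ℤ) * linZ L (fun c => icellCoef c (wperm (mk4 Sym.h Sym.h Sym.h Sym.one) σ)) := by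
  induction L with
  | nil => simp [linZ]
  | cons a t ih => simp only [linZ_cons]; rw [ih, sh1110_expand h σ]; ring

/-- moment law for the shape `(1,1,1,0)`: its signed moment is `Φ_3`, whatever the placement. -/
theorem sh1110_moment (h : ℤ) (D : Design) (h1 : D.A1) (σ : Equiv.Perm (Fin 4)) :
    linZ D.N (sh1110 h σ) - linZ D.P (sh1110 h σ) = Phi3 h D := by
  have q1 := Tz_wperm D h1 (s := Sym.one) (t := Sym.one) (r := Sym.one) (u := Sym.one) rfl rfl rfl rfl σ Word.unit unit_efree (by decide)
  have q2 := Tz_wperm D h1 (s := Sym.one) (t := Sym.one) (r := Sym.h) (u := Sym.one) rfl rfl rfl rfl σ ref1 (efree_of_efreeB _ (by decide)) (by decide)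
  have q3 := Tz_wperm D h1 (s := Sym.one) (t := Sym.h) (r := Sym.one) (u := Sym.one) rfl rfl rfl rfl σ ref1 (efree_of_efreeB _ (by decide)) (by decide)
  have q4 := Tz_wperm D h1 (s := Sym.one) (t := Sym.h) (r := Sym.h) (u := Sym.one) rfl rfl rfl rfl σ ref2 (efree_of_efreeB _ (by decide)) (by decide)
  have q5 := Tz_wperm D h1 (s := Sym.h) (t := Sym.one) (r := Sym.one) (u := Sym.one) rfl rfl rfl rfl σ ref1 (efree_of_efreeB _ (by decide)) (by decide)
  have q6 := Tz_wperm D h1 (s := Sym.h) (t := Sym.one) (r := Sym.h) (u := Sym.one) rfl rfl rfl rfl σ ref2 (efree_of_efreeB _ (by decide)) (by decide)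
  have q7 := Tz_wperm D h1 (s := Sym.h) (t := Sym.h) (r := Sym.one) (u := Sym.one) rfl rfl rfl rfl σ ref2 (efree_of_efreeB _ (by decide)) (by decide)
  have q8 := Tz_wperm D h1 (s := Sym.h) (t := Sym.h) (r := Sym.h) (u := Sym.one) rfl rfl rfl rfl σ ref3 (efree_of_efreeB _ (by decide)) (by decide)
  rw [linZ_sh1110 h σ, linZ_sh1110 h σ]
  unfold Phi3 Design.Tz at *
  linear_combination 1 * h ^ 3 * q1 + (-1 : ℤ) * h ^ 2 * q2 + (-1 : ℤ) * h ^ 2 * q3 + 1 * h * q4 + (-1 : ℤ) * h ^ 2 * q5 + 1 * h * q6 + 1 * h * q7 + (-1 : ℤ) * q8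

/-- alphabet form of the shape `(1,1,1,0)`: `|xy|` for each `q`, `col` for each `h − a`. -/
def a1110 (σ : Equiv.Perm (Fin 4)) (c : Cell) : ℤ := (c (σ 0)).colevel * (c (σ 1)).colevel * (c (σ 2)).colevel

theorem sh1110_alpha {h : ℤ} {c : Cell} (hc : ∀ f : Fin 4, (c f).OnAlphabet h) (σ : Equiv.Perm (Fin 4)) :
    sh1110 h σ c = 1 * a1110 σ c := by
  unfold sh1110 a1110
  rw [col_eq (hc (σ 0)), col_eq (hc (σ 1)), col_eq (hc (σ 2))]
  ring

theorem sh1110_moment_alpha {h : ℤ} {D : Design} (hD : D.OnAlphabet h) (h1 : D.A1) (σ : Equiv.Perm (Fin 4)) :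
    1 * (linZ D.N (a1110 σ) - linZ D.P (a1110 σ)) = Phi3 h D := by
  rw [← sh1110_moment h D h1 σ,
    linZ_congr' D.N (sh1110 h σ) (fun c => 1 * a1110 σ c) fun cm hm hp => sh1110_alpha (onAlphabet_of_N hD hm hp) σ,
    linZ_congr' D.P (sh1110 h σ) (fun c => 1 * a1110 σ c) fun cm hm hp => sh1110_alpha (onAlphabet_of_P hD hm hp) σ,
    linZ_smul, linZ_smul]
  ring

/-- the shape `(2,2,1,0)` placed by `σ`: q · q · col · 1 at slots `σ 0..3`. -/
def sh2210 (h : ℤ) (σ : Equiv.Perm (Fin 4)) (c : Cell) : ℤ := qv h (c (σ 0)) * qv h (c (σ 1)) * (h - (c (σ 2)).a)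

theorem sh2210_expand (h : ℤ) (σ : Equiv.Perm (Fin 4)) (c : Cell) : sh2210 h σ c =
    1 * h * icellCoef c (wperm (mk4 Sym.pt Sym.pt Sym.one Sym.one) σ)
      + (-1 : ℤ) * icellCoef c (wperm (mk4 Sym.pt Sym.pt Sym.h Sym.one) σ)
      + (-2 : ℤ) * h ^ 2 * icellCoef c (wperm (mk4 Sym.pt Sym.h Sym.one Sym.one) σ)
      + 2 * h * icellCoef c (wperm (mk4 Sym.pt Sym.h Sym.h Sym.one) σ)
      + 1 * h ^ 3 * icellCoef c (wperm (mk4 Sym.pt Sym.one Sym.one Sym.one) σ)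
      + (-1 : ℤ) * h ^ 2 * icellCoef c (wperm (mk4 Sym.pt Sym.one Sym.h Sym.one) σ)
      + (-2 : ℤ) * h ^ 2 * icellCoef c (wperm (mk4 Sym.h Sym.pt Sym.one Sym.one) σ)
      + 2 * h * icellCoef c (wperm (mk4 Sym.h Sym.pt Sym.h Sym.one) σ)
      + 4 * h ^ 3 * icellCoef c (wperm (mk4 Sym.h Sym.h Sym.one Sym.one) σ)
      + (-4 : ℤ) * h ^ 2 * icellCoef c (wperm (mk4 Sym.h Sym.h Sym.h Sym.one) σ)
      + (-2 : ℤ) * h ^ 4 * icellCoef c (wperm (mk4 Sym.h Sym.one Sym.one Sym.one) σ)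
      + 2 * h ^ 3 * icellCoef c (wperm (mk4 Sym.h Sym.one Sym.h Sym.one) σ)
      + 1 * h ^ 3 * icellCoef c (wperm (mk4 Sym.one Sym.pt Sym.one Sym.one) σ)
      + (-1 : ℤ) * h ^ 2 * icellCoef c (wperm (mk4 Sym.one Sym.pt Sym.h Sym.one) σ)
      + (-2 : ℤ) * h ^ 4 * icellCoef c (wperm (mk4 Sym.one Sym.h Sym.one Sym.one) σ)
      + 2 * h ^ 3 * icellCoef c (wperm (mk4 Sym.one Sym.h Sym.h Sym.one) σ)
      + 1 * h ^ 5 * icellCoef c (wperm (mk4 Sym.one Sym.one Sym.one Sym.one) σ)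
      + (-1 : ℤ) * h ^ 4 * icellCoef c (wperm (mk4 Sym.one Sym.one Sym.h Sym.one) σ) := by
  simp only [sh2210, icellCoef_wperm, Sym.icoef, qv]
  ring

theorem linZ_sh2210 (h : ℤ) (σ : Equiv.Perm (Fin 4)) (L : List (Cell × ℕ)) : linZ L (sh2210 h σ) =
    1 * h * linZ L (fun c => icellCoef c (wperm (mk4 Sym.pt Sym.pt Sym.one Sym.one) σ))
      + (-1 : ℤ) * linZ L (fun c => icellCoef c (wperm (mk4 Sym.pt Sym.pt Sym.h Sym.one) σ))
      + (-2 : ℤ) * h ^ 2 * linZ L (fun c => icellCoef c (wperm (mk4 Sym.pt Sym.h Sym.one Sym.one) σ))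
      + 2 * h * linZ L (fun c => icellCoef c (wperm (mk4 Sym.pt Sym.h Sym.h Sym.one) σ))
      + 1 * h ^ 3 * linZ L (fun c => icellCoef c (wperm (mk4 Sym.pt Sym.one Sym.one Sym.one) σ))
      + (-1 : ℤ) * h ^ 2 * linZ L (fun c => icellCoef c (wperm (mk4 Sym.pt Sym.one Sym.h Sym.one) σ))
      + (-2 : ℤ) * h ^ 2 * linZ L (fun c => icellCoef c (wperm (mk4 Sym.h Sym.pt Sym.one Sym.one) σ))
      + 2 * h * linZ L (fun c => icellCoef c (wperm (mk4 Sym.h Sym.pt Sym.h Sym.one) σ))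
      + 4 * h ^ 3 * linZ L (fun c => icellCoef c (wperm (mk4 Sym.h Sym.h Sym.one Sym.one) σ))
      + (-4 : ℤ) * h ^ 2 * linZ L (fun c => icellCoef c (wperm (mk4 Sym.h Sym.h Sym.h Sym.one) σ))
      + (-2 : ℤ) * h ^ 4 * linZ L (fun c => icellCoef c (wperm (mk4 Sym.h Sym.one Sym.one Sym.one) σ))
      + 2 * h ^ 3 * linZ L (fun c => icellCoef c (wperm (mk4 Sym.h Sym.one Sym.h Sym.one) σ))
      + 1 * h ^ 3 * linZ L (fun c => icellCoef c (wperm (mk4 Sym.one Sym.pt Sym.one Sym.one) σ))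
      + (-1 : ℤ) * h ^ 2 * linZ L (fun c => icellCoef c (wperm (mk4 Sym.one Sym.pt Sym.h Sym.one) σ))
      + (-2 : ℤ) * h ^ 4 * linZ L (fun c => icellCoef c (wperm (mk4 Sym.one Sym.h Sym.one Sym.one) σ))
      + 2 * h ^ 3 * linZ L (fun c => icellCoef c (wperm (mk4 Sym.one Sym.h Sym.h Sym.one) σ))
      + 1 * h ^ 5 * linZ L (fun c => icellCoef c (wperm (mk4 Sym.one Sym.one Sym.one Sym.one) σ))
      + (-1 : ℤ) * h ^ 4 * linZ L (fun c => icellCoef c (wperm (mk4 Sym.one Sym.one Sym.h Sym.one) σ)) := by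
  induction L with
  | nil => simp [linZ]
  | cons a t ih => simp only [linZ_cons]; rw [ih, sh2210_expand h σ]; ring

/-- moment law for the shape `(2,2,1,0)`: its signed moment is `Φ_5`, whatever the placement. -/
theorem sh2210_moment (h : ℤ) (D : Design) (h1 : D.A1) (σ : Equiv.Perm (Fin 4)) :
    linZ D.N (sh2210 h σ) - linZ D.P (sh2210 h σ) = Phi5 h D := by
  have q1 := Tz_wperm D h1 (s := Sym.pt) (t := Sym.pt) (r := Sym.one) (u := Sym.one) rfl rfl rfl rfl σ ref4 (efree_of_efreeB _ (by decide)) (by decide)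
  have q2 := Tz_wperm D h1 (s := Sym.pt) (t := Sym.pt) (r := Sym.h) (u := Sym.one) rfl rfl rfl rfl σ ref5 (efree_of_efreeB _ ref5_ok.1) (by rw [ref5_ok.2]; decide)
  have q3 := Tz_wperm D h1 (s := Sym.pt) (t := Sym.h) (r := Sym.one) (u := Sym.one) rfl rfl rfl rfl σ ref3 (efree_of_efreeB _ (by decide)) (by decide)
  have q4 := Tz_wperm D h1 (s := Sym.pt) (t := Sym.h) (r := Sym.h) (u := Sym.one) rfl rfl rfl rfl σ ref4 (efree_of_efreeB _ (by decide)) (by decide)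
  have q5 := Tz_wperm D h1 (s := Sym.pt) (t := Sym.one) (r := Sym.one) (u := Sym.one) rfl rfl rfl rfl σ ref2 (efree_of_efreeB _ (by decide)) (by decide)
  have q6 := Tz_wperm D h1 (s := Sym.pt) (t := Sym.one) (r := Sym.h) (u := Sym.one) rfl rfl rfl rfl σ ref3 (efree_of_efreeB _ (by decide)) (by decide)
  have q7 := Tz_wperm D h1 (s := Sym.h) (t := Sym.pt) (r := Sym.one) (u := Sym.one) rfl rfl rfl rfl σ ref3 (efree_of_efreeB _ (by decide)) (by decide)
  have q8 := Tz_wperm D h1 (s := Sym.h) (t := Sym.pt) (r := Sym.h) (u := Sym.one) rfl rfl rfl rfl σ ref4 (efree_of_efreeB _ (by decide)) (by decide)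
  have q9 := Tz_wperm D h1 (s := Sym.h) (t := Sym.h) (r := Sym.one) (u := Sym.one) rfl rfl rfl rfl σ ref2 (efree_of_efreeB _ (by decide)) (by decide)
  have q10 := Tz_wperm D h1 (s := Sym.h) (t := Sym.h) (r := Sym.h) (u := Sym.one) rfl rfl rfl rfl σ ref3 (efree_of_efreeB _ (by decide)) (by decide)
  have q11 := Tz_wperm D h1 (s := Sym.h) (t := Sym.one) (r := Sym.one) (u := Sym.one) rfl rfl rfl rfl σ ref1 (efree_of_efreeB _ (by decide)) (by decide)
  have q12 := Tz_wperm D h1 (s := Sym.h) (t := Sym.one) (r := Sym.h) (u := Sym.one) rfl rfl rfl rfl σ ref2 (efree_of_efreeB _ (by decide)) (by decide)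
  have q13 := Tz_wperm D h1 (s := Sym.one) (t := Sym.pt) (r := Sym.one) (u := Sym.one) rfl rfl rfl rfl σ ref2 (efree_of_efreeB _ (by decide)) (by decide)
  have q14 := Tz_wperm D h1 (s := Sym.one) (t := Sym.pt) (r := Sym.h) (u := Sym.one) rfl rfl rfl rfl σ ref3 (efree_of_efreeB _ (by decide)) (by decide)
  have q15 := Tz_wperm D h1 (s := Sym.one) (t := Sym.h) (r := Sym.one) (u := Sym.one) rfl rfl rfl rfl σ ref1 (efree_of_efreeB _ (by decide)) (by decide)
  have q16 := Tz_wperm D h1 (s := Sym.one) (t := Sym.h) (r := Sym.h) (u := Sym.one) rfl rfl rfl rfl σ ref2 (efree_of_efreeB _ (by decide)) (by decide)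
  have q17 := Tz_wperm D h1 (s := Sym.one) (t := Sym.one) (r := Sym.one) (u := Sym.one) rfl rfl rfl rfl σ Word.unit unit_efree (by decide)
  have q18 := Tz_wperm D h1 (s := Sym.one) (t := Sym.one) (r := Sym.h) (u := Sym.one) rfl rfl rfl rfl σ ref1 (efree_of_efreeB _ (by decide)) (by decide)
  rw [linZ_sh2210 h σ, linZ_sh2210 h σ]
  unfold Phi5 Design.Tz at *
  linear_combination 1 * h * q1 + (-1 : ℤ) * q2 + (-2 : ℤ) * h ^ 2 * q3 + 2 * h * q4 + 1 * h ^ 3 * q5 + (-1 : ℤ) * h ^ 2 * q6 + (-2 : ℤ) * h ^ 2 * q7 + 2 * h * q8 + 4 * h ^ 3 * q9 + (-4 : ℤ) * h ^ 2 * q10 + (-2 : ℤ) * h ^ 4 * q11 + 2 * h ^ 3 * q12 + 1 * h ^ 3 * q13 + (-1 : ℤ) * h ^ 2 * q14 + (-2 : ℤ) * h ^ 4 * q15 + 2 * h ^ 3 * q16 + 1 * h ^ 5 * q17 + (-1 : ℤ) * h ^ 4 * q18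

/-- alphabet form of the shape `(2,2,1,0)`: `|xy|` for each `q`, `col` for each `h − a`. -/
def a2210 (σ : Equiv.Perm (Fin 4)) (c : Cell) : ℤ := (|(c (σ 0)).x| * |(c (σ 0)).y|) * (|(c (σ 1)).x| * |(c (σ 1)).y|) * (c (σ 2)).colevel

theorem sh2210_alpha {h : ℤ} {c : Cell} (hc : ∀ f : Fin 4, (c f).OnAlphabet h) (σ : Equiv.Perm (Fin 4)) :
    sh2210 h σ c = 4 * a2210 σ c := by
  unfold sh2210 a2210
  rw [qv_eq (hc (σ 0)), qv_eq (hc (σ 1)), col_eq (hc (σ 2))]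
  ring

theorem sh2210_moment_alpha {h : ℤ} {D : Design} (hD : D.OnAlphabet h) (h1 : D.A1) (σ : Equiv.Perm (Fin 4)) :
    4 * (linZ D.N (a2210 σ) - linZ D.P (a2210 σ)) = Phi5 h D := by
  rw [← sh2210_moment h D h1 σ,
    linZ_congr' D.N (sh2210 h σ) (fun c => 4 * a2210 σ c) fun cm hm hp => sh2210_alpha (onAlphabet_of_N hD hm hp) σ,
    linZ_congr' D.P (sh2210 h σ) (fun c => 4 * a2210 σ c) fun cm hm hp => sh2210_alpha (onAlphabet_of_P hD hm hp) σ,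
    linZ_smul, linZ_smul]
  ring

/-- the shape `(2,1,1,1)` placed by `σ`: q · col · col · col at slots `σ 0..3`. -/
def sh2111 (h : ℤ) (σ : Equiv.Perm (Fin 4)) (c : Cell) : ℤ := qv h (c (σ 0)) * (h - (c (σ 1)).a) * (h - (c (σ 2)).a) * (h - (c (σ 3)).a)

theorem sh2111_expand (h : ℤ) (σ : Equiv.Perm (Fin 4)) (c : Cell) : sh2111 h σ c =
    1 * h ^ 3 * icellCoef c (wperm (mk4 Sym.pt Sym.one Sym.one Sym.one) σ)
      + (-1 : ℤ) * h ^ 2 * icellCoef c (wperm (mk4 Sym.pt Sym.one Sym.one Sym.h) σ)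
      + (-1 : ℤ) * h ^ 2 * icellCoef c (wperm (mk4 Sym.pt Sym.one Sym.h Sym.one) σ)
      + 1 * h * icellCoef c (wperm (mk4 Sym.pt Sym.one Sym.h Sym.h) σ)
      + (-1 : ℤ) * h ^ 2 * icellCoef c (wperm (mk4 Sym.pt Sym.h Sym.one Sym.one) σ)
      + 1 * h * icellCoef c (wperm (mk4 Sym.pt Sym.h Sym.one Sym.h) σ)
      + 1 * h * icellCoef c (wperm (mk4 Sym.pt Sym.h Sym.h Sym.one) σ)
      + (-1 : ℤ) * icellCoef c (wperm (mk4 Sym.pt Sym.h Sym.h Sym.h) σ)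
      + (-2 : ℤ) * h ^ 4 * icellCoef c (wperm (mk4 Sym.h Sym.one Sym.one Sym.one) σ)
      + 2 * h ^ 3 * icellCoef c (wperm (mk4 Sym.h Sym.one Sym.one Sym.h) σ)
      + 2 * h ^ 3 * icellCoef c (wperm (mk4 Sym.h Sym.one Sym.h Sym.one) σ)
      + (-2 : ℤ) * h ^ 2 * icellCoef c (wperm (mk4 Sym.h Sym.one Sym.h Sym.h) σ)
      + 2 * h ^ 3 * icellCoef c (wperm (mk4 Sym.h Sym.h Sym.one Sym.one) σ)
      + (-2 : ℤ) * h ^ 2 * icellCoef c (wperm (mk4 Sym.h Sym.h Sym.one Sym.h) σ)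
      + (-2 : ℤ) * h ^ 2 * icellCoef c (wperm (mk4 Sym.h Sym.h Sym.h Sym.one) σ)
      + 2 * h * icellCoef c (wperm (mk4 Sym.h Sym.h Sym.h Sym.h) σ)
      + 1 * h ^ 5 * icellCoef c (wperm (mk4 Sym.one Sym.one Sym.one Sym.one) σ)
      + (-1 : ℤ) * h ^ 4 * icellCoef c (wperm (mk4 Sym.one Sym.one Sym.one Sym.h) σ)
      + (-1 : ℤ) * h ^ 4 * icellCoef c (wperm (mk4 Sym.one Sym.one Sym.h Sym.one) σ)
      + 1 * h ^ 3 * icellCoef c (wperm (mk4 Sym.one Sym.one Sym.h Sym.h) σ)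
      + (-1 : ℤ) * h ^ 4 * icellCoef c (wperm (mk4 Sym.one Sym.h Sym.one Sym.one) σ)
      + 1 * h ^ 3 * icellCoef c (wperm (mk4 Sym.one Sym.h Sym.one Sym.h) σ)
      + 1 * h ^ 3 * icellCoef c (wperm (mk4 Sym.one Sym.h Sym.h Sym.one) σ)
      + (-1 : ℤ) * h ^ 2 * icellCoef c (wperm (mk4 Sym.one Sym.h Sym.h Sym.h) σ) := by
  simp only [sh2111, icellCoef_wperm, Sym.icoef, qv]
  ring

theorem linZ_sh2111 (h : ℤ) (σ : Equiv.Perm (Fin 4)) (L : List (Cell × ℕ)) : linZ L (sh2111 h σ) =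
    1 * h ^ 3 * linZ L (fun c => icellCoef c (wperm (mk4 Sym.pt Sym.one Sym.one Sym.one) σ))
      + (-1 : ℤ) * h ^ 2 * linZ L (fun c => icellCoef c (wperm (mk4 Sym.pt Sym.one Sym.one Sym.h) σ))
      + (-1 : ℤ) * h ^ 2 * linZ L (fun c => icellCoef c (wperm (mk4 Sym.pt Sym.one Sym.h Sym.one) σ))
      + 1 * h * linZ L (fun c => icellCoef c (wperm (mk4 Sym.pt Sym.one Sym.h Sym.h) σ))
      + (-1 : ℤ) * h ^ 2 * linZ L (fun c => icellCoef c (wperm (mk4 Sym.pt Sym.h Sym.one Sym.one) σ))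
      + 1 * h * linZ L (fun c => icellCoef c (wperm (mk4 Sym.pt Sym.h Sym.one Sym.h) σ))
      + 1 * h * linZ L (fun c => icellCoef c (wperm (mk4 Sym.pt Sym.h Sym.h Sym.one) σ))
      + (-1 : ℤ) * linZ L (fun c => icellCoef c (wperm (mk4 Sym.pt Sym.h Sym.h Sym.h) σ))
      + (-2 : ℤ) * h ^ 4 * linZ L (fun c => icellCoef c (wperm (mk4 Sym.h Sym.one Sym.one Sym.one) σ))
      + 2 * h ^ 3 * linZ L (fun c => icellCoef c (wperm (mk4 Sym.h Sym.one Sym.one Sym.h) σ))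
      + 2 * h ^ 3 * linZ L (fun c => icellCoef c (wperm (mk4 Sym.h Sym.one Sym.h Sym.one) σ))
      + (-2 : ℤ) * h ^ 2 * linZ L (fun c => icellCoef c (wperm (mk4 Sym.h Sym.one Sym.h Sym.h) σ))
      + 2 * h ^ 3 * linZ L (fun c => icellCoef c (wperm (mk4 Sym.h Sym.h Sym.one Sym.one) σ))
      + (-2 : ℤ) * h ^ 2 * linZ L (fun c => icellCoef c (wperm (mk4 Sym.h Sym.h Sym.one Sym.h) σ))
      + (-2 : ℤ) * h ^ 2 * linZ L (fun c => icellCoef c (wperm (mk4 Sym.h Sym.h Sym.h Sym.one) σ))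
      + 2 * h * linZ L (fun c => icellCoef c (wperm (mk4 Sym.h Sym.h Sym.h Sym.h) σ))
      + 1 * h ^ 5 * linZ L (fun c => icellCoef c (wperm (mk4 Sym.one Sym.one Sym.one Sym.one) σ))
      + (-1 : ℤ) * h ^ 4 * linZ L (fun c => icellCoef c (wperm (mk4 Sym.one Sym.one Sym.one Sym.h) σ))
      + (-1 : ℤ) * h ^ 4 * linZ L (fun c => icellCoef c (wperm (mk4 Sym.one Sym.one Sym.h Sym.one) σ))
      + 1 * h ^ 3 * linZ L (fun c => icellCoef c (wperm (mk4 Sym.one Sym.one Sym.h Sym.h) σ))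
      + (-1 : ℤ) * h ^ 4 * linZ L (fun c => icellCoef c (wperm (mk4 Sym.one Sym.h Sym.one Sym.one) σ))
      + 1 * h ^ 3 * linZ L (fun c => icellCoef c (wperm (mk4 Sym.one Sym.h Sym.one Sym.h) σ))
      + 1 * h ^ 3 * linZ L (fun c => icellCoef c (wperm (mk4 Sym.one Sym.h Sym.h Sym.one) σ))
      + (-1 : ℤ) * h ^ 2 * linZ L (fun c => icellCoef c (wperm (mk4 Sym.one Sym.h Sym.h Sym.h) σ)) := by
  induction L with
  | nil => simp [linZ]
  | cons a t ih => simp only [linZ_cons]; rw [ih, sh2111_expand h σ]; ring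

/-- moment law for the shape `(2,1,1,1)`: its signed moment is `Φ_5`, whatever the placement. -/
theorem sh2111_moment (h : ℤ) (D : Design) (h1 : D.A1) (σ : Equiv.Perm (Fin 4)) :
    linZ D.N (sh2111 h σ) - linZ D.P (sh2111 h σ) = Phi5 h D := by
  have q1 := Tz_wperm D h1 (s := Sym.pt) (t := Sym.one) (r := Sym.one) (u := Sym.one) rfl rfl rfl rfl σ ref2 (efree_of_efreeB _ (by decide)) (by decide)
  have q2 := Tz_wperm D h1 (s := Sym.pt) (t := Sym.one) (r := Sym.one) (u := Sym.h) rfl rfl rfl rfl σ ref3 (efree_of_efreeB _ (by decide)) (by decide)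
  have q3 := Tz_wperm D h1 (s := Sym.pt) (t := Sym.one) (r := Sym.h) (u := Sym.one) rfl rfl rfl rfl σ ref3 (efree_of_efreeB _ (by decide)) (by decide)
  have q4 := Tz_wperm D h1 (s := Sym.pt) (t := Sym.one) (r := Sym.h) (u := Sym.h) rfl rfl rfl rfl σ ref4 (efree_of_efreeB _ (by decide)) (by decide)
  have q5 := Tz_wperm D h1 (s := Sym.pt) (t := Sym.h) (r := Sym.one) (u := Sym.one) rfl rfl rfl rfl σ ref3 (efree_of_efreeB _ (by decide)) (by decide)
  have q6 := Tz_wperm D h1 (s := Sym.pt) (t := Sym.h) (r := Sym.one) (u := Sym.h) rfl rfl rfl rfl σ ref4 (efree_of_efreeB _ (by decide)) (by decide)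
  have q7 := Tz_wperm D h1 (s := Sym.pt) (t := Sym.h) (r := Sym.h) (u := Sym.one) rfl rfl rfl rfl σ ref4 (efree_of_efreeB _ (by decide)) (by decide)
  have q8 := Tz_wperm D h1 (s := Sym.pt) (t := Sym.h) (r := Sym.h) (u := Sym.h) rfl rfl rfl rfl σ ref5 (efree_of_efreeB _ ref5_ok.1) (by rw [ref5_ok.2]; decide)
  have q9 := Tz_wperm D h1 (s := Sym.h) (t := Sym.one) (r := Sym.one) (u := Sym.one) rfl rfl rfl rfl σ ref1 (efree_of_efreeB _ (by decide)) (by decide)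
  have q10 := Tz_wperm D h1 (s := Sym.h) (t := Sym.one) (r := Sym.one) (u := Sym.h) rfl rfl rfl rfl σ ref2 (efree_of_efreeB _ (by decide)) (by decide)
  have q11 := Tz_wperm D h1 (s := Sym.h) (t := Sym.one) (r := Sym.h) (u := Sym.one) rfl rfl rfl rfl σ ref2 (efree_of_efreeB _ (by decide)) (by decide)
  have q12 := Tz_wperm D h1 (s := Sym.h) (t := Sym.one) (r := Sym.h) (u := Sym.h) rfl rfl rfl rfl σ ref3 (efree_of_efreeB _ (by decide)) (by decide)
  have q13 := Tz_wperm D h1 (s := Sym.h) (t := Sym.h) (r := Sym.one) (u := Sym.one) rfl rfl rfl rfl σ ref2 (efree_of_efreeB _ (by decide)) (by decide)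
  have q14 := Tz_wperm D h1 (s := Sym.h) (t := Sym.h) (r := Sym.one) (u := Sym.h) rfl rfl rfl rfl σ ref3 (efree_of_efreeB _ (by decide)) (by decide)
  have q15 := Tz_wperm D h1 (s := Sym.h) (t := Sym.h) (r := Sym.h) (u := Sym.one) rfl rfl rfl rfl σ ref3 (efree_of_efreeB _ (by decide)) (by decide)
  have q16 := Tz_wperm D h1 (s := Sym.h) (t := Sym.h) (r := Sym.h) (u := Sym.h) rfl rfl rfl rfl σ ref4 (efree_of_efreeB _ (by decide)) (by decide)
  have q17 := Tz_wperm D h1 (s := Sym.one) (t := Sym.one) (r := Sym.one) (u := Sym.one) rfl rfl rfl rfl σ Word.unit unit_efree (by decide)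
  have q18 := Tz_wperm D h1 (s := Sym.one) (t := Sym.one) (r := Sym.one) (u := Sym.h) rfl rfl rfl rfl σ ref1 (efree_of_efreeB _ (by decide)) (by decide)
  have q19 := Tz_wperm D h1 (s := Sym.one) (t := Sym.one) (r := Sym.h) (u := Sym.one) rfl rfl rfl rfl σ ref1 (efree_of_efreeB _ (by decide)) (by decide)
  have q20 := Tz_wperm D h1 (s := Sym.one) (t := Sym.one) (r := Sym.h) (u := Sym.h) rfl rfl rfl rfl σ ref2 (efree_of_efreeB _ (by decide)) (by decide)
  have q21 := Tz_wperm D h1 (s := Sym.one) (t := Sym.h) (r := Sym.one) (u := Sym.one) rfl rfl rfl rfl σ ref1 (efree_of_efreeB _ (by decide)) (by decide)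
  have q22 := Tz_wperm D h1 (s := Sym.one) (t := Sym.h) (r := Sym.one) (u := Sym.h) rfl rfl rfl rfl σ ref2 (efree_of_efreeB _ (by decide)) (by decide)
  have q23 := Tz_wperm D h1 (s := Sym.one) (t := Sym.h) (r := Sym.h) (u := Sym.one) rfl rfl rfl rfl σ ref2 (efree_of_efreeB _ (by decide)) (by decide)
  have q24 := Tz_wperm D h1 (s := Sym.one) (t := Sym.h) (r := Sym.h) (u := Sym.h) rfl rfl rfl rfl σ ref3 (efree_of_efreeB _ (by decide)) (by decide)
  rw [linZ_sh2111 h σ, linZ_sh2111 h σ]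
  unfold Phi5 Design.Tz at *
  linear_combination 1 * h ^ 3 * q1 + (-1 : ℤ) * h ^ 2 * q2 + (-1 : ℤ) * h ^ 2 * q3 + 1 * h * q4 + (-1 : ℤ) * h ^ 2 * q5 + 1 * h * q6 + 1 * h * q7 + (-1 : ℤ) * q8 + (-2 : ℤ) * h ^ 4 * q9 + 2 * h ^ 3 * q10 + 2 * h ^ 3 * q11 + (-2 : ℤ) * h ^ 2 * q12 + 2 * h ^ 3 * q13 + (-2 : ℤ) * h ^ 2 * q14 + (-2 : ℤ) * h ^ 2 * q15 + 2 * h * q16 + 1 * h ^ 5 * q17 + (-1 : ℤ) * h ^ 4 * q18 + (-1 : ℤ) * h ^ 4 * q19 + 1 * h ^ 3 * q20 + (-1 : ℤ) * h ^ 4 * q21 + 1 * h ^ 3 * q22 + 1 * h ^ 3 * q23 + (-1 : ℤ) * h ^ 2 * q24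

/-- alphabet form of the shape `(2,1,1,1)`: `|xy|` for each `q`, `col` for each `h − a`. -/
def a2111 (σ : Equiv.Perm (Fin 4)) (c : Cell) : ℤ := (|(c (σ 0)).x| * |(c (σ 0)).y|) * (c (σ 1)).colevel * (c (σ 2)).colevel * (c (σ 3)).colevel

theorem sh2111_alpha {h : ℤ} {c : Cell} (hc : ∀ f : Fin 4, (c f).OnAlphabet h) (σ : Equiv.Perm (Fin 4)) :
    sh2111 h σ c = 2 * a2111 σ c := by
  unfold sh2111 a2111
  rw [qv_eq (hc (σ 0)), col_eq (hc (σ 1)), col_eq (hc (σ 2)), col_eq (hc (σ 3))]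
  ring

theorem sh2111_moment_alpha {h : ℤ} {D : Design} (hD : D.OnAlphabet h) (h1 : D.A1) (σ : Equiv.Perm (Fin 4)) :
    2 * (linZ D.N (a2111 σ) - linZ D.P (a2111 σ)) = Phi5 h D := by
  rw [← sh2111_moment h D h1 σ,
    linZ_congr' D.N (sh2111 h σ) (fun c => 2 * a2111 σ c) fun cm hm hp => sh2111_alpha (onAlphabet_of_N hD hm hp) σ,
    linZ_congr' D.P (sh2111 h σ) (fun c => 2 * a2111 σ c) fun cm hm hp => sh2111_alpha (onAlphabet_of_P hD hm hp) σ,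
    linZ_smul, linZ_smul]
  ring

/-- the shape `(2,2,2,0)` placed by `σ`: q · q · q · 1 at slots `σ 0..3`. -/
def sh2220 (h : ℤ) (σ : Equiv.Perm (Fin 4)) (c : Cell) : ℤ := qv h (c (σ 0)) * qv h (c (σ 1)) * qv h (c (σ 2))

theorem sh2220_expand (h : ℤ) (σ : Equiv.Perm (Fin 4)) (c : Cell) : sh2220 h σ c =
    1 * icellCoef c (wperm (mk4 Sym.pt Sym.pt Sym.pt Sym.one) σ)
      + (-2 : ℤ) * h * icellCoef c (wperm (mk4 Sym.pt Sym.pt Sym.h Sym.one) σ)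
      + 1 * h ^ 2 * icellCoef c (wperm (mk4 Sym.pt Sym.pt Sym.one Sym.one) σ)
      + (-2 : ℤ) * h * icellCoef c (wperm (mk4 Sym.pt Sym.h Sym.pt Sym.one) σ)
      + 4 * h ^ 2 * icellCoef c (wperm (mk4 Sym.pt Sym.h Sym.h Sym.one) σ)
      + (-2 : ℤ) * h ^ 3 * icellCoef c (wperm (mk4 Sym.pt Sym.h Sym.one Sym.one) σ)
      + 1 * h ^ 2 * icellCoef c (wperm (mk4 Sym.pt Sym.one Sym.pt Sym.one) σ)
      + (-2 : ℤ) * h ^ 3 * icellCoef c (wperm (mk4 Sym.pt Sym.one Sym.h Sym.one) σ)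
      + 1 * h ^ 4 * icellCoef c (wperm (mk4 Sym.pt Sym.one Sym.one Sym.one) σ)
      + (-2 : ℤ) * h * icellCoef c (wperm (mk4 Sym.h Sym.pt Sym.pt Sym.one) σ)
      + 4 * h ^ 2 * icellCoef c (wperm (mk4 Sym.h Sym.pt Sym.h Sym.one) σ)
      + (-2 : ℤ) * h ^ 3 * icellCoef c (wperm (mk4 Sym.h Sym.pt Sym.one Sym.one) σ)
      + 4 * h ^ 2 * icellCoef c (wperm (mk4 Sym.h Sym.h Sym.pt Sym.one) σ)
      + (-8 : ℤ) * h ^ 3 * icellCoef c (wperm (mk4 Sym.h Sym.h Sym.h Sym.one) σ)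
      + 4 * h ^ 4 * icellCoef c (wperm (mk4 Sym.h Sym.h Sym.one Sym.one) σ)
      + (-2 : ℤ) * h ^ 3 * icellCoef c (wperm (mk4 Sym.h Sym.one Sym.pt Sym.one) σ)
      + 4 * h ^ 4 * icellCoef c (wperm (mk4 Sym.h Sym.one Sym.h Sym.one) σ)
      + (-2 : ℤ) * h ^ 5 * icellCoef c (wperm (mk4 Sym.h Sym.one Sym.one Sym.one) σ)
      + 1 * h ^ 2 * icellCoef c (wperm (mk4 Sym.one Sym.pt Sym.pt Sym.one) σ)
      + (-2 : ℤ) * h ^ 3 * icellCoef c (wperm (mk4 Sym.one Sym.pt Sym.h Sym.one) σ)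
      + 1 * h ^ 4 * icellCoef c (wperm (mk4 Sym.one Sym.pt Sym.one Sym.one) σ)
      + (-2 : ℤ) * h ^ 3 * icellCoef c (wperm (mk4 Sym.one Sym.h Sym.pt Sym.one) σ)
      + 4 * h ^ 4 * icellCoef c (wperm (mk4 Sym.one Sym.h Sym.h Sym.one) σ)
      + (-2 : ℤ) * h ^ 5 * icellCoef c (wperm (mk4 Sym.one Sym.h Sym.one Sym.one) σ)
      + 1 * h ^ 4 * icellCoef c (wperm (mk4 Sym.one Sym.one Sym.pt Sym.one) σ)
      + (-2 : ℤ) * h ^ 5 * icellCoef c (wperm (mk4 Sym.one Sym.one Sym.h Sym.one) σ)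
      + 1 * h ^ 6 * icellCoef c (wperm (mk4 Sym.one Sym.one Sym.one Sym.one) σ) := by
  simp only [sh2220, icellCoef_wperm, Sym.icoef, qv]
  ring

theorem linZ_sh2220 (h : ℤ) (σ : Equiv.Perm (Fin 4)) (L : List (Cell × ℕ)) : linZ L (sh2220 h σ) =
    1 * linZ L (fun c => icellCoef c (wperm (mk4 Sym.pt Sym.pt Sym.pt Sym.one) σ))
      + (-2 : ℤ) * h * linZ L (fun c => icellCoef c (wperm (mk4 Sym.pt Sym.pt Sym.h Sym.one) σ))
      + 1 * h ^ 2 * linZ L (fun c => icellCoef c (wperm (mk4 Sym.pt Sym.pt Sym.one Sym.one) σ))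
      + (-2 : ℤ) * h * linZ L (fun c => icellCoef c (wperm (mk4 Sym.pt Sym.h Sym.pt Sym.one) σ))
      + 4 * h ^ 2 * linZ L (fun c => icellCoef c (wperm (mk4 Sym.pt Sym.h Sym.h Sym.one) σ))
      + (-2 : ℤ) * h ^ 3 * linZ L (fun c => icellCoef c (wperm (mk4 Sym.pt Sym.h Sym.one Sym.one) σ))
      + 1 * h ^ 2 * linZ L (fun c => icellCoef c (wperm (mk4 Sym.pt Sym.one Sym.pt Sym.one) σ))
      + (-2 : ℤ) * h ^ 3 * linZ L (fun c => icellCoef c (wperm (mk4 Sym.pt Sym.one Sym.h Sym.one) σ))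
      + 1 * h ^ 4 * linZ L (fun c => icellCoef c (wperm (mk4 Sym.pt Sym.one Sym.one Sym.one) σ))
      + (-2 : ℤ) * h * linZ L (fun c => icellCoef c (wperm (mk4 Sym.h Sym.pt Sym.pt Sym.one) σ))
      + 4 * h ^ 2 * linZ L (fun c => icellCoef c (wperm (mk4 Sym.h Sym.pt Sym.h Sym.one) σ))
      + (-2 : ℤ) * h ^ 3 * linZ L (fun c => icellCoef c (wperm (mk4 Sym.h Sym.pt Sym.one Sym.one) σ))
      + 4 * h ^ 2 * linZ L (fun c => icellCoef c (wperm (mk4 Sym.h Sym.h Sym.pt Sym.one) σ))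
      + (-8 : ℤ) * h ^ 3 * linZ L (fun c => icellCoef c (wperm (mk4 Sym.h Sym.h Sym.h Sym.one) σ))
      + 4 * h ^ 4 * linZ L (fun c => icellCoef c (wperm (mk4 Sym.h Sym.h Sym.one Sym.one) σ))
      + (-2 : ℤ) * h ^ 3 * linZ L (fun c => icellCoef c (wperm (mk4 Sym.h Sym.one Sym.pt Sym.one) σ))
      + 4 * h ^ 4 * linZ L (fun c => icellCoef c (wperm (mk4 Sym.h Sym.one Sym.h Sym.one) σ))
      + (-2 : ℤ) * h ^ 5 * linZ L (fun c => icellCoef c (wperm (mk4 Sym.h Sym.one Sym.one Sym.one) σ))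
      + 1 * h ^ 2 * linZ L (fun c => icellCoef c (wperm (mk4 Sym.one Sym.pt Sym.pt Sym.one) σ))
      + (-2 : ℤ) * h ^ 3 * linZ L (fun c => icellCoef c (wperm (mk4 Sym.one Sym.pt Sym.h Sym.one) σ))
      + 1 * h ^ 4 * linZ L (fun c => icellCoef c (wperm (mk4 Sym.one Sym.pt Sym.one Sym.one) σ))
      + (-2 : ℤ) * h ^ 3 * linZ L (fun c => icellCoef c (wperm (mk4 Sym.one Sym.h Sym.pt Sym.one) σ))
      + 4 * h ^ 4 * linZ L (fun c => icellCoef c (wperm (mk4 Sym.one Sym.h Sym.h Sym.one) σ))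
      + (-2 : ℤ) * h ^ 5 * linZ L (fun c => icellCoef c (wperm (mk4 Sym.one Sym.h Sym.one Sym.one) σ))
      + 1 * h ^ 4 * linZ L (fun c => icellCoef c (wperm (mk4 Sym.one Sym.one Sym.pt Sym.one) σ))
      + (-2 : ℤ) * h ^ 5 * linZ L (fun c => icellCoef c (wperm (mk4 Sym.one Sym.one Sym.h Sym.one) σ))
      + 1 * h ^ 6 * linZ L (fun c => icellCoef c (wperm (mk4 Sym.one Sym.one Sym.one Sym.one) σ)) := by
  induction L with
  | nil => simp [linZ]
  | cons a t ih => simp only [linZ_cons]; rw [ih, sh2220_expand h σ]; ring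

/-- moment law for the shape `(2,2,2,0)`: its signed moment is `Φ_6`, whatever the placement. -/
theorem sh2220_moment (h : ℤ) (D : Design) (h1 : D.A1) (σ : Equiv.Perm (Fin 4)) :
    linZ D.N (sh2220 h σ) - linZ D.P (sh2220 h σ) = Phi6 h D := by
  have q1 := Tz_wperm D h1 (s := Sym.pt) (t := Sym.pt) (r := Sym.pt) (u := Sym.one) rfl rfl rfl rfl σ ref6 (efree_of_efreeB _ ref6_ok.1) (by rw [ref6_ok.2]; decide)
  have q2 := Tz_wperm D h1 (s := Sym.pt) (t := Sym.pt) (r := Sym.h) (u := Sym.one) rfl rfl rfl rfl σ ref5 (efree_of_efreeB _ ref5_ok.1) (by rw [ref5_ok.2]; decide)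
  have q3 := Tz_wperm D h1 (s := Sym.pt) (t := Sym.pt) (r := Sym.one) (u := Sym.one) rfl rfl rfl rfl σ ref4 (efree_of_efreeB _ (by decide)) (by decide)
  have q4 := Tz_wperm D h1 (s := Sym.pt) (t := Sym.h) (r := Sym.pt) (u := Sym.one) rfl rfl rfl rfl σ ref5 (efree_of_efreeB _ ref5_ok.1) (by rw [ref5_ok.2]; decide)
  have q5 := Tz_wperm D h1 (s := Sym.pt) (t := Sym.h) (r := Sym.h) (u := Sym.one) rfl rfl rfl rfl σ ref4 (efree_of_efreeB _ (by decide)) (by decide)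
  have q6 := Tz_wperm D h1 (s := Sym.pt) (t := Sym.h) (r := Sym.one) (u := Sym.one) rfl rfl rfl rfl σ ref3 (efree_of_efreeB _ (by decide)) (by decide)
  have q7 := Tz_wperm D h1 (s := Sym.pt) (t := Sym.one) (r := Sym.pt) (u := Sym.one) rfl rfl rfl rfl σ ref4 (efree_of_efreeB _ (by decide)) (by decide)
  have q8 := Tz_wperm D h1 (s := Sym.pt) (t := Sym.one) (r := Sym.h) (u := Sym.one) rfl rfl rfl rfl σ ref3 (efree_of_efreeB _ (by decide)) (by decide)
  have q9 := Tz_wperm D h1 (s := Sym.pt) (t := Sym.one) (r := Sym.one) (u := Sym.one) rfl rfl rfl rfl σ ref2 (efree_of_efreeB _ (by decide)) (by decide)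
  have q10 := Tz_wperm D h1 (s := Sym.h) (t := Sym.pt) (r := Sym.pt) (u := Sym.one) rfl rfl rfl rfl σ ref5 (efree_of_efreeB _ ref5_ok.1) (by rw [ref5_ok.2]; decide)
  have q11 := Tz_wperm D h1 (s := Sym.h) (t := Sym.pt) (r := Sym.h) (u := Sym.one) rfl rfl rfl rfl σ ref4 (efree_of_efreeB _ (by decide)) (by decide)
  have q12 := Tz_wperm D h1 (s := Sym.h) (t := Sym.pt) (r := Sym.one) (u := Sym.one) rfl rfl rfl rfl σ ref3 (efree_of_efreeB _ (by decide)) (by decide)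
  have q13 := Tz_wperm D h1 (s := Sym.h) (t := Sym.h) (r := Sym.pt) (u := Sym.one) rfl rfl rfl rfl σ ref4 (efree_of_efreeB _ (by decide)) (by decide)
  have q14 := Tz_wperm D h1 (s := Sym.h) (t := Sym.h) (r := Sym.h) (u := Sym.one) rfl rfl rfl rfl σ ref3 (efree_of_efreeB _ (by decide)) (by decide)
  have q15 := Tz_wperm D h1 (s := Sym.h) (t := Sym.h) (r := Sym.one) (u := Sym.one) rfl rfl rfl rfl σ ref2 (efree_of_efreeB _ (by decide)) (by decide)
  have q16 := Tz_wperm D h1 (s := Sym.h) (t := Sym.one) (r := Sym.pt) (u := Sym.one) rfl rfl rfl rfl σ ref3 (efree_of_efreeB _ (by decide)) (by decide)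
  have q17 := Tz_wperm D h1 (s := Sym.h) (t := Sym.one) (r := Sym.h) (u := Sym.one) rfl rfl rfl rfl σ ref2 (efree_of_efreeB _ (by decide)) (by decide)
  have q18 := Tz_wperm D h1 (s := Sym.h) (t := Sym.one) (r := Sym.one) (u := Sym.one) rfl rfl rfl rfl σ ref1 (efree_of_efreeB _ (by decide)) (by decide)
  have q19 := Tz_wperm D h1 (s := Sym.one) (t := Sym.pt) (r := Sym.pt) (u := Sym.one) rfl rfl rfl rfl σ ref4 (efree_of_efreeB _ (by decide)) (by decide)
  have q20 := Tz_wperm D h1 (s := Sym.one) (t := Sym.pt) (r := Sym.h) (u := Sym.one) rfl rfl rfl rfl σ ref3 (efree_of_efreeB _ (by decide)) (by decide)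
  have q21 := Tz_wperm D h1 (s := Sym.one) (t := Sym.pt) (r := Sym.one) (u := Sym.one) rfl rfl rfl rfl σ ref2 (efree_of_efreeB _ (by decide)) (by decide)
  have q22 := Tz_wperm D h1 (s := Sym.one) (t := Sym.h) (r := Sym.pt) (u := Sym.one) rfl rfl rfl rfl σ ref3 (efree_of_efreeB _ (by decide)) (by decide)
  have q23 := Tz_wperm D h1 (s := Sym.one) (t := Sym.h) (r := Sym.h) (u := Sym.one) rfl rfl rfl rfl σ ref2 (efree_of_efreeB _ (by decide)) (by decide)
  have q24 := Tz_wperm D h1 (s := Sym.one) (t := Sym.h) (r := Sym.one) (u := Sym.one) rfl rfl rfl rfl σ ref1 (efree_of_efreeB _ (by decide)) (by decide)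
  have q25 := Tz_wperm D h1 (s := Sym.one) (t := Sym.one) (r := Sym.pt) (u := Sym.one) rfl rfl rfl rfl σ ref2 (efree_of_efreeB _ (by decide)) (by decide)
  have q26 := Tz_wperm D h1 (s := Sym.one) (t := Sym.one) (r := Sym.h) (u := Sym.one) rfl rfl rfl rfl σ ref1 (efree_of_efreeB _ (by decide)) (by decide)
  have q27 := Tz_wperm D h1 (s := Sym.one) (t := Sym.one) (r := Sym.one) (u := Sym.one) rfl rfl rfl rfl σ Word.unit unit_efree (by decide)
  rw [linZ_sh2220 h σ, linZ_sh2220 h σ]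
  unfold Phi6 Design.Tz at *
  linear_combination 1 * q1 + (-2 : ℤ) * h * q2 + 1 * h ^ 2 * q3 + (-2 : ℤ) * h * q4 + 4 * h ^ 2 * q5 + (-2 : ℤ) * h ^ 3 * q6 + 1 * h ^ 2 * q7 + (-2 : ℤ) * h ^ 3 * q8 + 1 * h ^ 4 * q9 + (-2 : ℤ) * h * q10 + 4 * h ^ 2 * q11 + (-2 : ℤ) * h ^ 3 * q12 + 4 * h ^ 2 * q13 + (-8 : ℤ) * h ^ 3 * q14 + 4 * h ^ 4 * q15 + (-2 : ℤ) * h ^ 3 * q16 + 4 * h ^ 4 * q17 + (-2 : ℤ) * h ^ 5 * q18 + 1 * h ^ 2 * q19 + (-2 : ℤ) * h ^ 3 * q20 + 1 * h ^ 4 * q21 + (-2 : ℤ) * h ^ 3 * q22 + 4 * h ^ 4 * q23 + (-2 : ℤ) * h ^ 5 * q24 + 1 * h ^ 4 * q25 + (-2 : ℤ) * h ^ 5 * q26 + 1 * h ^ 6 * q27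

/-- alphabet form of the shape `(2,2,2,0)`: `|xy|` for each `q`, `col` for each `h − a`. -/
def a2220 (σ : Equiv.Perm (Fin 4)) (c : Cell) : ℤ := (|(c (σ 0)).x| * |(c (σ 0)).y|) * (|(c (σ 1)).x| * |(c (σ 1)).y|) * (|(c (σ 2)).x| * |(c (σ 2)).y|)

theorem sh2220_alpha {h : ℤ} {c : Cell} (hc : ∀ f : Fin 4, (c f).OnAlphabet h) (σ : Equiv.Perm (Fin 4)) :
    sh2220 h σ c = 8 * a2220 σ c := by
  unfold sh2220 a2220
  rw [qv_eq (hc (σ 0)), qv_eq (hc (σ 1)), qv_eq (hc (σ 2))]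
  ring

theorem sh2220_moment_alpha {h : ℤ} {D : Design} (hD : D.OnAlphabet h) (h1 : D.A1) (σ : Equiv.Perm (Fin 4)) :
    8 * (linZ D.N (a2220 σ) - linZ D.P (a2220 σ)) = Phi6 h D := by
  rw [← sh2220_moment h D h1 σ,
    linZ_congr' D.N (sh2220 h σ) (fun c => 8 * a2220 σ c) fun cm hm hp => sh2220_alpha (onAlphabet_of_N hD hm hp) σ,
    linZ_congr' D.P (sh2220 h σ) (fun c => 8 * a2220 σ c) fun cm hm hp => sh2220_alpha (onAlphabet_of_P hD hm hp) σ,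
    linZ_smul, linZ_smul]
  ring

/-- the shape `(2,2,1,1)` placed by `σ`: q · q · col · col at slots `σ 0..3`. -/
def sh2211 (h : ℤ) (σ : Equiv.Perm (Fin 4)) (c : Cell) : ℤ := qv h (c (σ 0)) * qv h (c (σ 1)) * (h - (c (σ 2)).a) * (h - (c (σ 3)).a)

theorem sh2211_expand (h : ℤ) (σ : Equiv.Perm (Fin 4)) (c : Cell) : sh2211 h σ c =
    1 * h ^ 2 * icellCoef c (wperm (mk4 Sym.pt Sym.pt Sym.one Sym.one) σ)
      + (-1 : ℤ) * h * icellCoef c (wperm (mk4 Sym.pt Sym.pt Sym.one Sym.h) σ)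
      + (-1 : ℤ) * h * icellCoef c (wperm (mk4 Sym.pt Sym.pt Sym.h Sym.one) σ)
      + 1 * icellCoef c (wperm (mk4 Sym.pt Sym.pt Sym.h Sym.h) σ)
      + (-2 : ℤ) * h ^ 3 * icellCoef c (wperm (mk4 Sym.pt Sym.h Sym.one Sym.one) σ)
      + 2 * h ^ 2 * icellCoef c (wperm (mk4 Sym.pt Sym.h Sym.one Sym.h) σ)
      + 2 * h ^ 2 * icellCoef c (wperm (mk4 Sym.pt Sym.h Sym.h Sym.one) σ)
      + (-2 : ℤ) * h * icellCoef c (wperm (mk4 Sym.pt Sym.h Sym.h Sym.h) σ)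
      + 1 * h ^ 4 * icellCoef c (wperm (mk4 Sym.pt Sym.one Sym.one Sym.one) σ)
      + (-1 : ℤ) * h ^ 3 * icellCoef c (wperm (mk4 Sym.pt Sym.one Sym.one Sym.h) σ)
      + (-1 : ℤ) * h ^ 3 * icellCoef c (wperm (mk4 Sym.pt Sym.one Sym.h Sym.one) σ)
      + 1 * h ^ 2 * icellCoef c (wperm (mk4 Sym.pt Sym.one Sym.h Sym.h) σ)
      + (-2 : ℤ) * h ^ 3 * icellCoef c (wperm (mk4 Sym.h Sym.pt Sym.one Sym.one) σ)
      + 2 * h ^ 2 * icellCoef c (wperm (mk4 Sym.h Sym.pt Sym.one Sym.h) σ)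
      + 2 * h ^ 2 * icellCoef c (wperm (mk4 Sym.h Sym.pt Sym.h Sym.one) σ)
      + (-2 : ℤ) * h * icellCoef c (wperm (mk4 Sym.h Sym.pt Sym.h Sym.h) σ)
      + 4 * h ^ 4 * icellCoef c (wperm (mk4 Sym.h Sym.h Sym.one Sym.one) σ)
      + (-4 : ℤ) * h ^ 3 * icellCoef c (wperm (mk4 Sym.h Sym.h Sym.one Sym.h) σ)
      + (-4 : ℤ) * h ^ 3 * icellCoef c (wperm (mk4 Sym.h Sym.h Sym.h Sym.one) σ)
      + 4 * h ^ 2 * icellCoef c (wperm (mk4 Sym.h Sym.h Sym.h Sym.h) σ)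
      + (-2 : ℤ) * h ^ 5 * icellCoef c (wperm (mk4 Sym.h Sym.one Sym.one Sym.one) σ)
      + 2 * h ^ 4 * icellCoef c (wperm (mk4 Sym.h Sym.one Sym.one Sym.h) σ)
      + 2 * h ^ 4 * icellCoef c (wperm (mk4 Sym.h Sym.one Sym.h Sym.one) σ)
      + (-2 : ℤ) * h ^ 3 * icellCoef c (wperm (mk4 Sym.h Sym.one Sym.h Sym.h) σ)
      + 1 * h ^ 4 * icellCoef c (wperm (mk4 Sym.one Sym.pt Sym.one Sym.one) σ)
      + (-1 : ℤ) * h ^ 3 * icellCoef c (wperm (mk4 Sym.one Sym.pt Sym.one Sym.h) σ)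
      + (-1 : ℤ) * h ^ 3 * icellCoef c (wperm (mk4 Sym.one Sym.pt Sym.h Sym.one) σ)
      + 1 * h ^ 2 * icellCoef c (wperm (mk4 Sym.one Sym.pt Sym.h Sym.h) σ)
      + (-2 : ℤ) * h ^ 5 * icellCoef c (wperm (mk4 Sym.one Sym.h Sym.one Sym.one) σ)
      + 2 * h ^ 4 * icellCoef c (wperm (mk4 Sym.one Sym.h Sym.one Sym.h) σ)
      + 2 * h ^ 4 * icellCoef c (wperm (mk4 Sym.one Sym.h Sym.h Sym.one) σ)
      + (-2 : ℤ) * h ^ 3 * icellCoef c (wperm (mk4 Sym.one Sym.h Sym.h Sym.h) σ)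
      + 1 * h ^ 6 * icellCoef c (wperm (mk4 Sym.one Sym.one Sym.one Sym.one) σ)
      + (-1 : ℤ) * h ^ 5 * icellCoef c (wperm (mk4 Sym.one Sym.one Sym.one Sym.h) σ)
      + (-1 : ℤ) * h ^ 5 * icellCoef c (wperm (mk4 Sym.one Sym.one Sym.h Sym.one) σ)
      + 1 * h ^ 4 * icellCoef c (wperm (mk4 Sym.one Sym.one Sym.h Sym.h) σ) := by
  simp only [sh2211, icellCoef_wperm, Sym.icoef, qv]
  ring

theorem linZ_sh2211 (h : ℤ) (σ : Equiv.Perm (Fin 4)) (L : List (Cell × ℕ)) : linZ L (sh2211 h σ) =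
    1 * h ^ 2 * linZ L (fun c => icellCoef c (wperm (mk4 Sym.pt Sym.pt Sym.one Sym.one) σ))
      + (-1 : ℤ) * h * linZ L (fun c => icellCoef c (wperm (mk4 Sym.pt Sym.pt Sym.one Sym.h) σ))
      + (-1 : ℤ) * h * linZ L (fun c => icellCoef c (wperm (mk4 Sym.pt Sym.pt Sym.h Sym.one) σ))
      + 1 * linZ L (fun c => icellCoef c (wperm (mk4 Sym.pt Sym.pt Sym.h Sym.h) σ))
      + (-2 : ℤ) * h ^ 3 * linZ L (fun c => icellCoef c (wperm (mk4 Sym.pt Sym.h Sym.one Sym.one) σ))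
      + 2 * h ^ 2 * linZ L (fun c => icellCoef c (wperm (mk4 Sym.pt Sym.h Sym.one Sym.h) σ))
      + 2 * h ^ 2 * linZ L (fun c => icellCoef c (wperm (mk4 Sym.pt Sym.h Sym.h Sym.one) σ))
      + (-2 : ℤ) * h * linZ L (fun c => icellCoef c (wperm (mk4 Sym.pt Sym.h Sym.h Sym.h) σ))
      + 1 * h ^ 4 * linZ L (fun c => icellCoef c (wperm (mk4 Sym.pt Sym.one Sym.one Sym.one) σ))
      + (-1 : ℤ) * h ^ 3 * linZ L (fun c => icellCoef c (wperm (mk4 Sym.pt Sym.one Sym.one Sym.h) σ))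
      + (-1 : ℤ) * h ^ 3 * linZ L (fun c => icellCoef c (wperm (mk4 Sym.pt Sym.one Sym.h Sym.one) σ))
      + 1 * h ^ 2 * linZ L (fun c => icellCoef c (wperm (mk4 Sym.pt Sym.one Sym.h Sym.h) σ))
      + (-2 : ℤ) * h ^ 3 * linZ L (fun c => icellCoef c (wperm (mk4 Sym.h Sym.pt Sym.one Sym.one) σ))
      + 2 * h ^ 2 * linZ L (fun c => icellCoef c (wperm (mk4 Sym.h Sym.pt Sym.one Sym.h) σ))
      + 2 * h ^ 2 * linZ L (fun c => icellCoef c (wperm (mk4 Sym.h Sym.pt Sym.h Sym.one) σ))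
      + (-2 : ℤ) * h * linZ L (fun c => icellCoef c (wperm (mk4 Sym.h Sym.pt Sym.h Sym.h) σ))
      + 4 * h ^ 4 * linZ L (fun c => icellCoef c (wperm (mk4 Sym.h Sym.h Sym.one Sym.one) σ))
      + (-4 : ℤ) * h ^ 3 * linZ L (fun c => icellCoef c (wperm (mk4 Sym.h Sym.h Sym.one Sym.h) σ))
      + (-4 : ℤ) * h ^ 3 * linZ L (fun c => icellCoef c (wperm (mk4 Sym.h Sym.h Sym.h Sym.one) σ))
      + 4 * h ^ 2 * linZ L (fun c => icellCoef c (wperm (mk4 Sym.h Sym.h Sym.h Sym.h) σ))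
      + (-2 : ℤ) * h ^ 5 * linZ L (fun c => icellCoef c (wperm (mk4 Sym.h Sym.one Sym.one Sym.one) σ))
      + 2 * h ^ 4 * linZ L (fun c => icellCoef c (wperm (mk4 Sym.h Sym.one Sym.one Sym.h) σ))
      + 2 * h ^ 4 * linZ L (fun c => icellCoef c (wperm (mk4 Sym.h Sym.one Sym.h Sym.one) σ))
      + (-2 : ℤ) * h ^ 3 * linZ L (fun c => icellCoef c (wperm (mk4 Sym.h Sym.one Sym.h Sym.h) σ))
      + 1 * h ^ 4 * linZ L (fun c => icellCoef c (wperm (mk4 Sym.one Sym.pt Sym.one Sym.one) σ))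
      + (-1 : ℤ) * h ^ 3 * linZ L (fun c => icellCoef c (wperm (mk4 Sym.one Sym.pt Sym.one Sym.h) σ))
      + (-1 : ℤ) * h ^ 3 * linZ L (fun c => icellCoef c (wperm (mk4 Sym.one Sym.pt Sym.h Sym.one) σ))
      + 1 * h ^ 2 * linZ L (fun c => icellCoef c (wperm (mk4 Sym.one Sym.pt Sym.h Sym.h) σ))
      + (-2 : ℤ) * h ^ 5 * linZ L (fun c => icellCoef c (wperm (mk4 Sym.one Sym.h Sym.one Sym.one) σ))
      + 2 * h ^ 4 * linZ L (fun c => icellCoef c (wperm (mk4 Sym.one Sym.h Sym.one Sym.h) σ))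
      + 2 * h ^ 4 * linZ L (fun c => icellCoef c (wperm (mk4 Sym.one Sym.h Sym.h Sym.one) σ))
      + (-2 : ℤ) * h ^ 3 * linZ L (fun c => icellCoef c (wperm (mk4 Sym.one Sym.h Sym.h Sym.h) σ))
      + 1 * h ^ 6 * linZ L (fun c => icellCoef c (wperm (mk4 Sym.one Sym.one Sym.one Sym.one) σ))
      + (-1 : ℤ) * h ^ 5 * linZ L (fun c => icellCoef c (wperm (mk4 Sym.one Sym.one Sym.one Sym.h) σ))
      + (-1 : ℤ) * h ^ 5 * linZ L (fun c => icellCoef c (wperm (mk4 Sym.one Sym.one Sym.h Sym.one) σ))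
      + 1 * h ^ 4 * linZ L (fun c => icellCoef c (wperm (mk4 Sym.one Sym.one Sym.h Sym.h) σ)) := by
  induction L with
  | nil => simp [linZ]
  | cons a t ih => simp only [linZ_cons]; rw [ih, sh2211_expand h σ]; ring

/-- moment law for the shape `(2,2,1,1)`: its signed moment is `Φ_6`, whatever the placement. -/
theorem sh2211_moment (h : ℤ) (D : Design) (h1 : D.A1) (σ : Equiv.Perm (Fin 4)) :
    linZ D.N (sh2211 h σ) - linZ D.P (sh2211 h σ) = Phi6 h D := by
  have q1 := Tz_wperm D h1 (s := Sym.pt) (t := Sym.pt) (r := Sym.one) (u := Sym.one) rfl rfl rfl rfl σ ref4 (efree_of_efreeB _ (by decide)) (by decide)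
  have q2 := Tz_wperm D h1 (s := Sym.pt) (t := Sym.pt) (r := Sym.one) (u := Sym.h) rfl rfl rfl rfl σ ref5 (efree_of_efreeB _ ref5_ok.1) (by rw [ref5_ok.2]; decide)
  have q3 := Tz_wperm D h1 (s := Sym.pt) (t := Sym.pt) (r := Sym.h) (u := Sym.one) rfl rfl rfl rfl σ ref5 (efree_of_efreeB _ ref5_ok.1) (by rw [ref5_ok.2]; decide)
  have q4 := Tz_wperm D h1 (s := Sym.pt) (t := Sym.pt) (r := Sym.h) (u := Sym.h) rfl rfl rfl rfl σ ref6 (efree_of_efreeB _ ref6_ok.1) (by rw [ref6_ok.2]; decide)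
  have q5 := Tz_wperm D h1 (s := Sym.pt) (t := Sym.h) (r := Sym.one) (u := Sym.one) rfl rfl rfl rfl σ ref3 (efree_of_efreeB _ (by decide)) (by decide)
  have q6 := Tz_wperm D h1 (s := Sym.pt) (t := Sym.h) (r := Sym.one) (u := Sym.h) rfl rfl rfl rfl σ ref4 (efree_of_efreeB _ (by decide)) (by decide)
  have q7 := Tz_wperm D h1 (s := Sym.pt) (t := Sym.h) (r := Sym.h) (u := Sym.one) rfl rfl rfl rfl σ ref4 (efree_of_efreeB _ (by decide)) (by decide)
  have q8 := Tz_wperm D h1 (s := Sym.pt) (t := Sym.h) (r := Sym.h) (u := Sym.h) rfl rfl rfl rfl σ ref5 (efree_of_efreeB _ ref5_ok.1) (by rw [ref5_ok.2]; decide)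
  have q9 := Tz_wperm D h1 (s := Sym.pt) (t := Sym.one) (r := Sym.one) (u := Sym.one) rfl rfl rfl rfl σ ref2 (efree_of_efreeB _ (by decide)) (by decide)
  have q10 := Tz_wperm D h1 (s := Sym.pt) (t := Sym.one) (r := Sym.one) (u := Sym.h) rfl rfl rfl rfl σ ref3 (efree_of_efreeB _ (by decide)) (by decide)
  have q11 := Tz_wperm D h1 (s := Sym.pt) (t := Sym.one) (r := Sym.h) (u := Sym.one) rfl rfl rfl rfl σ ref3 (efree_of_efreeB _ (by decide)) (by decide)
  have q12 := Tz_wperm D h1 (s := Sym.pt) (t := Sym.one) (r := Sym.h) (u := Sym.h) rfl rfl rfl rfl σ ref4 (efree_of_efreeB _ (by decide)) (by decide)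
  have q13 := Tz_wperm D h1 (s := Sym.h) (t := Sym.pt) (r := Sym.one) (u := Sym.one) rfl rfl rfl rfl σ ref3 (efree_of_efreeB _ (by decide)) (by decide)
  have q14 := Tz_wperm D h1 (s := Sym.h) (t := Sym.pt) (r := Sym.one) (u := Sym.h) rfl rfl rfl rfl σ ref4 (efree_of_efreeB _ (by decide)) (by decide)
  have q15 := Tz_wperm D h1 (s := Sym.h) (t := Sym.pt) (r := Sym.h) (u := Sym.one) rfl rfl rfl rfl σ ref4 (efree_of_efreeB _ (by decide)) (by decide)
  have q16 := Tz_wperm D h1 (s := Sym.h) (t := Sym.pt) (r := Sym.h) (u := Sym.h) rfl rfl rfl rfl σ ref5 (efree_of_efreeB _ ref5_ok.1) (by rw [ref5_ok.2]; decide)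
  have q17 := Tz_wperm D h1 (s := Sym.h) (t := Sym.h) (r := Sym.one) (u := Sym.one) rfl rfl rfl rfl σ ref2 (efree_of_efreeB _ (by decide)) (by decide)
  have q18 := Tz_wperm D h1 (s := Sym.h) (t := Sym.h) (r := Sym.one) (u := Sym.h) rfl rfl rfl rfl σ ref3 (efree_of_efreeB _ (by decide)) (by decide)
  have q19 := Tz_wperm D h1 (s := Sym.h) (t := Sym.h) (r := Sym.h) (u := Sym.one) rfl rfl rfl rfl σ ref3 (efree_of_efreeB _ (by decide)) (by decide)
  have q20 := Tz_wperm D h1 (s := Sym.h) (t := Sym.h) (r := Sym.h) (u := Sym.h) rfl rfl rfl rfl σ ref4 (efree_of_efreeB _ (by decide)) (by decide)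
  have q21 := Tz_wperm D h1 (s := Sym.h) (t := Sym.one) (r := Sym.one) (u := Sym.one) rfl rfl rfl rfl σ ref1 (efree_of_efreeB _ (by decide)) (by decide)
  have q22 := Tz_wperm D h1 (s := Sym.h) (t := Sym.one) (r := Sym.one) (u := Sym.h) rfl rfl rfl rfl σ ref2 (efree_of_efreeB _ (by decide)) (by decide)
  have q23 := Tz_wperm D h1 (s := Sym.h) (t := Sym.one) (r := Sym.h) (u := Sym.one) rfl rfl rfl rfl σ ref2 (efree_of_efreeB _ (by decide)) (by decide)
  have q24 := Tz_wperm D h1 (s := Sym.h) (t := Sym.one) (r := Sym.h) (u := Sym.h) rfl rfl rfl rfl σ ref3 (efree_of_efreeB _ (by decide)) (by decide)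
  have q25 := Tz_wperm D h1 (s := Sym.one) (t := Sym.pt) (r := Sym.one) (u := Sym.one) rfl rfl rfl rfl σ ref2 (efree_of_efreeB _ (by decide)) (by decide)
  have q26 := Tz_wperm D h1 (s := Sym.one) (t := Sym.pt) (r := Sym.one) (u := Sym.h) rfl rfl rfl rfl σ ref3 (efree_of_efreeB _ (by decide)) (by decide)
  have q27 := Tz_wperm D h1 (s := Sym.one) (t := Sym.pt) (r := Sym.h) (u := Sym.one) rfl rfl rfl rfl σ ref3 (efree_of_efreeB _ (by decide)) (by decide)
  have q28 := Tz_wperm D h1 (s := Sym.one) (t := Sym.pt) (r := Sym.h) (u := Sym.h) rfl rfl rfl rfl σ ref4 (efree_of_efreeB _ (by decide)) (by decide)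
  have q29 := Tz_wperm D h1 (s := Sym.one) (t := Sym.h) (r := Sym.one) (u := Sym.one) rfl rfl rfl rfl σ ref1 (efree_of_efreeB _ (by decide)) (by decide)
  have q30 := Tz_wperm D h1 (s := Sym.one) (t := Sym.h) (r := Sym.one) (u := Sym.h) rfl rfl rfl rfl σ ref2 (efree_of_efreeB _ (by decide)) (by decide)
  have q31 := Tz_wperm D h1 (s := Sym.one) (t := Sym.h) (r := Sym.h) (u := Sym.one) rfl rfl rfl rfl σ ref2 (efree_of_efreeB _ (by decide)) (by decide)
  have q32 := Tz_wperm D h1 (s := Sym.one) (t := Sym.h) (r := Sym.h) (u := Sym.h) rfl rfl rfl rfl σ ref3 (efree_of_efreeB _ (by decide)) (by decide)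
  have q33 := Tz_wperm D h1 (s := Sym.one) (t := Sym.one) (r := Sym.one) (u := Sym.one) rfl rfl rfl rfl σ Word.unit unit_efree (by decide)
  have q34 := Tz_wperm D h1 (s := Sym.one) (t := Sym.one) (r := Sym.one) (u := Sym.h) rfl rfl rfl rfl σ ref1 (efree_of_efreeB _ (by decide)) (by decide)
  have q35 := Tz_wperm D h1 (s := Sym.one) (t := Sym.one) (r := Sym.h) (u := Sym.one) rfl rfl rfl rfl σ ref1 (efree_of_efreeB _ (by decide)) (by decide)
  have q36 := Tz_wperm D h1 (s := Sym.one) (t := Sym.one) (r := Sym.h) (u := Sym.h) rfl rfl rfl rfl σ ref2 (efree_of_efreeB _ (by decide)) (by decide)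
  rw [linZ_sh2211 h σ, linZ_sh2211 h σ]
  unfold Phi6 Design.Tz at *
  linear_combination 1 * h ^ 2 * q1 + (-1 : ℤ) * h * q2 + (-1 : ℤ) * h * q3 + 1 * q4 + (-2 : ℤ) * h ^ 3 * q5 + 2 * h ^ 2 * q6 + 2 * h ^ 2 * q7 + (-2 : ℤ) * h * q8 + 1 * h ^ 4 * q9 + (-1 : ℤ) * h ^ 3 * q10 + (-1 : ℤ) * h ^ 3 * q11 + 1 * h ^ 2 * q12 + (-2 : ℤ) * h ^ 3 * q13 + 2 * h ^ 2 * q14 + 2 * h ^ 2 * q15 + (-2 : ℤ) * h * q16 + 4 * h ^ 4 * q17 + (-4 : ℤ) * h ^ 3 * q18 + (-4 : ℤ) * h ^ 3 * q19 + 4 * h ^ 2 * q20 + (-2 : ℤ) * h ^ 5 * q21 + 2 * h ^ 4 * q22 + 2 * h ^ 4 * q23 + (-2 : ℤ) * h ^ 3 * q24 + 1 * h ^ 4 * q25 + (-1 : ℤ) * h ^ 3 * q26 + (-1 : ℤ) * h ^ 3 * q27 + 1 * h ^ 2 * q28 + (-2 : ℤ) * h ^ 5 * q29 + 2 * h ^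 4 * q30 + 2 * h ^ 4 * q31 + (-2 : ℤ) * h ^ 3 * q32 + 1 * h ^ 6 * q33 + (-1 : ℤ) * h ^ 5 * q34 + (-1 : ℤ) * h ^ 5 * q35 + 1 * h ^ 4 * q36

/-- alphabet form of the shape `(2,2,1,1)`: `|xy|` for each `q`, `col` for each `h − a`. -/
def a2211 (σ : Equiv.Perm (Fin 4)) (c : Cell) : ℤ := (|(c (σ 0)).x| * |(c (σ 0)).y|) * (|(c (σ 1)).x| * |(c (σ 1)).y|) * (c (σ 2)).colevel * (c (σ 3)).colevel

theorem sh2211_alpha {h : ℤ} {c : Cell} (hc : ∀ f : Fin 4, (c f).OnAlphabet h) (σ : Equiv.Perm (Fin 4)) :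
    sh2211 h σ c = 4 * a2211 σ c := by
  unfold sh2211 a2211
  rw [qv_eq (hc (σ 0)), qv_eq (hc (σ 1)), col_eq (hc (σ 2)), col_eq (hc (σ 3))]
  ring

theorem sh2211_moment_alpha {h : ℤ} {D : Design} (hD : D.OnAlphabet h) (h1 : D.A1) (σ : Equiv.Perm (Fin 4)) :
    4 * (linZ D.N (a2211 σ) - linZ D.P (a2211 σ)) = Phi6 h D := by
  rw [← sh2211_moment h D h1 σ,
    linZ_congr' D.N (sh2211 h σ) (fun c => 4 * a2211 σ c) fun cm hm hp => sh2211_alpha (onAlphabet_of_N hD hm hp) σ,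
    linZ_congr' D.P (sh2211 h σ) (fun c => 4 * a2211 σ c) fun cm hm hp => sh2211_alpha (onAlphabet_of_P hD hm hp) σ,
    linZ_smul, linZ_smul]
  ring

/-- the shape `(2,2,2,1)` placed by `σ`: q · q · q · col at slots `σ 0..3`. -/
def sh2221 (h : ℤ) (σ : Equiv.Perm (Fin 4)) (c : Cell) : ℤ := qv h (c (σ 0)) * qv h (c (σ 1)) * qv h (c (σ 2)) * (h - (c (σ 3)).a)

theorem sh2221_expand (h : ℤ) (σ : Equiv.Perm (Fin 4)) (c : Cell) : sh2221 h σ c =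
    1 * h * icellCoef c (wperm (mk4 Sym.pt Sym.pt Sym.pt Sym.one) σ)
      + (-1 : ℤ) * icellCoef c (wperm (mk4 Sym.pt Sym.pt Sym.pt Sym.h) σ)
      + (-2 : ℤ) * h ^ 2 * icellCoef c (wperm (mk4 Sym.pt Sym.pt Sym.h Sym.one) σ)
      + 2 * h * icellCoef c (wperm (mk4 Sym.pt Sym.pt Sym.h Sym.h) σ)
      + 1 * h ^ 3 * icellCoef c (wperm (mk4 Sym.pt Sym.pt Sym.one Sym.one) σ)
      + (-1 : ℤ) * h ^ 2 * icellCoef c (wperm (mk4 Sym.pt Sym.pt Sym.one Sym.h) σ)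
      + (-2 : ℤ) * h ^ 2 * icellCoef c (wperm (mk4 Sym.pt Sym.h Sym.pt Sym.one) σ)
      + 2 * h * icellCoef c (wperm (mk4 Sym.pt Sym.h Sym.pt Sym.h) σ)
      + 4 * h ^ 3 * icellCoef c (wperm (mk4 Sym.pt Sym.h Sym.h Sym.one) σ)
      + (-4 : ℤ) * h ^ 2 * icellCoef c (wperm (mk4 Sym.pt Sym.h Sym.h Sym.h) σ)
      + (-2 : ℤ) * h ^ 4 * icellCoef c (wperm (mk4 Sym.pt Sym.h Sym.one Sym.one) σ)
      + 2 * h ^ 3 * icellCoef c (wperm (mk4 Sym.pt Sym.h Sym.one Sym.h) σ)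
      + 1 * h ^ 3 * icellCoef c (wperm (mk4 Sym.pt Sym.one Sym.pt Sym.one) σ)
      + (-1 : ℤ) * h ^ 2 * icellCoef c (wperm (mk4 Sym.pt Sym.one Sym.pt Sym.h) σ)
      + (-2 : ℤ) * h ^ 4 * icellCoef c (wperm (mk4 Sym.pt Sym.one Sym.h Sym.one) σ)
      + 2 * h ^ 3 * icellCoef c (wperm (mk4 Sym.pt Sym.one Sym.h Sym.h) σ)
      + 1 * h ^ 5 * icellCoef c (wperm (mk4 Sym.pt Sym.one Sym.one Sym.one) σ)
      + (-1 : ℤ) * h ^ 4 * icellCoef c (wperm (mk4 Sym.pt Sym.one Sym.one Sym.h) σ)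
      + (-2 : ℤ) * h ^ 2 * icellCoef c (wperm (mk4 Sym.h Sym.pt Sym.pt Sym.one) σ)
      + 2 * h * icellCoef c (wperm (mk4 Sym.h Sym.pt Sym.pt Sym.h) σ)
      + 4 * h ^ 3 * icellCoef c (wperm (mk4 Sym.h Sym.pt Sym.h Sym.one) σ)
      + (-4 : ℤ) * h ^ 2 * icellCoef c (wperm (mk4 Sym.h Sym.pt Sym.h Sym.h) σ)
      + (-2 : ℤ) * h ^ 4 * icellCoef c (wperm (mk4 Sym.h Sym.pt Sym.one Sym.one) σ)
      + 2 * h ^ 3 * icellCoef c (wperm (mk4 Sym.h Sym.pt Sym.one Sym.h) σ)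
      + 4 * h ^ 3 * icellCoef c (wperm (mk4 Sym.h Sym.h Sym.pt Sym.one) σ)
      + (-4 : ℤ) * h ^ 2 * icellCoef c (wperm (mk4 Sym.h Sym.h Sym.pt Sym.h) σ)
      + (-8 : ℤ) * h ^ 4 * icellCoef c (wperm (mk4 Sym.h Sym.h Sym.h Sym.one) σ)
      + 8 * h ^ 3 * icellCoef c (wperm (mk4 Sym.h Sym.h Sym.h Sym.h) σ)
      + 4 * h ^ 5 * icellCoef c (wperm (mk4 Sym.h Sym.h Sym.one Sym.one) σ)
      + (-4 : ℤ) * h ^ 4 * icellCoef c (wperm (mk4 Sym.h Sym.h Sym.one Sym.h) σ)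
      + (-2 : ℤ) * h ^ 4 * icellCoef c (wperm (mk4 Sym.h Sym.one Sym.pt Sym.one) σ)
      + 2 * h ^ 3 * icellCoef c (wperm (mk4 Sym.h Sym.one Sym.pt Sym.h) σ)
      + 4 * h ^ 5 * icellCoef c (wperm (mk4 Sym.h Sym.one Sym.h Sym.one) σ)
      + (-4 : ℤ) * h ^ 4 * icellCoef c (wperm (mk4 Sym.h Sym.one Sym.h Sym.h) σ)
      + (-2 : ℤ) * h ^ 6 * icellCoef c (wperm (mk4 Sym.h Sym.one Sym.one Sym.one) σ)
      + 2 * h ^ 5 * icellCoef c (wperm (mk4 Sym.h Sym.one Sym.one Sym.h) σ)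
      + 1 * h ^ 3 * icellCoef c (wperm (mk4 Sym.one Sym.pt Sym.pt Sym.one) σ)
      + (-1 : ℤ) * h ^ 2 * icellCoef c (wperm (mk4 Sym.one Sym.pt Sym.pt Sym.h) σ)
      + (-2 : ℤ) * h ^ 4 * icellCoef c (wperm (mk4 Sym.one Sym.pt Sym.h Sym.one) σ)
      + 2 * h ^ 3 * icellCoef c (wperm (mk4 Sym.one Sym.pt Sym.h Sym.h) σ)
      + 1 * h ^ 5 * icellCoef c (wperm (mk4 Sym.one Sym.pt Sym.one Sym.one) σ)
      + (-1 : ℤ) * h ^ 4 * icellCoef c (wperm (mk4 Sym.one Sym.pt Sym.one Sym.h) σ)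
      + (-2 : ℤ) * h ^ 4 * icellCoef c (wperm (mk4 Sym.one Sym.h Sym.pt Sym.one) σ)
      + 2 * h ^ 3 * icellCoef c (wperm (mk4 Sym.one Sym.h Sym.pt Sym.h) σ)
      + 4 * h ^ 5 * icellCoef c (wperm (mk4 Sym.one Sym.h Sym.h Sym.one) σ)
      + (-4 : ℤ) * h ^ 4 * icellCoef c (wperm (mk4 Sym.one Sym.h Sym.h Sym.h) σ)
      + (-2 : ℤ) * h ^ 6 * icellCoef c (wperm (mk4 Sym.one Sym.h Sym.one Sym.one) σ)
      + 2 * h ^ 5 * icellCoef c (wperm (mk4 Sym.one Sym.h Sym.one Sym.h) σ)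
      + 1 * h ^ 5 * icellCoef c (wperm (mk4 Sym.one Sym.one Sym.pt Sym.one) σ)
      + (-1 : ℤ) * h ^ 4 * icellCoef c (wperm (mk4 Sym.one Sym.one Sym.pt Sym.h) σ)
      + (-2 : ℤ) * h ^ 6 * icellCoef c (wperm (mk4 Sym.one Sym.one Sym.h Sym.one) σ)
      + 2 * h ^ 5 * icellCoef c (wperm (mk4 Sym.one Sym.one Sym.h Sym.h) σ)
      + 1 * h ^ 7 * icellCoef c (wperm (mk4 Sym.one Sym.one Sym.one Sym.one) σ)
      + (-1 : ℤ) * h ^ 6 * icellCoef c (wperm (mk4 Sym.one Sym.one Sym.one Sym.h) σ) := by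
  simp only [sh2221, icellCoef_wperm, Sym.icoef, qv]
  ring

theorem linZ_sh2221 (h : ℤ) (σ : Equiv.Perm (Fin 4)) (L : List (Cell × ℕ)) : linZ L (sh2221 h σ) =
    1 * h * linZ L (fun c => icellCoef c (wperm (mk4 Sym.pt Sym.pt Sym.pt Sym.one) σ))
      + (-1 : ℤ) * linZ L (fun c => icellCoef c (wperm (mk4 Sym.pt Sym.pt Sym.pt Sym.h) σ))
      + (-2 : ℤ) * h ^ 2 * linZ L (fun c => icellCoef c (wperm (mk4 Sym.pt Sym.pt Sym.h Sym.one) σ))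
      + 2 * h * linZ L (fun c => icellCoef c (wperm (mk4 Sym.pt Sym.pt Sym.h Sym.h) σ))
      + 1 * h ^ 3 * linZ L (fun c => icellCoef c (wperm (mk4 Sym.pt Sym.pt Sym.one Sym.one) σ))
      + (-1 : ℤ) * h ^ 2 * linZ L (fun c => icellCoef c (wperm (mk4 Sym.pt Sym.pt Sym.one Sym.h) σ))
      + (-2 : ℤ) * h ^ 2 * linZ L (fun c => icellCoef c (wperm (mk4 Sym.pt Sym.h Sym.pt Sym.one) σ))
      + 2 * h * linZ L (fun c => icellCoef c (wperm (mk4 Sym.pt Sym.h Sym.pt Sym.h) σ))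
      + 4 * h ^ 3 * linZ L (fun c => icellCoef c (wperm (mk4 Sym.pt Sym.h Sym.h Sym.one) σ))
      + (-4 : ℤ) * h ^ 2 * linZ L (fun c => icellCoef c (wperm (mk4 Sym.pt Sym.h Sym.h Sym.h) σ))
      + (-2 : ℤ) * h ^ 4 * linZ L (fun c => icellCoef c (wperm (mk4 Sym.pt Sym.h Sym.one Sym.one) σ))
      + 2 * h ^ 3 * linZ L (fun c => icellCoef c (wperm (mk4 Sym.pt Sym.h Sym.one Sym.h) σ))
      + 1 * h ^ 3 * linZ L (fun c => icellCoef c (wperm (mk4 Sym.pt Sym.one Sym.pt Sym.one) σ))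
      + (-1 : ℤ) * h ^ 2 * linZ L (fun c => icellCoef c (wperm (mk4 Sym.pt Sym.one Sym.pt Sym.h) σ))
      + (-2 : ℤ) * h ^ 4 * linZ L (fun c => icellCoef c (wperm (mk4 Sym.pt Sym.one Sym.h Sym.one) σ))
      + 2 * h ^ 3 * linZ L (fun c => icellCoef c (wperm (mk4 Sym.pt Sym.one Sym.h Sym.h) σ))
      + 1 * h ^ 5 * linZ L (fun c => icellCoef c (wperm (mk4 Sym.pt Sym.one Sym.one Sym.one) σ))
      + (-1 : ℤ) * h ^ 4 * linZ L (fun c => icellCoef c (wperm (mk4 Sym.pt Sym.one Sym.one Sym.h) σ))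
      + (-2 : ℤ) * h ^ 2 * linZ L (fun c => icellCoef c (wperm (mk4 Sym.h Sym.pt Sym.pt Sym.one) σ))
      + 2 * h * linZ L (fun c => icellCoef c (wperm (mk4 Sym.h Sym.pt Sym.pt Sym.h) σ))
      + 4 * h ^ 3 * linZ L (fun c => icellCoef c (wperm (mk4 Sym.h Sym.pt Sym.h Sym.one) σ))
      + (-4 : ℤ) * h ^ 2 * linZ L (fun c => icellCoef c (wperm (mk4 Sym.h Sym.pt Sym.h Sym.h) σ))
      + (-2 : ℤ) * h ^ 4 * linZ L (fun c => icellCoef c (wperm (mk4 Sym.h Sym.pt Sym.one Sym.one) σ))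
      + 2 * h ^ 3 * linZ L (fun c => icellCoef c (wperm (mk4 Sym.h Sym.pt Sym.one Sym.h) σ))
      + 4 * h ^ 3 * linZ L (fun c => icellCoef c (wperm (mk4 Sym.h Sym.h Sym.pt Sym.one) σ))
      + (-4 : ℤ) * h ^ 2 * linZ L (fun c => icellCoef c (wperm (mk4 Sym.h Sym.h Sym.pt Sym.h) σ))
      + (-8 : ℤ) * h ^ 4 * linZ L (fun c => icellCoef c (wperm (mk4 Sym.h Sym.h Sym.h Sym.one) σ))
      + 8 * h ^ 3 * linZ L (fun c => icellCoef c (wperm (mk4 Sym.h Sym.h Sym.h Sym.h) σ))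
      + 4 * h ^ 5 * linZ L (fun c => icellCoef c (wperm (mk4 Sym.h Sym.h Sym.one Sym.one) σ))
      + (-4 : ℤ) * h ^ 4 * linZ L (fun c => icellCoef c (wperm (mk4 Sym.h Sym.h Sym.one Sym.h) σ))
      + (-2 : ℤ) * h ^ 4 * linZ L (fun c => icellCoef c (wperm (mk4 Sym.h Sym.one Sym.pt Sym.one) σ))
      + 2 * h ^ 3 * linZ L (fun c => icellCoef c (wperm (mk4 Sym.h Sym.one Sym.pt Sym.h) σ))
      + 4 * h ^ 5 * linZ L (fun c => icellCoef c (wperm (mk4 Sym.h Sym.one Sym.h Sym.one) σ))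
      + (-4 : ℤ) * h ^ 4 * linZ L (fun c => icellCoef c (wperm (mk4 Sym.h Sym.one Sym.h Sym.h) σ))
      + (-2 : ℤ) * h ^ 6 * linZ L (fun c => icellCoef c (wperm (mk4 Sym.h Sym.one Sym.one Sym.one) σ))
      + 2 * h ^ 5 * linZ L (fun c => icellCoef c (wperm (mk4 Sym.h Sym.one Sym.one Sym.h) σ))
      + 1 * h ^ 3 * linZ L (fun c => icellCoef c (wperm (mk4 Sym.one Sym.pt Sym.pt Sym.one) σ))
      + (-1 : ℤ) * h ^ 2 * linZ L (fun c => icellCoef c (wperm (mk4 Sym.one Sym.pt Sym.pt Sym.h) σ))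
      + (-2 : ℤ) * h ^ 4 * linZ L (fun c => icellCoef c (wperm (mk4 Sym.one Sym.pt Sym.h Sym.one) σ))
      + 2 * h ^ 3 * linZ L (fun c => icellCoef c (wperm (mk4 Sym.one Sym.pt Sym.h Sym.h) σ))
      + 1 * h ^ 5 * linZ L (fun c => icellCoef c (wperm (mk4 Sym.one Sym.pt Sym.one Sym.one) σ))
      + (-1 : ℤ) * h ^ 4 * linZ L (fun c => icellCoef c (wperm (mk4 Sym.one Sym.pt Sym.one Sym.h) σ))
      + (-2 : ℤ) * h ^ 4 * linZ L (fun c => icellCoef c (wperm (mk4 Sym.one Sym.h Sym.pt Sym.one) σ))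
      + 2 * h ^ 3 * linZ L (fun c => icellCoef c (wperm (mk4 Sym.one Sym.h Sym.pt Sym.h) σ))
      + 4 * h ^ 5 * linZ L (fun c => icellCoef c (wperm (mk4 Sym.one Sym.h Sym.h Sym.one) σ))
      + (-4 : ℤ) * h ^ 4 * linZ L (fun c => icellCoef c (wperm (mk4 Sym.one Sym.h Sym.h Sym.h) σ))
      + (-2 : ℤ) * h ^ 6 * linZ L (fun c => icellCoef c (wperm (mk4 Sym.one Sym.h Sym.one Sym.one) σ))
      + 2 * h ^ 5 * linZ L (fun c => icellCoef c (wperm (mk4 Sym.one Sym.h Sym.one Sym.h) σ))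
      + 1 * h ^ 5 * linZ L (fun c => icellCoef c (wperm (mk4 Sym.one Sym.one Sym.pt Sym.one) σ))
      + (-1 : ℤ) * h ^ 4 * linZ L (fun c => icellCoef c (wperm (mk4 Sym.one Sym.one Sym.pt Sym.h) σ))
      + (-2 : ℤ) * h ^ 6 * linZ L (fun c => icellCoef c (wperm (mk4 Sym.one Sym.one Sym.h Sym.one) σ))
      + 2 * h ^ 5 * linZ L (fun c => icellCoef c (wperm (mk4 Sym.one Sym.one Sym.h Sym.h) σ))
      + 1 * h ^ 7 * linZ L (fun c => icellCoef c (wperm (mk4 Sym.one Sym.one Sym.one Sym.one) σ))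
      + (-1 : ℤ) * h ^ 6 * linZ L (fun c => icellCoef c (wperm (mk4 Sym.one Sym.one Sym.one Sym.h) σ)) := by
  induction L with
  | nil => simp [linZ]
  | cons a t ih => simp only [linZ_cons]; rw [ih, sh2221_expand h σ]; ring

/-- moment law for the shape `(2,2,2,1)`: its signed moment is `Φ_7`, whatever the placement. -/
theorem sh2221_moment (h : ℤ) (D : Design) (h1 : D.A1) (σ : Equiv.Perm (Fin 4)) :
    linZ D.N (sh2221 h σ) - linZ D.P (sh2221 h σ) = Phi7 h D := by
  have q1 := Tz_wperm D h1 (s := Sym.pt) (t := Sym.pt) (r := Sym.pt) (u := Sym.one) rfl rfl rfl rfl σ ref6 (efree_of_efreeB _ ref6_ok.1) (by rw [ref6_ok.2]; decide)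
  have q2 := Tz_wperm D h1 (s := Sym.pt) (t := Sym.pt) (r := Sym.pt) (u := Sym.h) rfl rfl rfl rfl σ ref7 (efree_of_efreeB _ ref7_ok.1) (by rw [ref7_ok.2]; decide)
  have q3 := Tz_wperm D h1 (s := Sym.pt) (t := Sym.pt) (r := Sym.h) (u := Sym.one) rfl rfl rfl rfl σ ref5 (efree_of_efreeB _ ref5_ok.1) (by rw [ref5_ok.2]; decide)
  have q4 := Tz_wperm D h1 (s := Sym.pt) (t := Sym.pt) (r := Sym.h) (u := Sym.h) rfl rfl rfl rfl σ ref6 (efree_of_efreeB _ ref6_ok.1) (by rw [ref6_ok.2]; decide)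
  have q5 := Tz_wperm D h1 (s := Sym.pt) (t := Sym.pt) (r := Sym.one) (u := Sym.one) rfl rfl rfl rfl σ ref4 (efree_of_efreeB _ (by decide)) (by decide)
  have q6 := Tz_wperm D h1 (s := Sym.pt) (t := Sym.pt) (r := Sym.one) (u := Sym.h) rfl rfl rfl rfl σ ref5 (efree_of_efreeB _ ref5_ok.1) (by rw [ref5_ok.2]; decide)
  have q7 := Tz_wperm D h1 (s := Sym.pt) (t := Sym.h) (r := Sym.pt) (u := Sym.one) rfl rfl rfl rfl σ ref5 (efree_of_efreeB _ ref5_ok.1) (by rw [ref5_ok.2]; decide)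
  have q8 := Tz_wperm D h1 (s := Sym.pt) (t := Sym.h) (r := Sym.pt) (u := Sym.h) rfl rfl rfl rfl σ ref6 (efree_of_efreeB _ ref6_ok.1) (by rw [ref6_ok.2]; decide)
  have q9 := Tz_wperm D h1 (s := Sym.pt) (t := Sym.h) (r := Sym.h) (u := Sym.one) rfl rfl rfl rfl σ ref4 (efree_of_efreeB _ (by decide)) (by decide)
  have q10 := Tz_wperm D h1 (s := Sym.pt) (t := Sym.h) (r := Sym.h) (u := Sym.h) rfl rfl rfl rfl σ ref5 (efree_of_efreeB _ ref5_ok.1) (by rw [ref5_ok.2]; decide)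
  have q11 := Tz_wperm D h1 (s := Sym.pt) (t := Sym.h) (r := Sym.one) (u := Sym.one) rfl rfl rfl rfl σ ref3 (efree_of_efreeB _ (by decide)) (by decide)
  have q12 := Tz_wperm D h1 (s := Sym.pt) (t := Sym.h) (r := Sym.one) (u := Sym.h) rfl rfl rfl rfl σ ref4 (efree_of_efreeB _ (by decide)) (by decide)
  have q13 := Tz_wperm D h1 (s := Sym.pt) (t := Sym.one) (r := Sym.pt) (u := Sym.one) rfl rfl rfl rfl σ ref4 (efree_of_efreeB _ (by decide)) (by decide)
  have q14 := Tz_wperm D h1 (s := Sym.pt) (t := Sym.one) (r := Sym.pt) (u := Sym.h) rfl rfl rfl rfl σ ref5 (efree_of_efreeB _ ref5_ok.1) (by rw [ref5_ok.2]; decide)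
  have q15 := Tz_wperm D h1 (s := Sym.pt) (t := Sym.one) (r := Sym.h) (u := Sym.one) rfl rfl rfl rfl σ ref3 (efree_of_efreeB _ (by decide)) (by decide)
  have q16 := Tz_wperm D h1 (s := Sym.pt) (t := Sym.one) (r := Sym.h) (u := Sym.h) rfl rfl rfl rfl σ ref4 (efree_of_efreeB _ (by decide)) (by decide)
  have q17 := Tz_wperm D h1 (s := Sym.pt) (t := Sym.one) (r := Sym.one) (u := Sym.one) rfl rfl rfl rfl σ ref2 (efree_of_efreeB _ (by decide)) (by decide)
  have q18 := Tz_wperm D h1 (s := Sym.pt) (t := Sym.one) (r := Sym.one) (u := Sym.h) rfl rfl rfl rfl σ ref3 (efree_of_efreeB _ (by decide)) (by decide)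
  have q19 := Tz_wperm D h1 (s := Sym.h) (t := Sym.pt) (r := Sym.pt) (u := Sym.one) rfl rfl rfl rfl σ ref5 (efree_of_efreeB _ ref5_ok.1) (by rw [ref5_ok.2]; decide)
  have q20 := Tz_wperm D h1 (s := Sym.h) (t := Sym.pt) (r := Sym.pt) (u := Sym.h) rfl rfl rfl rfl σ ref6 (efree_of_efreeB _ ref6_ok.1) (by rw [ref6_ok.2]; decide)
  have q21 := Tz_wperm D h1 (s := Sym.h) (t := Sym.pt) (r := Sym.h) (u := Sym.one) rfl rfl rfl rfl σ ref4 (efree_of_efreeB _ (by decide)) (by decide)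
  have q22 := Tz_wperm D h1 (s := Sym.h) (t := Sym.pt) (r := Sym.h) (u := Sym.h) rfl rfl rfl rfl σ ref5 (efree_of_efreeB _ ref5_ok.1) (by rw [ref5_ok.2]; decide)
  have q23 := Tz_wperm D h1 (s := Sym.h) (t := Sym.pt) (r := Sym.one) (u := Sym.one) rfl rfl rfl rfl σ ref3 (efree_of_efreeB _ (by decide)) (by decide)
  have q24 := Tz_wperm D h1 (s := Sym.h) (t := Sym.pt) (r := Sym.one) (u := Sym.h) rfl rfl rfl rfl σ ref4 (efree_of_efreeB _ (by decide)) (by decide)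
  have q25 := Tz_wperm D h1 (s := Sym.h) (t := Sym.h) (r := Sym.pt) (u := Sym.one) rfl rfl rfl rfl σ ref4 (efree_of_efreeB _ (by decide)) (by decide)
  have q26 := Tz_wperm D h1 (s := Sym.h) (t := Sym.h) (r := Sym.pt) (u := Sym.h) rfl rfl rfl rfl σ ref5 (efree_of_efreeB _ ref5_ok.1) (by rw [ref5_ok.2]; decide)
  have q27 := Tz_wperm D h1 (s := Sym.h) (t := Sym.h) (r := Sym.h) (u := Sym.one) rfl rfl rfl rfl σ ref3 (efree_of_efreeB _ (by decide)) (by decide)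
  have q28 := Tz_wperm D h1 (s := Sym.h) (t := Sym.h) (r := Sym.h) (u := Sym.h) rfl rfl rfl rfl σ ref4 (efree_of_efreeB _ (by decide)) (by decide)
  have q29 := Tz_wperm D h1 (s := Sym.h) (t := Sym.h) (r := Sym.one) (u := Sym.one) rfl rfl rfl rfl σ ref2 (efree_of_efreeB _ (by decide)) (by decide)
  have q30 := Tz_wperm D h1 (s := Sym.h) (t := Sym.h) (r := Sym.one) (u := Sym.h) rfl rfl rfl rfl σ ref3 (efree_of_efreeB _ (by decide)) (by decide)
  have q31 := Tz_wperm D h1 (s := Sym.h) (t := Sym.one) (r := Sym.pt) (u := Sym.one) rfl rfl rfl rfl σ ref3 (efree_of_efreeB _ (by decide)) (by decide)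
  have q32 := Tz_wperm D h1 (s := Sym.h) (t := Sym.one) (r := Sym.pt) (u := Sym.h) rfl rfl rfl rfl σ ref4 (efree_of_efreeB _ (by decide)) (by decide)
  have q33 := Tz_wperm D h1 (s := Sym.h) (t := Sym.one) (r := Sym.h) (u := Sym.one) rfl rfl rfl rfl σ ref2 (efree_of_efreeB _ (by decide)) (by decide)
  have q34 := Tz_wperm D h1 (s := Sym.h) (t := Sym.one) (r := Sym.h) (u := Sym.h) rfl rfl rfl rfl σ ref3 (efree_of_efreeB _ (by decide)) (by decide)
  have q35 := Tz_wperm D h1 (s := Sym.h) (t := Sym.one) (r := Sym.one) (u := Sym.one) rfl rfl rfl rfl σ ref1 (efree_of_efreeB _ (by decide)) (by decide)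
  have q36 := Tz_wperm D h1 (s := Sym.h) (t := Sym.one) (r := Sym.one) (u := Sym.h) rfl rfl rfl rfl σ ref2 (efree_of_efreeB _ (by decide)) (by decide)
  have q37 := Tz_wperm D h1 (s := Sym.one) (t := Sym.pt) (r := Sym.pt) (u := Sym.one) rfl rfl rfl rfl σ ref4 (efree_of_efreeB _ (by decide)) (by decide)
  have q38 := Tz_wperm D h1 (s := Sym.one) (t := Sym.pt) (r := Sym.pt) (u := Sym.h) rfl rfl rfl rfl σ ref5 (efree_of_efreeB _ ref5_ok.1) (by rw [ref5_ok.2]; decide)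
  have q39 := Tz_wperm D h1 (s := Sym.one) (t := Sym.pt) (r := Sym.h) (u := Sym.one) rfl rfl rfl rfl σ ref3 (efree_of_efreeB _ (by decide)) (by decide)
  have q40 := Tz_wperm D h1 (s := Sym.one) (t := Sym.pt) (r := Sym.h) (u := Sym.h) rfl rfl rfl rfl σ ref4 (efree_of_efreeB _ (by decide)) (by decide)
  have q41 := Tz_wperm D h1 (s := Sym.one) (t := Sym.pt) (r := Sym.one) (u := Sym.one) rfl rfl rfl rfl σ ref2 (efree_of_efreeB _ (by decide)) (by decide)
  have q42 := Tz_wperm D h1 (s := Sym.one) (t := Sym.pt) (r := Sym.one) (u := Sym.h) rfl rfl rfl rfl σ ref3 (efree_of_efreeB _ (by decide)) (by decide)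
  have q43 := Tz_wperm D h1 (s := Sym.one) (t := Sym.h) (r := Sym.pt) (u := Sym.one) rfl rfl rfl rfl σ ref3 (efree_of_efreeB _ (by decide)) (by decide)
  have q44 := Tz_wperm D h1 (s := Sym.one) (t := Sym.h) (r := Sym.pt) (u := Sym.h) rfl rfl rfl rfl σ ref4 (efree_of_efreeB _ (by decide)) (by decide)
  have q45 := Tz_wperm D h1 (s := Sym.one) (t := Sym.h) (r := Sym.h) (u := Sym.one) rfl rfl rfl rfl σ ref2 (efree_of_efreeB _ (by decide)) (by decide)
  have q46 := Tz_wperm D h1 (s := Sym.one) (t := Sym.h) (r := Sym.h) (u := Sym.h) rfl rfl rfl rfl σ ref3 (efree_of_efreeB _ (by decide)) (by decide)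
  have q47 := Tz_wperm D h1 (s := Sym.one) (t := Sym.h) (r := Sym.one) (u := Sym.one) rfl rfl rfl rfl σ ref1 (efree_of_efreeB _ (by decide)) (by decide)
  have q48 := Tz_wperm D h1 (s := Sym.one) (t := Sym.h) (r := Sym.one) (u := Sym.h) rfl rfl rfl rfl σ ref2 (efree_of_efreeB _ (by decide)) (by decide)
  have q49 := Tz_wperm D h1 (s := Sym.one) (t := Sym.one) (r := Sym.pt) (u := Sym.one) rfl rfl rfl rfl σ ref2 (efree_of_efreeB _ (by decide)) (by decide)
  have q50 := Tz_wperm D h1 (s := Sym.one) (t := Sym.one) (r := Sym.pt) (u := Sym.h) rfl rfl rfl rfl σ ref3 (efree_of_efreeB _ (by decide)) (by decide)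
  have q51 := Tz_wperm D h1 (s := Sym.one) (t := Sym.one) (r := Sym.h) (u := Sym.one) rfl rfl rfl rfl σ ref1 (efree_of_efreeB _ (by decide)) (by decide)
  have q52 := Tz_wperm D h1 (s := Sym.one) (t := Sym.one) (r := Sym.h) (u := Sym.h) rfl rfl rfl rfl σ ref2 (efree_of_efreeB _ (by decide)) (by decide)
  have q53 := Tz_wperm D h1 (s := Sym.one) (t := Sym.one) (r := Sym.one) (u := Sym.one) rfl rfl rfl rfl σ Word.unit unit_efree (by decide)
  have q54 := Tz_wperm D h1 (s := Sym.one) (t := Sym.one) (r := Sym.one) (u := Sym.h) rfl rfl rfl rfl σ ref1 (efree_of_efreeB _ (by decide)) (by decide)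
  rw [linZ_sh2221 h σ, linZ_sh2221 h σ]
  unfold Phi7 Design.Tz at *
  linear_combination 1 * h * q1 + (-1 : ℤ) * q2 + (-2 : ℤ) * h ^ 2 * q3 + 2 * h * q4 + 1 * h ^ 3 * q5 + (-1 : ℤ) * h ^ 2 * q6 + (-2 : ℤ) * h ^ 2 * q7 + 2 * h * q8 + 4 * h ^ 3 * q9 + (-4 : ℤ) * h ^ 2 * q10 + (-2 : ℤ) * h ^ 4 * q11 + 2 * h ^ 3 * q12 + 1 * h ^ 3 * q13 + (-1 : ℤ) * h ^ 2 * q14 + (-2 : ℤ) * h ^ 4 * q15 + 2 * h ^ 3 * q16 + 1 * h ^ 5 * q17 + (-1 : ℤ) * h ^ 4 * q18 + (-2 : ℤ) * h ^ 2 * q19 + 2 * h * q20 + 4 * h ^ 3 * q21 + (-4 : ℤ) * h ^ 2 * q22 + (-2 : ℤ) * h ^ 4 * q23 + 2 * h ^ 3 * q24 + 4 * h ^ 3 * q25 + (-4 : ℤ) * h ^ 2 * q26 + (-8 : ℤ) * h ^ 4 * q27 + 8 * h ^ 3 * q28 + 4 * h ^ 5 * q29 + (-4 : ℤ) * h ^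 4 * q30 + (-2 : ℤ) * h ^ 4 * q31 + 2 * h ^ 3 * q32 + 4 * h ^ 5 * q33 + (-4 : ℤ) * h ^ 4 * q34 + (-2 : ℤ) * h ^ 6 * q35 + 2 * h ^ 5 * q36 + 1 * h ^ 3 * q37 + (-1 : ℤ) * h ^ 2 * q38 + (-2 : ℤ) * h ^ 4 * q39 + 2 * h ^ 3 * q40 + 1 * h ^ 5 * q41 + (-1 : ℤ) * h ^ 4 * q42 + (-2 : ℤ) * h ^ 4 * q43 + 2 * h ^ 3 * q44 + 4 * h ^ 5 * q45 + (-4 : ℤ) * h ^ 4 * q46 + (-2 : ℤ) * h ^ 6 * q47 + 2 * h ^ 5 * q48 + 1 * h ^ 5 * q49 + (-1 : ℤ) * h ^ 4 * q50 + (-2 : ℤ) * h ^ 6 * q51 + 2 * h ^ 5 * q52 + 1 * h ^ 7 * q53 + (-1 : ℤ) * h ^ 6 * q54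

/-- alphabet form of the shape `(2,2,2,1)`: `|xy|` for each `q`, `col` for each `h − a`. -/
def a2221 (σ : Equiv.Perm (Fin 4)) (c : Cell) : ℤ := (|(c (σ 0)).x| * |(c (σ 0)).y|) * (|(c (σ 1)).x| * |(c (σ 1)).y|) * (|(c (σ 2)).x| * |(c (σ 2)).y|) * (c (σ 3)).colevel

theorem sh2221_alpha {h : ℤ} {c : Cell} (hc : ∀ f : Fin 4, (c f).OnAlphabet h) (σ : Equiv.Perm (Fin 4)) :
    sh2221 h σ c = 8 * a2221 σ c := by
  unfold sh2221 a2221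
  rw [qv_eq (hc (σ 0)), qv_eq (hc (σ 1)), qv_eq (hc (σ 2)), col_eq (hc (σ 3))]
  ring

theorem sh2221_moment_alpha {h : ℤ} {D : Design} (hD : D.OnAlphabet h) (h1 : D.A1) (σ : Equiv.Perm (Fin 4)) :
    8 * (linZ D.N (a2221 σ) - linZ D.P (a2221 σ)) = Phi7 h D := by
  rw [← sh2221_moment h D h1 σ,
    linZ_congr' D.N (sh2221 h σ) (fun c => 8 * a2221 σ c) fun cm hm hp => sh2221_alpha (onAlphabet_of_N hD hm hp) σ,
    linZ_congr' D.P (sh2221 h σ) (fun c => 8 * a2221 σ c) fun cm hm hp => sh2221_alpha (onAlphabet_of_P hD hm hp) σ,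
    linZ_smul, linZ_smul]
  ring

/-- **degree-1 shape law**: the shapes `(1,0,0,0)∘σ` and `(1,0,0,0)∘σ'` have the same signed moment (`= Φ_1`), for all placements. -/
theorem slot_law (h : ℤ) (D : Design) (h1 : D.A1) (σ σ' : Equiv.Perm (Fin 4)) :
    linZ D.N (sh1000 h σ) - linZ D.P (sh1000 h σ) = linZ D.N (sh1000 h σ') - linZ D.P (sh1000 h σ') := by
  rw [sh1000_moment h D h1, sh1000_moment h D h1]

/-- degree-1 shape law on the alphabet: `1·(Σ_N − Σ_P) m·a1000∘σ = 1·(Σ_N − Σ_P) m·a1000∘σ'`. -/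
theorem slot_law_alphabet {h : ℤ} {D : Design} (hD : D.OnAlphabet h) (h1 : D.A1) (σ σ' : Equiv.Perm (Fin 4)) :
    1 * (linZ D.N (a1000 σ) - linZ D.P (a1000 σ)) = 1 * (linZ D.N (a1000 σ') - linZ D.P (a1000 σ')) := by
  rw [sh1000_moment_alpha hD h1, sh1000_moment_alpha hD h1]

/-- **degree-2 shape law**: the shapes `(2,0,0,0)∘σ` and `(1,1,0,0)∘σ'` have the same signed moment (`= Φ_2`), for all placements. -/
theorem degTwo_law (h : ℤ) (D : Design) (h1 : D.A1) (σ σ' : Equiv.Perm (Fin 4)) :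
    linZ D.N (sh2000 h σ) - linZ D.P (sh2000 h σ) = linZ D.N (sh1100 h σ') - linZ D.P (sh1100 h σ') := by
  rw [sh2000_moment h D h1, sh1100_moment h D h1]

/-- degree-2 shape law on the alphabet: `2·(Σ_N − Σ_P) m·a2000∘σ = 1·(Σ_N − Σ_P) m·a1100∘σ'`. -/
theorem degTwo_law_alphabet {h : ℤ} {D : Design} (hD : D.OnAlphabet h) (h1 : D.A1) (σ σ' : Equiv.Perm (Fin 4)) :
    2 * (linZ D.N (a2000 σ) - linZ D.P (a2000 σ)) = 1 * (linZ D.N (a1100 σ') - linZ D.P (a1100 σ')) := by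
  rw [sh2000_moment_alpha hD h1, sh1100_moment_alpha hD h1]

/-- **degree-3 shape law**: the shapes `(2,1,0,0)∘σ` and `(1,1,1,0)∘σ'` have the same signed moment (`= Φ_3`), for all placements. -/
theorem degThree_law (h : ℤ) (D : Design) (h1 : D.A1) (σ σ' : Equiv.Perm (Fin 4)) :
    linZ D.N (sh2100 h σ) - linZ D.P (sh2100 h σ) = linZ D.N (sh1110 h σ') - linZ D.P (sh1110 h σ') := by
  rw [sh2100_moment h D h1, sh1110_moment h D h1]

/-- degree-3 shape law on the alphabet: `2·(Σ_N − Σ_P) m·a2100∘σ = 1·(Σ_N − Σ_P) m·a1110∘σ'`. -/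
theorem degThree_law_alphabet {h : ℤ} {D : Design} (hD : D.OnAlphabet h) (h1 : D.A1) (σ σ' : Equiv.Perm (Fin 4)) :
    2 * (linZ D.N (a2100 σ) - linZ D.P (a2100 σ)) = 1 * (linZ D.N (a1110 σ') - linZ D.P (a1110 σ')) := by
  rw [sh2100_moment_alpha hD h1, sh1110_moment_alpha hD h1]

/-- **degree-5 shape law**: the shapes `(2,2,1,0)∘σ` and `(2,1,1,1)∘σ'` have the same signed moment (`= Φ_5`), for all placements. -/
theorem degFive_law (h : ℤ) (D : Design) (h1 : D.A1) (σ σ' : Equiv.Perm (Fin 4)) :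
    linZ D.N (sh2210 h σ) - linZ D.P (sh2210 h σ) = linZ D.N (sh2111 h σ') - linZ D.P (sh2111 h σ') := by
  rw [sh2210_moment h D h1, sh2111_moment h D h1]

/-- degree-5 shape law on the alphabet: `4·(Σ_N − Σ_P) m·a2210∘σ = 2·(Σ_N − Σ_P) m·a2111∘σ'`. -/
theorem degFive_law_alphabet {h : ℤ} {D : Design} (hD : D.OnAlphabet h) (h1 : D.A1) (σ σ' : Equiv.Perm (Fin 4)) :
    4 * (linZ D.N (a2210 σ) - linZ D.P (a2210 σ)) = 2 * (linZ D.N (a2111 σ') - linZ D.P (a2111 σ')) := by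
  rw [sh2210_moment_alpha hD h1, sh2111_moment_alpha hD h1]

/-- **degree-6 shape law**: the shapes `(2,2,2,0)∘σ` and `(2,2,1,1)∘σ'` have the same signed moment (`= Φ_6`), for all placements. -/
theorem degSix_law (h : ℤ) (D : Design) (h1 : D.A1) (σ σ' : Equiv.Perm (Fin 4)) :
    linZ D.N (sh2220 h σ) - linZ D.P (sh2220 h σ) = linZ D.N (sh2211 h σ') - linZ D.P (sh2211 h σ') := by
  rw [sh2220_moment h D h1, sh2211_moment h D h1]

/-- degree-6 shape law on the alphabet: `8·(Σ_N − Σ_P) m·a2220∘σ = 4·(Σ_N − Σ_P) m·a2211∘σ'`. -/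
theorem degSix_law_alphabet {h : ℤ} {D : Design} (hD : D.OnAlphabet h) (h1 : D.A1) (σ σ' : Equiv.Perm (Fin 4)) :
    8 * (linZ D.N (a2220 σ) - linZ D.P (a2220 σ)) = 4 * (linZ D.N (a2211 σ') - linZ D.P (a2211 σ')) := by
  rw [sh2220_moment_alpha hD h1, sh2211_moment_alpha hD h1]

/-- **degree-7 shape law**: the shapes `(2,2,2,1)∘σ` and `(2,2,2,1)∘σ'` have the same signed moment (`= Φ_7`), for all placements. -/
theorem degSeven_law (h : ℤ) (D : Design) (h1 : D.A1) (σ σ' : Equiv.Perm (Fin 4)) :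
    linZ D.N (sh2221 h σ) - linZ D.P (sh2221 h σ) = linZ D.N (sh2221 h σ') - linZ D.P (sh2221 h σ') := by
  rw [sh2221_moment h D h1, sh2221_moment h D h1]

/-- degree-7 shape law on the alphabet: `8·(Σ_N − Σ_P) m·a2221∘σ = 8·(Σ_N − Σ_P) m·a2221∘σ'`. -/
theorem degSeven_law_alphabet {h : ℤ} {D : Design} (hD : D.OnAlphabet h) (h1 : D.A1) (σ σ' : Equiv.Perm (Fin 4)) :
    8 * (linZ D.N (a2221 σ) - linZ D.P (a2221 σ)) = 8 * (linZ D.N (a2221 σ') - linZ D.P (a2221 σ')) := by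
  rw [sh2221_moment_alpha hD h1, sh2221_moment_alpha hD h1]

end ShapeLaws

/-! ## §9 THE DECORATED e-ROW LAW — clause 1 of (A1) with arbitrary e-free decorations (every height, every ring)

Clause 1 kills every e-mixed word except `eeee ∕ ēēēē`.  Hence for every per-slot DECORATION pattern `p : Fin 4 → DS` with at
least one `e`/`ē` slot and not constantly `e` nor constantly `ē`, the functional `∏_f dval (p f)` — `e ↦ β̄`, `ē ↦ β`, `Q ↦ q_h`
(`= selfInt − 2h·a + h²`, on the alphabet `2|x||y|`), `C ↦ h − a` (`= col`), `I ↦ 1` — has EQUAL N- and P-moments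
(`decorated_row_law`).  These PHASE ROWS are invisible to every type-level LP (they cancel phase by phase) and are not implied by
the cube laws (which have no degree-2 factor).  Shell-3 readings (memo §8): `(e,ē,Q,Q)`: the `BBuu` P-cells at each slot pair have
phase-balanced complementary letters; `(e,C,Q,Q)`: `Σ_{P BBuu@pair} m·β̄_g = 0`; `(e,I,Q,Q)`: the third-letter phases of the
pair-carriers balance between N `BBHu` and P `BBuu ∕ ABBH ∕ BBBH ∕ BDHu ∕ BBHu`. -/

section DecoratedRows

open Summit.HodgeConjecture.HodgeConjecture.Cruxes.BlochSeedDiscOne.RingTwoMassLaw.CI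

/-- decoration symbols: `E` reads `β̄`, `Eb` reads `β`, `Q` reads `q_h`, `C` reads `h − a`, `I` reads `1`. -/
inductive DS where
  | E | Eb | Q | C | I
  deriving DecidableEq

def dE : Sym → GaussianInt
  | Sym.e => 1
  | Sym.ebar => 0
  | Sym.one => 0
  | Sym.h => 0
  | Sym.pt => 0

def dEb : Sym → GaussianInt
  | Sym.e => 0
  | Sym.ebar => 1
  | Sym.one => 0
  | Sym.h => 0
  | Sym.pt => 0

def dQ (h : ℤ) : Sym → GaussianInt
  | Sym.e => 0
  | Sym.ebar => 0
  | Sym.one => (h : GaussianInt) ^ 2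
  | Sym.h => -2 * (h : GaussianInt)
  | Sym.pt => 1

def dC (h : ℤ) : Sym → GaussianInt
  | Sym.e => 0
  | Sym.ebar => 0
  | Sym.one => (h : GaussianInt)
  | Sym.h => -1
  | Sym.pt => 0

def dI : Sym → GaussianInt
  | Sym.e => 0
  | Sym.ebar => 0
  | Sym.one => 1
  | Sym.h => 0
  | Sym.pt => 0

/-- the symbol table of a decoration. -/
def dtab (h : ℤ) : DS → Sym → GaussianInt
  | DS.E => dE
  | DS.Eb => dEb
  | DS.Q => dQ h
  | DS.C => dC h
  | DS.I => dI

/-- the letter value a decoration reads. -/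
def dval (h : ℤ) : DS → Letter → GaussianInt
  | DS.E, ℓ => star ℓ.beta
  | DS.Eb, ℓ => ℓ.beta
  | DS.Q, ℓ => ((qv h ℓ : ℤ) : GaussianInt)
  | DS.C, ℓ => (((h - ℓ.a) : ℤ) : GaussianInt)
  | DS.I, _ => 1

/-- the weight table of a decoration pattern. -/
def Ld (h : ℤ) (p : Fin 4 → DS) : Tab := fun f => dtab h (p f)

theorem read_d (h : ℤ) (d : DS) (ℓ : Letter) : ∑ s : Sym, dtab h d s * s.coef ℓ = dval h d ℓ := by
  rw [sum_sym]
  cases d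
  · simp [dtab, dE, dval, Sym.coef]
  · simp [dtab, dEb, dval, Sym.coef]
  · simp only [dtab, dQ, dval, Sym.coef, qv]
    push_cast
    ring
  · simp only [dtab, dC, dval, Sym.coef]
    push_cast
    ring
  · simp [dtab, dI, dval, Sym.coef]

theorem prod_G_Ld (h : ℤ) (p : Fin 4 → DS) (c : Cell) :
    ∏ f : Fin 4, G (Ld h p) f (c f) = ∏ f : Fin 4, dval h (p f) (c f) :=
  Finset.prod_congr rfl fun f _ => read_d h (p f) (c f)

theorem dE_efree {s : Sym} (hs : s.efree = true) : dE s = 0 := by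
  cases s <;> first | rfl | exact absurd hs (by decide)

theorem dEb_efree {s : Sym} (hs : s.efree = true) : dEb s = 0 := by
  cases s <;> first | rfl | exact absurd hs (by decide)

theorem killsEfree_Ld (h : ℤ) (p : Fin 4 → DS) (hmix : ∃ f, p f = DS.E ∨ p f = DS.Eb) : KillsEfree (Ld h p) := by
  intro w hw
  obtain ⟨f, hf⟩ := hmix
  unfold lamW
  apply Finset.prod_eq_zero (Finset.mem_univ f)
  unfold Ld
  rcases hf with hf | hf
  · rw [hf]; exact dE_efree (hw f)
  · rw [hf]; exact dEb_efree (hw f)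

theorem dtab_e_of_ne {h : ℤ} {d : DS} (hd : d ≠ DS.E) : dtab h d Sym.e = 0 := by
  cases d <;> first | exact absurd rfl hd | rfl

theorem dtab_ebar_of_ne {h : ℤ} {d : DS} (hd : d ≠ DS.Eb) : dtab h d Sym.ebar = 0 := by
  cases d <;> first | exact absurd rfl hd | rfl

theorem lamW_Ld_eeee (h : ℤ) (p : Fin 4 → DS) (hE : ∃ f, p f ≠ DS.E) : lamW (Ld h p) Word.eeee = 0 := by
  obtain ⟨f, hf⟩ := hE
  unfold lamW
  exact Finset.prod_eq_zero (Finset.mem_univ f) (by unfold Ld Word.eeee; exact dtab_e_of_ne hf)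

theorem lamW_Ld_EEEE (h : ℤ) (p : Fin 4 → DS) (hEb : ∃ f, p f ≠ DS.Eb) : lamW (Ld h p) Word.EEEE = 0 := by
  obtain ⟨f, hf⟩ := hEb
  unfold lamW
  exact Finset.prod_eq_zero (Finset.mem_univ f) (by unfold Ld Word.EEEE; exact dtab_ebar_of_ne hf)

/-- **THE DECORATED e-ROW LAW** (clause 1 only; every height, every ring): for every decoration pattern with an `e`/`ē` slot that
is not constantly `e` nor constantly `ē`, `Σ_N m·∏_f dval(p_f)(c_f) = Σ_P m·∏_f dval(p_f)(c_f)`. -/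
theorem decorated_row_law (h : ℤ) (D : Design) (hA : A1e D) (p : Fin 4 → DS)
    (hmix : ∃ f, p f = DS.E ∨ p f = DS.Eb) (hE : ∃ f, p f ≠ DS.E) (hEb : ∃ f, p f ≠ DS.Eb) :
    wsum D.N (fun c => ∏ f : Fin 4, dval h (p f) (c f)) = wsum D.P (fun c => ∏ f : Fin 4, dval h (p f) (c f)) := by
  have hx := expand (Ld h p) D
  rw [collapse (Ld h p) D (killsEfree_Ld h p hmix) hA, lamW_Ld_eeee h p hE, lamW_Ld_EEEE h p hEb] at hx
  simp only [zero_mul, add_zero, prod_G_Ld] at hx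
  exact (sub_eq_zero.mp hx.symm)

/-- a decoration pattern placed by a slot permutation: slot `σ i` carries `pv i`. -/
def dperm (pv : Fin 4 → DS) (σ : Equiv.Perm (Fin 4)) : Fin 4 → DS := fun f => pv (σ.symm f)

theorem prod_dval_perm (h : ℤ) (pv : Fin 4 → DS) (σ : Equiv.Perm (Fin 4)) (c : Cell) :
    ∏ f : Fin 4, dval h (dperm pv σ f) (c f)
      = dval h (pv 0) (c (σ 0)) * dval h (pv 1) (c (σ 1)) * dval h (pv 2) (c (σ 2)) * dval h (pv 3) (c (σ 3)) := by
  rw [← Equiv.prod_comp σ (fun f => dval h (dperm pv σ f) (c f))]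
  simp only [dperm, Equiv.symm_apply_apply, Fin.prod_univ_four]

/-- the decorated e-row law for a placed pattern, product written out: e.g. `pv = ![E, Eb, Q, Q]` gives
`Σ_N m·β̄(c_{σ0})·β(c_{σ1})·q(c_{σ2})·q(c_{σ3}) = Σ_P m·(same)` for every `σ`. -/
theorem decorated_row_law_perm (h : ℤ) (D : Design) (hA : A1e D) (pv : Fin 4 → DS) (σ : Equiv.Perm (Fin 4))
    (hmix : ∃ i, pv i = DS.E ∨ pv i = DS.Eb) (hE : ∃ i, pv i ≠ DS.E) (hEb : ∃ i, pv i ≠ DS.Eb) :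
    wsum D.N (fun c => dval h (pv 0) (c (σ 0)) * dval h (pv 1) (c (σ 1)) * dval h (pv 2) (c (σ 2)) * dval h (pv 3) (c (σ 3)))
      = wsum D.P (fun c => dval h (pv 0) (c (σ 0)) * dval h (pv 1) (c (σ 1)) * dval h (pv 2) (c (σ 2)) * dval h (pv 3) (c (σ 3))) := by
  have hm : ∃ f, dperm pv σ f = DS.E ∨ dperm pv σ f = DS.Eb := by
    obtain ⟨i, hi⟩ := hmix; exact ⟨σ i, by simpa [dperm] using hi⟩
  have h2 : ∃ f, dperm pv σ f ≠ DS.E := by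
    obtain ⟨i, hi⟩ := hE; exact ⟨σ i, by simpa [dperm] using hi⟩
  have h3 : ∃ f, dperm pv σ f ≠ DS.Eb := by
    obtain ⟨i, hi⟩ := hEb; exact ⟨σ i, by simpa [dperm] using hi⟩
  have key := decorated_row_law h D hA (dperm pv σ) hm h2 h3
  simp only [prod_dval_perm] at key
  exact key

/-- the six phase rows used at shell 3 (memo §8), as instances: `(e,ē,Q,Q)`, `(e,e,Q,Q)`, `(e,C,Q,Q)`, `(e,I,Q,Q)`, `(e,ē,Q,I)`,
`(e,ē,C,C)` — each for every placement `σ`. -/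
theorem phase_rows (h : ℤ) (D : Design) (hA : A1e D) (σ : Equiv.Perm (Fin 4)) :
    (wsum D.N (fun c => star (c (σ 0)).beta * (c (σ 1)).beta * ((qv h (c (σ 2)) : ℤ) : GaussianInt) * ((qv h (c (σ 3)) : ℤ) : GaussianInt))
      = wsum D.P (fun c => star (c (σ 0)).beta * (c (σ 1)).beta * ((qv h (c (σ 2)) : ℤ) : GaussianInt) * ((qv h (c (σ 3)) : ℤ) : GaussianInt)))
    ∧ (wsum D.N (fun c => star (c (σ 0)).beta * star (c (σ 1)).beta * ((qv h (c (σ 2)) : ℤ) : GaussianInt) * ((qv h (c (σ 3)) : ℤ) : GaussianInt))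
      = wsum D.P (fun c => star (c (σ 0)).beta * star (c (σ 1)).beta * ((qv h (c (σ 2)) : ℤ) : GaussianInt) * ((qv h (c (σ 3)) : ℤ) : GaussianInt)))
    ∧ (wsum D.N (fun c => star (c (σ 0)).beta * (((h - (c (σ 1)).a) : ℤ) : GaussianInt) * ((qv h (c (σ 2)) : ℤ) : GaussianInt) * ((qv h (c (σ 3)) : ℤ) : GaussianInt))
      = wsum D.P (fun c => star (c (σ 0)).beta * (((h - (c (σ 1)).a) : ℤ) : GaussianInt) * ((qv h (c (σ 2)) : ℤ) : GaussianInt) * ((qv h (c (σ 3)) : ℤ) : GaussianInt)))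
    ∧ (wsum D.N (fun c => star (c (σ 0)).beta * 1 * ((qv h (c (σ 2)) : ℤ) : GaussianInt) * ((qv h (c (σ 3)) : ℤ) : GaussianInt))
      = wsum D.P (fun c => star (c (σ 0)).beta * 1 * ((qv h (c (σ 2)) : ℤ) : GaussianInt) * ((qv h (c (σ 3)) : ℤ) : GaussianInt)))
    ∧ (wsum D.N (fun c => star (c (σ 0)).beta * (c (σ 1)).beta * ((qv h (c (σ 2)) : ℤ) : GaussianInt) * 1)
      = wsum D.P (fun c => star (c (σ 0)).beta * (c (σ 1)).beta * ((qv h (c (σ 2)) : ℤ) : GaussianInt) * 1))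
    ∧ (wsum D.N (fun c => star (c (σ 0)).beta * (c (σ 1)).beta * (((h - (c (σ 2)).a) : ℤ) : GaussianInt) * (((h - (c (σ 3)).a) : ℤ) : GaussianInt))
      = wsum D.P (fun c => star (c (σ 0)).beta * (c (σ 1)).beta * (((h - (c (σ 2)).a) : ℤ) : GaussianInt) * (((h - (c (σ 3)).a) : ℤ) : GaussianInt))) := by
  refine ⟨?_, ?_, ?_, ?_, ?_, ?_⟩
  · exact decorated_row_law_perm h D hA ![DS.E, DS.Eb, DS.Q, DS.Q] σ ⟨0, by decide⟩ ⟨1, by decide⟩ ⟨0, by decide⟩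
  · exact decorated_row_law_perm h D hA ![DS.E, DS.E, DS.Q, DS.Q] σ ⟨0, by decide⟩ ⟨2, by decide⟩ ⟨0, by decide⟩
  · exact decorated_row_law_perm h D hA ![DS.E, DS.C, DS.Q, DS.Q] σ ⟨0, by decide⟩ ⟨1, by decide⟩ ⟨0, by decide⟩
  · exact decorated_row_law_perm h D hA ![DS.E, DS.I, DS.Q, DS.Q] σ ⟨0, by decide⟩ ⟨1, by decide⟩ ⟨0, by decide⟩
  · exact decorated_row_law_perm h D hA ![DS.E, DS.Eb, DS.Q, DS.I] σ ⟨0, by decide⟩ ⟨1, by decide⟩ ⟨0, by decide⟩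
  · exact decorated_row_law_perm h D hA ![DS.E, DS.Eb, DS.C, DS.C] σ ⟨0, by decide⟩ ⟨1, by decide⟩ ⟨0, by decide⟩

end DecoratedRows

/-! ## §10 THE PHASE-LATTICE LAW `4 ∣ T` (pure integer lemma behind the shell-3 reading of §9)

Index the unit phases by `ℤ/4` (`ζ = i^a`).  If an integer mass table `x a b` on `μ₄ × μ₄` has vanishing character sums at
`(1,0)`, `(0,1)`, `(1,1)` and `(−1,1)` — written below as the equalities of the antipodal ROW sums `X_a = X_{a+2}`, COLUMN sums
`Y_b = Y_{b+2}`, DIAGONAL sums `Z_c = Z_{c+2}` (`a + b ≡ c`) and ANTIDIAGONAL sums `W_c = W_{c+2}` (`b − a ≡ c`) — then its total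
mass is divisible by 4 (`phase_lattice_four`; proof: the rows' dipoles alternate in sign, so `X_0 ≡ X_1 (mod 2)`; the
imaginary part `W_1 = W_3` of the antidiagonal sum is not even needed).  At shell 3 the
rows `(e,C,Q,Q)`, `(ē,C,Q,Q)`… of §9 put the P `BBuu` masses of one slot pair in exactly this position (memo §9), so
`4 ∣ m_P(BBuu@pair) = 2b`: the b-law's `b` is even.  Nonnegativity is not needed. -/

section PhaseLattice

/-- **phase-lattice law**: vanishing character sums at `(1,0), (0,1), (1,1), (−1,1)` force `4 ∣ total mass`. -/
theorem phase_lattice_four (x : Fin 4 → Fin 4 → ℤ)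
    (hX0 : x 0 0 + x 0 1 + x 0 2 + x 0 3 = x 2 0 + x 2 1 + x 2 2 + x 2 3)
    (hX1 : x 1 0 + x 1 1 + x 1 2 + x 1 3 = x 3 0 + x 3 1 + x 3 2 + x 3 3)
    (hY0 : x 0 0 + x 1 0 + x 2 0 + x 3 0 = x 0 2 + x 1 2 + x 2 2 + x 3 2)
    (hY1 : x 0 1 + x 1 1 + x 2 1 + x 3 1 = x 0 3 + x 1 3 + x 2 3 + x 3 3)
    (hZ0 : x 0 0 + x 1 3 + x 2 2 + x 3 1 = x 0 2 + x 1 1 + x 2 0 + x 3 3)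
    (hZ1 : x 0 1 + x 1 0 + x 2 3 + x 3 2 = x 0 3 + x 1 2 + x 2 1 + x 3 0)
    (hW0 : x 0 0 + x 1 1 + x 2 2 + x 3 3 = x 0 2 + x 1 3 + x 2 0 + x 3 1) :
    (4 : ℤ) ∣ x 0 0 + x 0 1 + x 0 2 + x 0 3 + x 1 0 + x 1 1 + x 1 2 + x 1 3 + x 2 0 + x 2 1 + x 2 2 + x 2 3 + x 3 0 + x 3 1 + x 3 2 + x 3 3 := by
  omega

end PhaseLattice

/-! ## §11 CONSUMER FORMS OF THE SHAPE LAWS UNDER SUPPORT HYPOTHESES (v9; height/shell-free; made for gs-eng-2's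
support-level facts (A) «no N off-axis hook» and (B) «no P two-off-axis hub-free cell» at shell 3)

`a2220 σ c = |x||y|_{σ0}·|x||y|_{σ1}·|x||y|_{σ2}` vanishes iff `c` is NOT off-axis at all three slots; `a2211 σ' c` vanishes iff
`c` is not (off-axis at σ'0, σ'1 AND charged at σ'2, σ'3); `a2111 σ' c` vanishes iff `c` is not (off-axis at σ'0 and charged at
the other three); `a2210 σ c = |x||y|_{σ0}|x||y|_{σ1}·col_{σ2}`.  All four are ≥ 0, so a vanishing `linZ` over a side means the
functional vanishes on every counted cell of that side (`vanish_of_linZ_eq_zero`).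
* `offaxis_triple_free` (the b-law as an EXCLUSION): if no N cell is off-axis on the triple `σ{0,1,2}`, and no cell on either
  side is «off-axis at σ'0,σ'1 & charged at σ'2,σ'3», then NO P cell is off-axis on the triple `σ{0,1,2}`.  At shell 3 with
  gs-eng-2 (B) (no P `BBuu`): **P has no `BBBH` cell** — a mass-level consequence the support-level door pruning does not see.
* `hook_slot_law` / `offaxis_pair_col_le`: if no N cell is «off-axis at σ'0 & charged at σ'1,σ'2,σ'3» (gs-eng-2 (A): no N
  B-hook), then `2·Σ_P m·a2111∘σ' = 4·(Σ_P − Σ_N) m·a2210∘σ` for ALL σ, σ' — so the P off-axis hooks are slot-equidistributed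
  (weights Buuu 1, Duuu/ABuu/BBuu 2) and `Σ_N m·a2210∘σ ≤ Σ_P m·a2210∘σ` at every placement (shell 3: N[BBHu]_{kl;g} ≤
  P[2ABBH + 2BBBH + BBHu + BBuu + 2BDHu]_{kl;g}), with equality everywhere iff P has no off-axis hook either. -/

section Consumers

theorem linZ_eq_zero_of_vanish (L : List (Cell × ℕ)) (φ : Cell → ℤ) (h : ∀ cm ∈ L, 0 < cm.2 → φ cm.1 = 0) :
    linZ L φ = 0 := by
  rw [linZ_congr' L φ (fun _ => 0) h]
  unfold linZ; simp

theorem a2220_nonneg (σ : Equiv.Perm (Fin 4)) (c : Cell) : 0 ≤ a2220 σ c := by unfold a2220; positivity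
theorem a2211_nonneg (σ : Equiv.Perm (Fin 4)) (c : Cell) : 0 ≤ a2211 σ c := by
  unfold a2211 Letter.colevel; positivity
theorem a2210_nonneg (σ : Equiv.Perm (Fin 4)) (c : Cell) : 0 ≤ a2210 σ c := by
  unfold a2210 Letter.colevel; positivity
theorem a2111_nonneg (σ : Equiv.Perm (Fin 4)) (c : Cell) : 0 ≤ a2111 σ c := by
  unfold a2111 Letter.colevel; positivity

/-- a nonnegative functional with vanishing `linZ` vanishes on every counted cell. -/
theorem vanish_of_linZ_eq_zero (L : List (Cell × ℕ)) (φ : Cell → ℤ) (hφ : ∀ c, 0 ≤ φ c) (h0 : linZ L φ = 0)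
    {c : Cell} {m : ℕ} (hm : (c, m) ∈ L) (hp : 0 < m) : φ c = 0 := by
  by_contra hne
  have hpos : 0 < φ c := lt_of_le_of_ne (hφ c) (Ne.symm hne)
  have := linZ_pos L φ (fun cm _ _ => hφ cm.1) (cm := (c, m)) hm hp hpos
  omega

/-- N-side support hypothesis ⇒ vanishing N-`linZ`. -/
theorem linZ_N_eq_zero_of_supp (D : Design) (φ : Cell → ℤ) (h : ∀ c ∈ D.suppN, φ c = 0) : linZ D.N φ = 0 :=
  linZ_eq_zero_of_vanish D.N φ fun cm hm hp => h cm.1 ((mem_suppN_iff D cm.1).mpr ⟨cm.2, hm, hp⟩)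

/-- P-side support hypothesis ⇒ vanishing P-`linZ`. -/
theorem linZ_P_eq_zero_of_supp (D : Design) (φ : Cell → ℤ) (h : ∀ c ∈ D.suppP, φ c = 0) : linZ D.P φ = 0 :=
  linZ_eq_zero_of_vanish D.P φ fun cm hm hp => h cm.1 ((mem_suppP_iff D cm.1).mpr ⟨cm.2, hm, hp⟩)

/-- **off-axis triple exclusion** (the degree-6 shape law as a consumer statement): no N off-axis triple on `σ{0,1,2}` and no
«off-axis pair + charged co-pair» cell on either side (placement `σ'`) ⇒ no P off-axis triple on `σ{0,1,2}`. -/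
theorem offaxis_triple_free {h : ℤ} {D : Design} (hD : D.OnAlphabet h) (h1 : D.A1) (σ σ' : Equiv.Perm (Fin 4))
    (hN3 : ∀ c ∈ D.suppN, a2220 σ c = 0) (hN22 : ∀ c ∈ D.suppN, a2211 σ' c = 0)
    (hP22 : ∀ c ∈ D.suppP, a2211 σ' c = 0) : ∀ c ∈ D.suppP, a2220 σ c = 0 := by
  have hlaw := degSix_law_alphabet hD h1 σ σ'
  rw [linZ_N_eq_zero_of_supp D _ hN3, linZ_N_eq_zero_of_supp D _ hN22, linZ_P_eq_zero_of_supp D _ hP22] at hlaw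
  have hP3 : linZ D.P (a2220 σ) = 0 := by omega
  intro c hc
  obtain ⟨m, hm, hp⟩ := (mem_suppP_iff D c).mp hc
  exact vanish_of_linZ_eq_zero D.P (a2220 σ) (a2220_nonneg σ) hP3 hm hp

/-- **hook slot law**: with no N off-axis hook at placement `σ'` (gs-eng-2 (A)), the P off-axis hooks at `σ'` are tied to the
off-axis-pair/col functional at EVERY placement `σ`: `2·Σ_P m a2111∘σ' = 4·(Σ_P − Σ_N) m a2210∘σ`. -/
theorem hook_slot_law {h : ℤ} {D : Design} (hD : D.OnAlphabet h) (h1 : D.A1) (σ σ' : Equiv.Perm (Fin 4))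
    (hN : ∀ c ∈ D.suppN, a2111 σ' c = 0) :
    2 * linZ D.P (a2111 σ') = 4 * (linZ D.P (a2210 σ) - linZ D.N (a2210 σ)) := by
  have hlaw := degFive_law_alphabet hD h1 σ σ'
  rw [linZ_N_eq_zero_of_supp D _ hN] at hlaw
  omega

/-- corollary: with no N off-axis hook anywhere... at ONE placement `σ'`, `Σ_N m a2210∘σ ≤ Σ_P m a2210∘σ` at every `σ`. -/
theorem offaxis_pair_col_le {h : ℤ} {D : Design} (hD : D.OnAlphabet h) (h1 : D.A1) (σ σ' : Equiv.Perm (Fin 4))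
    (hN : ∀ c ∈ D.suppN, a2111 σ' c = 0) : linZ D.N (a2210 σ) ≤ linZ D.P (a2210 σ) := by
  have hlaw := hook_slot_law hD h1 σ σ' hN
  have hP : 0 ≤ linZ D.P (a2111 σ') := linZ_nonneg D.P _ fun cm _ _ => a2111_nonneg σ' cm.1
  omega

/-- and the P hooks are slot-equidistributed: `Σ_P m a2111∘σ' = Σ_P m a2111∘σ''` whenever N has no hook at both placements. -/
theorem hook_equidistributed {h : ℤ} {D : Design} (hD : D.OnAlphabet h) (h1 : D.A1) (σ' σ'' : Equiv.Perm (Fin 4))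
    (hN' : ∀ c ∈ D.suppN, a2111 σ' c = 0) (hN'' : ∀ c ∈ D.suppN, a2111 σ'' c = 0) :
    linZ D.P (a2111 σ') = linZ D.P (a2111 σ'') := by
  have h' := hook_slot_law hD h1 1 σ' hN'
  have h'' := hook_slot_law hD h1 1 σ'' hN''
  omega

/-- equality case: if P has no off-axis hook at `σ'` either, the off-axis-pair/col masses AGREE on the two sides at every `σ`
(shell 3 under (A)+(D-kills-P-Buuu)+(B): N[BBHu]_{kl;g} = P[2ABBH + BBHu + 2BDHu]_{kl;g}). -/
theorem offaxis_pair_col_eq {h : ℤ} {D : Design} (hD : D.OnAlphabet h) (h1 : D.A1) (σ σ' : Equiv.Perm (Fin 4))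
    (hN : ∀ c ∈ D.suppN, a2111 σ' c = 0) (hP : ∀ c ∈ D.suppP, a2111 σ' c = 0) :
    linZ D.N (a2210 σ) = linZ D.P (a2210 σ) := by
  have hlaw := hook_slot_law hD h1 σ σ' hN
  rw [linZ_P_eq_zero_of_supp D _ hP] at hlaw
  omega

/-! ### §11b  Branch riders under «every off-axis-bearing cell has a hub» (gs-eng-2 (A) on N, (B)+(D) on P)
`pHookedHub_of_E_le`: in Branch β (`E ≤ −8`), if every P cell carrying an off-axis letter also carries a hub (shell 3: (B) «hub-free
P ⊆ {u⁴, Auuu, Buuu, AAuu, AAAu, AAAA}» plus «no P Buuu»), then for EVERY slot `k` and every pair `{f,g}` of other slots the P side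
contains a cell that is off-axis at `k`, hub-free at `f,g` and has a HUB at the remaining slot — twelve support-level existence
clauses (the rider R-B′-dual for s4 / gs-eng-2).  `nHookedHub_of_le_E` is the mirror statement for Branch α under (A). -/

theorem colevel_pos_of_offaxis {ℓ : Letter} (hx : ℓ.x ≠ 0) : 0 < ℓ.colevel := by
  unfold Letter.colevel
  have := abs_pos.mpr hx
  have := abs_nonneg ℓ.y
  linarith

/-- **Branch β rider**: P off-axis carriers are hooked to a hub, at every (k; f, g). -/
theorem pHookedHub_of_E_le {h : ℤ} {D : Design} (hD : D.OnAlphabet h) (h1 : D.A1) (hE : E h D ≤ -8)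
    (hB : ∀ c ∈ D.suppP, (∃ k : Fin 4, (c k).x ≠ 0 ∧ (c k).y ≠ 0) → ∃ j : Fin 4, (c j).colevel = 0)
    {k f g : Fin 4} (hkf : k ≠ f) (hkg : k ≠ g) (hfg : f ≠ g) :
    ∃ cm ∈ D.P, 0 < cm.2 ∧ ((cm.1 k).x ≠ 0 ∧ (cm.1 k).y ≠ 0) ∧ (0 < (cm.1 f).colevel ∧ 0 < (cm.1 g).colevel) ∧
      ∃ j : Fin 4, j ≠ k ∧ j ≠ f ∧ j ≠ g ∧ (cm.1 j).colevel = 0 := by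
  obtain ⟨cm, hm, hp, hk, hf, hg⟩ := pMixedCarrier_of_E_le hD h1 hE hkf hkg hfg
  have hc : cm.1 ∈ D.suppP := (mem_suppP_iff D cm.1).mpr ⟨cm.2, hm, hp⟩
  obtain ⟨j, hj⟩ := hB cm.1 hc ⟨k, hk⟩
  refine ⟨cm, hm, hp, hk, ⟨hf, hg⟩, j, ?_, ?_, ?_, hj⟩
  · rintro rfl; have := colevel_pos_of_offaxis hk.1; omega
  · rintro rfl; omega
  · rintro rfl; omega

/-- **Branch α rider**: N off-axis carriers are hooked to a hub, at every (k; f, g). -/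
theorem nHookedHub_of_le_E {h : ℤ} {D : Design} (hD : D.OnAlphabet h) (h1 : D.A1) (hE : 8 ≤ E h D)
    (hA : ∀ c ∈ D.suppN, (∃ k : Fin 4, (c k).x ≠ 0 ∧ (c k).y ≠ 0) → ∃ j : Fin 4, (c j).colevel = 0)
    {k f g : Fin 4} (hkf : k ≠ f) (hkg : k ≠ g) (hfg : f ≠ g) :
    ∃ cm ∈ D.N, 0 < cm.2 ∧ ((cm.1 k).x ≠ 0 ∧ (cm.1 k).y ≠ 0) ∧ (0 < (cm.1 f).colevel ∧ 0 < (cm.1 g).colevel) ∧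
      ∃ j : Fin 4, j ≠ k ∧ j ≠ f ∧ j ≠ g ∧ (cm.1 j).colevel = 0 := by
  obtain ⟨cm, hm, hp, hk, hf, hg⟩ := nMixedCarrier_of_le_E hD h1 hE hkf hkg hfg
  have hc : cm.1 ∈ D.suppN := (mem_suppN_iff D cm.1).mpr ⟨cm.2, hm, hp⟩
  obtain ⟨j, hj⟩ := hA cm.1 hc ⟨k, hk⟩
  refine ⟨cm, hm, hp, hk, ⟨hf, hg⟩, j, ?_, ?_, ?_, hj⟩
  · rintro rfl; have := colevel_pos_of_offaxis hk.1; omega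
  · rintro rfl; omega
  · rintro rfl; omega


/-! ### §11c  The Branch-β DICHOTOMY from the hub-free cover (B′ ⇒ E ≤ −16 or N has a hub-free cell)
`E = Σ_N m·dep − Σ_P m·dep` (`dep h c = ∏_f (h − a_f)` = the product of co-levels on the alphabet, > 0 exactly on hub-free cells)
and `8 ∣ E`.  So in Branch β either `E ≤ −16` (pair excess ≥ 4 at all six pairs, mixed excess ≥ 8 at all twelve triples) or
`E = −8` and `Σ_N m·dep = Σ_P m·dep − 8`; with the B′ cover floor `Σ_P m·dep ≥ 9` (anomaly's ≥ 10 distinct hub-free P cells mod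
gs-eng-2 (B)) the second case puts a HUB-FREE cell on the N side (`hubfreeN_of_E_eq`) — under (A) an N `u⁴` or `Auuu`, whose fine
atom gs-eng-2 (C) measures at > 45 resp. > 78 cells. -/

theorem E_eq_dep (h : ℤ) (D : Design) : E h D = linZ D.N (dep h) - linZ D.P (dep h) := rfl

theorem E_dichotomy {h : ℤ} {D : Design} (hD : D.OnAlphabet h) (h1 : D.A1) (hE : E h D < 0) :
    E h D ≤ -16 ∨ (E h D = -8 ∧ linZ D.N (dep h) = linZ D.P (dep h) - 8) := by
  obtain ⟨q, hq⟩ := (lattice_digits hD (a1e_of_a1 D h1)).1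
  have := E_eq_dep h D
  omega

theorem dep_eq_prod_colevel {h : ℤ} {c : Cell} (hc : ∀ f : Fin 4, (c f).OnAlphabet h) :
    dep h c = ∏ f : Fin 4, (c f).colevel := by
  unfold dep
  exact Finset.prod_congr rfl fun f _ => col_eq (hc f)

theorem dep_nonneg_alphabet {h : ℤ} {c : Cell} (hc : ∀ f : Fin 4, (c f).OnAlphabet h) : 0 ≤ dep h c := by
  rw [dep_eq_prod_colevel hc]
  exact Finset.prod_nonneg fun f _ => by unfold Letter.colevel; positivity

theorem colevel_pos_of_dep_pos {h : ℤ} {c : Cell} (hc : ∀ f : Fin 4, (c f).OnAlphabet h) (hpos : 0 < dep h c)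
    (f : Fin 4) : 0 < (c f).colevel := by
  rw [dep_eq_prod_colevel hc] at hpos
  have h0 : 0 ≤ (c f).colevel := by unfold Letter.colevel; positivity
  rcases h0.lt_or_eq with hlt | heq
  · exact hlt
  · exfalso
    have : ∏ g : Fin 4, (c g).colevel = 0 := Finset.prod_eq_zero (Finset.mem_univ f) heq.symm
    omega

/-- **B′ with `E = −8` and a P hub-free cover of dep-weight ≥ 9 has a hub-free N cell.** -/
theorem hubfreeN_of_E_eq {h : ℤ} {D : Design} (hD : D.OnAlphabet h) (hE : E h D = -8)
    (hcov : 9 ≤ linZ D.P (dep h)) : ∃ cm ∈ D.N, 0 < cm.2 ∧ ∀ f : Fin 4, 0 < (cm.1 f).colevel := by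
  have hN : 0 < linZ D.N (dep h) := by have := E_eq_dep h D; omega
  obtain ⟨cm, hm, hp, hpos⟩ := exists_pos_of_linZ_pos _ _ hN
  exact ⟨cm, hm, hp, colevel_pos_of_dep_pos (onAlphabet_of_N hD hm hp) hpos⟩

/-- the same dichotomy stated at once: Branch β + P dep-weight ≥ 9 ⇒ `E ≤ −16` or a hub-free N cell. -/
theorem branchB_dichotomy {h : ℤ} {D : Design} (hD : D.OnAlphabet h) (h1 : D.A1) (hE : E h D < 0)
    (hcov : 9 ≤ linZ D.P (dep h)) :
    E h D ≤ -16 ∨ ∃ cm ∈ D.N, 0 < cm.2 ∧ ∀ f : Fin 4, 0 < (cm.1 f).colevel := by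
  rcases E_dichotomy hD h1 hE with h16 | ⟨h8, _⟩
  · exact Or.inl h16
  · exact Or.inr (hubfreeN_of_E_eq hD h8 hcov)

/-- and in the `E ≤ −16` case the pair excess is ≥ 4 at every slot pair and the mixed excess ≥ 8 at every slot triple. -/
theorem excess_of_E_le_sixteen {h : ℤ} {D : Design} (hD : D.OnAlphabet h) (h1 : D.A1) (hE : E h D ≤ -16) {k f g : Fin 4}
    (hkf : k ≠ f) (hkg : k ≠ g) (hfg : f ≠ g) :
    linZ D.N (pw k f) + 4 ≤ linZ D.P (pw k f) ∧ linZ D.N (pm k f g) + 8 ≤ linZ D.P (pm k f g) := by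
  have h1' := pair_law_alphabet hD h1 hkf
  have h2' := mid_law_alphabet hD h1 hkf hkg hfg
  constructor <;> omega


end Consumers

end Summit.HodgeConjecture.HodgeConjecture.Cruxes.BlochSeedDiscOne.ShellThreePairLaw
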